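import Literature.NumberTheory.LFunctions.CertifiedZetaIsolationBounds
import Mathlib.Analysis.SpecialFunctions.ImproperIntegrals
import Literature.Analysis.Complex.VerticalLineShift
import Literature.Analysis.Complex.MellinBarnesShift
import Literature.NumberTheory.LFunctions.ZetaConvexityExplicit
import Literature.NumberTheory.LFunctions.EulerMaclaurinZeta
import HarnessLib

/-!
# Platt 2017, *Isolating some non-trivial zeros of zeta*, Appendix A: the aliasing errors of
# steps (4), (5), (6) and of the up-sampling — Lemma A.6 (both shifts of the line of integration,
# proved: the right shift `u ≥ 0` exactly as displayed, the left shift `u < 0` up to its last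
# sentence), Lemma A.8 (the shift across the pole of `ζ`, proved for `x ≥ 0`), Lemma B.1 (proved),
# Lemmas A.7, A.9, C.1 (summation / integration step, their pointwise inputs as hypotheses)

Topic `Literature/NumberTheory/LFunctions`; namespace `Literature.NumberTheory.LFunctions`, engine
sub-namespace `Platt2017`. Source: D. J. Platt, *Isolating some non-trivial zeros of zeta*, Math. Comp.
**86** (2017), no. 307, 2449–2467 [Platt2017] (journal pdf held as
`paper:platt2017-isolating-some-non-trivial-zeros-zeta`; Appendix A pp. 2456–2463). Companion of
`CertifiedZetaIsolationBounds.lean` (Lemmas A.1–A.5, A.10, A.11, B.2, C.2, C.3 of the same appendix;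
that file reached the proposal size limit, hence this second module). Typed for the parity-realchar
cell (D-0088 (4) literature-typing layer, row «Platt 2016 / Platt–Trudgian 2021 / Booker 2006»:
instrument provenance of the Platt–Trudgian verification `platt_trudgian_numerical_rh`). Everything in
this file is PROVED (kernel lane): no definitions, no named facts.

## The statements (pp. 2460–2462, verbatim) and what is proved

In the algorithm of §3 (p. 2451) step (4) replaces `G^{(k)}` — the Fourier transform of
`g(t;k) = Γ((1/2+i(t+t₀))/2) exp(π(t+t₀)/4 − t²/(2h²)) (−2πit)^k` — by its `A`-periodisation
`G̃^{(k)}(m) = Σ_l G^{(k)}(m/B + lA)`, and step (6) replaces `F` (the Fourier transform of `f`,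
(3.1)) by `F̃(n) = Σ_l F(n/B + lA)`. The two errors are lattice sums over `l ≠ 0`:

* **Lemma A.6** (p. 2460). «Let `σ ∈ 2ℤ_{>0} + 1`. Then `G^{(k)}(u)` is
  bounded in absolute terms by `C(σ,t₀,h,k) exp((2σ+1)²/(8h²) − (2σ−1)π|u|)
  + 2^{k+2} π^{k+1} exp(−t₀²/(2h²)) Σ_{l=0}^{(σ−1)/2} ((2l+1/2)² + t₀²)^{k/2}/l! ·
  exp((4l+1)²/(8h²) − (4l+1)π|u|)`. *Proof.* First we consider `u ≥ 0`. We write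
  `|G^{(k)}(u)| = |∫ Γ((1/2+i(t+t₀))/2) exp(π(t+t₀)/4 − t²/(2h²)) (−2πit)^k e(−tu) dt|`. Substituting
  `s = 1/2 + i(t+t₀)`, we now move the line of integration right to `ℜ(s) = σ` giving
  (A.1) `|G^{(k)}(u)| ≤ exp((2σ−1)²/(8h²) − πu(2σ−1)) (2π)^k ∫ |Γ((σ+i(t+t₀))/2) exp(π(t+t₀)/4)
  exp(−t²/(2h²)) (1/2−σ−it)^k| dt`. For `u < 0`, we move the line of integration left to `ℜ(s) = −σ`,
  picking up the poles of `Γ(s/2)` at `s = 0, −2, …, 1−σ`. …» — `platt2017_lemmaA6_right`: **THE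
  RIGHT SHIFT (display (A.1), every `u ≥ 0`) PROVED**, for every real `σ ≥ 1/2` (the Fourier integral
  of `g(t;k) e(−tu)` written out; the right-hand integral is `≤ C(σ,t₀,h,k)/(2π)^k` of Lemma A.3 since
  `|1/2−σ−it| ≤ |1/2+σ−it|`). Engine (`Platt2017.*`): the continued integrand
  `Ψ(s) = Γ(s/2) e^{π(τ+t₀)/4} e^{−τ²/(2h²)} (−2πiτ)^k e^{−2πiτu}`, `τ = −i(s−1/2) − t₀`
  (`fourier_kernel_eq`: `Ψ(1/2+i(t+t₀)) = g(t;k)e(−tu)`), holomorphic on `Re s > 0`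
  (`differentiableAt_fourier_kernel`), its modulus (`norm_fourier_kernel`), a uniform Gaussian
  majorant `K e^{−(y−t₁)²/(4h²)}` on the strip `1/2 ≤ Re s ≤ σ`, `t₁ = t₀ + πh²/4`
  (`norm_fourier_kernel_le`: `|Γ| ≤ Γ(Re)` and convexity of `Γ`, completing the square, and
  `(v+d)^k e^{−v²/(4h²)} ≤ k! e^{d+h²}`), hence integrability on the vertical lines and uniform decay
  on the horizontal segments (`integrable_fourier_kernel_vertical`, `decay_fourier_kernel`) — the
  hypotheses of the tree's `Literature.Analysis.Complex.integral_vertical_eq_of_differentiableOn`,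
  which performs «move the line of integration right» — and the exact modulus on `Re s = σ`
  (`norm_fourier_kernel_far`). — `platt2017_lemmaA6_left`: **THE LEFT SHIFT PROVED up to the last
  sentence**: for `σ = 2m+1` and every `u`, `|G^{(k)}(u)| ≤` «the integral which remains»
  `(2π)^k e^{(2σ+1)²/(8h²) + (2σ+1)πu} ∫ |Γ((−σ+i(t+t₀))/2) e^{π(t+t₀)/4 − t²/(2h²)} (σ+1/2−it)^k| dt`
  `+` «the contribution of the poles» `2^{k+2} π^{k+1} e^{−t₀²/(2h²)} Σ_{l=0}^{m} ((2l+1/2)²+t₀²)^{k/2}/l!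
  · e^{(4l+1)²/(8h²) + (4l+1)πu}`, BOTH EXACTLY AS PRINTED. Engine: `u`-free strip bounds
  (`norm_fourier_kernel_le'`, `integrable_fourier_kernel_vertical'`, `decay_fourier_kernel'`,
  `integral_fourier_kernel_shift`), the Mellin–Barnes form `Ψ(2z) = Φ(z) w^{−z} Γ(z)`, `w = e^{4πu}`,
  `Φ` entire (`fourier_kernel_two_mul`, `differentiable_fourier_cofactor`, `norm_fourier_cofactor`,
  `norm_fourier_cofactor_le`, `norm_fourier_cofactor_le_of_abs_le` — `Φ` is BOUNDED on vertical
  strips, so the finite-order hypothesis is trivial), the tree's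
  `Literature.Analysis.Complex.mellinBarnes_shift_eq_sum` (line `Re z = 3/2`, i.e. `Re s = 3`, reached
  first by the pole-free shift, then moved to `Re z = −m−1/2`, i.e. `Re s = −σ`, across the simple
  poles `z = 0, …, −m` of `Γ`: residues `(−1)^j Φ(−j) w^j/j!`), `residue_term_eq`
  (`4π|Φ(−j)|w^j/j!` = the printed `j`-th term) and `norm_fourier_kernel_far_left`. NOT typed: the
  printed last sentence «for our range of σ and for t ∈ ℝ, we have |Γ(−σ/2+it)| < |Γ(σ/2+it)| and the
  result follows» — false as printed at small `|t|` (`Γ(−3/2) = 4√π/3 ≈ 2.36 > Γ(3/2) ≈ 0.89`; true for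
  `|t| ≥ 1` by `Γ(z) = Γ(z+σ)/∏_{j<σ}(z+j)`), so the final packaging of the left-shift integral into
  `C(σ,t₀,h,k) exp((2σ+1)²/(8h²) − (2σ−1)π|u|)` is left to the user of `platt2017_lemmaA7_of_bound`
  (whose hypothesis is the printed two-sided form).
* **Lemma A.7** (pp. 2460–2461). «Let `m ∈ [0, N/2]` and `σ ∈ 2ℤ_{>0} + 1`. Then we have
  `|Σ_{l∈ℤ≠0} G^{(k)}(m/B + lA)| ≤ 2^{k+3} π^{k+1} exp(−t₀²/(2h²)) S
  + 2(1 + 1/(Aπ(2σ−1))) C(σ,t₀,h,k) exp((2σ+1)²/(8h²) − Aπ(2σ−1)/2)`, where `S` is the sum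
  `Σ_{l=0}^{(σ−1)/2} (1 + 1/(Aπ(4l+1))) ((2l+1/2)² + t₀²)^{k/2}/l! · exp((4l+1)²/(8h²) − Aπ(4l+1)/2)`.
  *Proof.* The left tail from `m = N/2` majorizes every case. The first term missing is `G^{(k)}(−A/2)`
  which we can bound using Lemma A.6 by […]. Our bound for `|G^{(k)}(u)|` is decreasing over the
  remainder of the left tail so we can bound it with the integral `∫_1^∞ [… (2n−1) …] dn`, and the
  result follows on evaluating this integral.» — `platt2017_lemmaA7_of_bound`: **the summation step
  PROVED, printed right-hand side recovered exactly**, for any `G : ℝ → ℂ` obeying the bound of Lemma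
  A.6 (hypothesis `hG`, with any constant `C ≥ 0` in place of `C(σ,t₀,h,k)`), real `x` with
  `|x| ≤ A/2` in place of `m/B` (`m ∈ [0, N/2]`, `N = AB`), conclusion as
  `‖Σ_{n∈ℤ} G(x+nA) − G(x)‖ ≤ …` together with the summability of the samples.
* **Lemma A.8** (p. 2461). «Let `σ ∈ 2ℤ+1` and `1 < σ < t₀`. Then we have
  `|F(x)| ≤ ζ(σ)π^{(1−2σ)/4} C(σ,t₀,h,0) exp((2σ−1)²/(8h²) − π|x|(2σ−1))
  + 2π^{5/4} exp(1/(8h²) − π|x| − t₀²/(2h²))`. *Proof.* Since `f(t)` is real, its Fourier Transform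
  `F(x)` has the property `F(−x) = conj F(x)` so we need only consider `x ≥ 0`. We write
  `s = 1/2 + i(t+t₀)` and shift the line of integration right to `ℜ(s) = σ` encountering the pole of
  `ζ(s)` at `s = 1`. This yields a residue smaller in absolute terms than `2π^{5/4} exp(1/(8h²) − πx −
  t₀²/(2h²))`. The remaining integral is then bounded in exactly the same fashion as in Lemma A.6 using
  `|ζ(σ+it)| ≤ |ζ(σ)|` for `σ > 1` and `t ∈ ℝ`.» — `platt2017_lemmaA8`: **PROVED for `x ≥ 0`**
  (`σ = 2m+1 ≥ 3`; `F(x) = ∫ f(t)e(−tx) dt` with Platt's `f`, `Λ` written out over `riemannZeta`;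
  `C(σ,t₀,h,0)` the integral; `ζ(σ) = Re ζ(σ)`): the continued integrand is
  `Ξ(s) = π^{1/4} Λ(s) e^{π(τ+t₀)/4} e^{−τ²/(2h²)} e^{−2πiτx}` with `Λ = completedRiemannZeta`
  (`Platt2017.fourierF_kernel_eq`), holomorphic off `{0, 1}` (`differentiableAt_fourierF_kernel`), with
  a simple pole at `1` in the concrete sense `Ξ = φ/(s−1)` near `1`, `φ(1) = π^{1/4} × weights(1)`
  (`fourierF_kernel_pole`, from `Λ = Λ₀ − 1/s − 1/(1−s)`), `2π|φ(1)| = 2π^{5/4} e^{1/(8h²) − πx − t₀²/(2h²)}`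
  (`norm_fourierF_residue`); the shift across the pole is the tree's
  `Literature.Analysis.Complex.integral_vertical_sub_eq_sum_of_simplePoles`, justified by a Gaussian
  strip majorant (`norm_fourierF_kernel_le`, from the Euler–Maclaurin growth bound
  `norm_riemannZeta_le_of_neg_one_le_re` of the tree: `|ζ(s)| ≤ (σ+3+|Im s|)³` away from the pole,
  `|Λ| = |Γ_ℝ||ζ|`), `integrable_fourierF_kernel_vertical`, `decay_fourierF_kernel`; on the far line
  `|Ξ| ≤ ζ(σ)π^{(1−2σ)/4} e^{(2σ−1)²/(8h²) − πx(2σ−1)} |Γ((σ+i(t+t₀))/2)| e^{π(t+t₀)/4 − t²/(2h²)}`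
  (`norm_fourierF_kernel_far_le`, with the tree's `norm_riemannZeta_le_re_riemannZeta`), and the
  `C(σ,t₀,h,0)` integrand is integrable (`integrable_lemmaA3_integrand`: monotonicity of
  `|Γ((σ+iτ)/2)| e^{πτ/4}` and Lemma A.2). NOT typed: the reduction of `x < 0` to `x ≥ 0`
  (`F(−x) = conj F(x)`, i.e. the reality of `Λ(t)`), and the printed hypothesis `σ < t₀` is not used.
* **Lemma A.9** (p. 2462). «For `n ∈ [0, N/2]` we have `|F̃(n) − F(n/B)| = |Σ_{l∈ℤ≠0} F(n/B + lA)|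
  ≤ 2ζ(σ)π^{(1−2σ)/4} C(σ,t₀,h,0) exp((2σ−1)²/(8h²) − Aπ(2σ−1)/2)(1 + 1/(Aπ(2σ−1)))
  + 4π^{5/4} exp((1−4t₀²)/(8h²) − Aπ/2)(1 + 1/(Aπ))`. *Proof.* The left tail from `n = N/2` majorizes
  all other cases. The first term missing is `F(−A/2)` which we can bound in absolute terms using Lemma
  A.8 […]. The same bound gives a decreasing sequence for the remaining terms which we can therefore
  estimate with the integral `∫_1^∞ […] dn`. Again, our result follows on evaluating this integral.» —
  `platt2017_lemmaA9_of_bound`: **the summation step PROVED, printed right-hand side recovered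
  exactly**, for any `F : ℝ → ℂ` obeying the bound of Lemma A.8 (hypothesis, with any constant
  `Cζ ≥ 0` in place of `ζ(σ)π^{(1−2σ)/4} C(σ,t₀,h,0)`), `|x| ≤ A/2`.

* **Lemma B.1** (p. 2463). «Let `x ≥ 0`. Then
  `|Σ_{j>J} (1/√j)(j√π)^{−it₀} G(x + log(j√π)/(2π))| ≤ C(σ,t₀,h,0) exp((2σ−1)²/(8h²)) π^{(1−2σ)/4}
  J^{1−σ}/(σ−1)`. *Proof.* Take `x = 0` and apply Equation A.1 of Lemma A.6.» — `platt2017_lemmaB1`: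
  **PROVED as printed** (every real `σ > 1`, `h > 0`, `J ≥ 1`; `G = G^{(0)}` written out,
  `C(σ,t₀,h,0) = ∫|Γ((σ+i(t+t₀))/2)| e^{π(t+t₀)/4 − t²/(2h²)} dt`; the sum over `j > J` as
  `Σ_{n≥0}` at `j = n+J+1`, with its convergence): display (A.1) (`platt2017_lemmaA6_right`, `k = 0`)
  term by term, `|(j√π)^{−it₀}| = 1`, `e^{−πu(2σ−1)} ≤ (j√π)^{−(2σ−1)/2}` for
  `u = x + log(j√π)/(2π)`, and the integral test `Σ_{j>J} j^{−σ} ≤ J^{1−σ}/(σ−1)` (Mathlib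
  `AntitoneOn.tsum_comp_add_le_integral`).
* **Lemma C.1** (p. 2464; `W(t) = Λ(t) e^{πt/4 − (t−t₀)²/(2H²)}`). «Define `I` by
  `I := 4∫_{A/2}^∞ |∫_{−∞}^{∞} W(t) e(−xt) dt| dx`. Then we have `I ≤ 4ζ(σ)/(2σ−1) π^{(−3−2σ)/4}
  C(σ,t₀,H,0) exp((2σ−1)²/(8H²) − πA(2σ−1)/2) + 8π^{1/4} exp((1−4t₀²)/(8H²) − πA/2)`. *Proof.*
  Using the substitution `t → t + t₀` the inner integral looks exactly like the definition of `F(x)`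
  with `H` taking the place of `h`. We bound this using Lemma A.8 and the outer integral is then
  trivial.» — `platt2017_lemmaC1_of_bound`: the outer integration PROVED with the printed right-hand
  side, for any inner integral `FW` obeying Lemma A.8's bound with `H` for `h` (hypothesis; any
  `Cζ ≥ 0` in place of `ζ(σ)π^{(1−2σ)/4}C(σ,t₀,H,0)`), every real `A` and `σ > 1/2`.

The common mechanism of A.7 and A.9 is `Platt2017.lattice_two_sided_exp`: if `‖F(u)‖ ≤ c₀e^{−a₀|u|} + Σ_{l<L}
c_l e^{−a_l|u|}` (`c ≥ 0`, `a > 0`) then for `|x| ≤ A/2`,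
`‖Σ_{n≠0} F(x+nA)‖ ≤ 2[c₀e^{−a₀A/2}(1 + 1/(Aa₀)) + Σ_l c_l e^{−a_lA/2}(1 + 1/(Aa_l))]` — the tree's
`Platt2017.lattice_two_sided` (both tails, «split off the first term and majorize the balance with an
integral») with `∫_{A/2}^∞ e^{−av} dv = e^{−aA/2}/a` (Mathlib `integral_exp_mul_Ioi`). The `n`-th point
of either tail lies at distance `≥ (2|n|−1)A/2` when `|x| ≤ A/2`, which is why «the left tail from
`m = N/2` majorizes every case».

## Main results

* `platt2017_lemmaA6_right`, `platt2017_lemmaA6_left`, `platt2017_lemmaA7_of_bound`, `platt2017_lemmaA8`,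
  `platt2017_lemmaA9_of_bound`, `platt2017_lemmaB1`, `platt2017_lemmaC1_of_bound` (namespace
  `Literature.NumberTheory.LFunctions`); engine `Platt2017.lattice_two_sided_exp`,
  `Platt2017.fourier_kernel_eq`, `differentiableAt_fourier_kernel`, `norm_fourier_kernel`,
  `norm_fourier_kernel_le`, `integrable_fourier_kernel_vertical`, `decay_fourier_kernel`,
  `norm_fourier_kernel_far` (and the primed `u`-free versions), `integral_fourier_kernel_shift`,
  `fourier_kernel_two_mul`, `differentiable_fourier_cofactor`, `norm_fourier_cofactor(_le, _le_of_abs_le)`,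
  `norm_fourier_kernel_far_left`, `residue_term_eq`; for A.8: `norm_fourier_weight`, `fourierF_kernel_eq`,
  `differentiableAt_fourierF_kernel`, `norm_fourierF_kernel`, `norm_completedZeta_strip_le`,
  `norm_fourierF_kernel_le`, `integrable_fourierF_kernel_vertical`, `decay_fourierF_kernel`,
  `norm_fourierF_kernel_far_le`, `fourierF_kernel_pole`, `norm_fourierF_residue`,
  `integrable_lemmaA3_integrand`.

## Deliberately NOT here

Of Lemma A.6 only its last sentence (the comparison `|Γ(−σ/2+it)| < |Γ(σ/2+it)|`, see above);
Of Lemma A.8 only the reflection `x < 0` (reality of `f`); Lemma 3.2 (the double shift behind the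
`j`-series for `F`) and Lemma 3.3 (Taylor). As typed, A.7, A.9 and C.1 are exactly the printed
deductions «A.6 ⇒ A.7», «A.8 ⇒ A.9», «A.8 ⇒ C.1» (their hypotheses are the printed two-sided
bounds), while both line-moves of A.6, Lemma A.8 for `x ≥ 0` and Lemma B.1 are theorems.

## References

* [Platt2017] D. J. Platt, *Isolating some non-trivial zeros of zeta*, Math. Comp. 86 (2017), no. 307,
  2449–2467, doi:10.1090/mcom/3198 — Appendix A, Lemmas A.6, A.7 (pp. 2460–2461), A.8, A.9
  (pp. 2461–2462), Appendix B, Lemma B.1 (p. 2463, proof p. 2464), Appendix C, Lemma C.1 (p. 2464);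
  §3 pp. 2451–2453 (steps (3)–(6): `G^{(k)}`, `F` as Fourier transforms, `e(x) = e^{2πix}`;
  Lemma 3.2, the `j`-series for `F`).
* E. C. Titchmarsh, *The Theory of Functions*, 2nd ed., §3.12 (moving a line of integration; via
  `Literature/Analysis/Complex/VerticalLineShift.lean`); E. C. Titchmarsh, *The Theory of the Riemann
  Zeta-Function*, 2nd ed., §2.7 (Mellin–Barnes shift past the poles of `Γ`; via
  `Literature/Analysis/Complex/MellinBarnesShift.lean`); H. M. Edwards, *Riemann's Zeta Function*
  (1974), §6.4 (Euler–Maclaurin growth of `ζ`; via `EulerMaclaurinZeta.lean`).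
* [PlattTrudgianBLMS2021] D. Platt, T. Trudgian, *The Riemann hypothesis is true up to `3·10¹²`*,
  Bull. Lond. Math. Soc. 53 (2021) 792–797 — §2 (the instrument is [Platt2017]).
-/

noncomputable section

open Complex Real Set MeasureTheory Filter

namespace Literature.NumberTheory.LFunctions

namespace Platt2017

/-- **Two-sided lattice tails of an exponential majorant** (the summation step of Lemmas A.7 and A.9,
«the left tail from `m = N/2` majorizes every case. The first term missing is … Our bound is decreasing
over the remainder of the left tail so we can bound it with the integral `∫_1^∞ … dn`, and the result
follows on evaluating this integral»): if `‖F(u)‖ ≤ c₀ e^{−a₀|u|} + Σ_{l<L} c_l e^{−a_l|u|}` with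
`c ≥ 0`, `a > 0`, then for `|x| ≤ A/2` the samples `F(x + nA)`, `n ∈ ℤ`, are summable and
`‖Σ_{n≠0} F(x+nA)‖ ≤ 2[c₀ e^{−a₀A/2}(1 + 1/(A a₀)) + Σ_l c_l e^{−a_l A/2}(1 + 1/(A a_l))]`
(`lattice_two_sided` with `∫_{A/2}^∞ e^{−av} dv = e^{−aA/2}/a`).
[cite: Platt2017, Lemma A.7 p. 2460 and Lemma A.9 p. 2462 (proofs)] -/
theorem lattice_two_sided_exp {F : ℝ → ℂ} {A x c₀ a₀ : ℝ} {L : ℕ} {c a : ℕ → ℝ} (hA : 0 < A)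
    (hx : |x| ≤ A / 2) (hc₀ : 0 ≤ c₀) (ha₀ : 0 < a₀) (hc : ∀ l, l < L → 0 ≤ c l)
    (ha : ∀ l, l < L → 0 < a l)
    (hF : ∀ u : ℝ, ‖F u‖ ≤ c₀ * Real.exp (-(a₀ * |u|)) +
      ∑ l ∈ Finset.range L, c l * Real.exp (-(a l * |u|))) :
    Summable (fun n : ℤ => F (x + n * A)) ∧
      ‖∑' n : ℤ, F (x + n * A) - F x‖ ≤
        2 * (c₀ * Real.exp (-(a₀ * (A / 2))) * (1 + 1 / (A * a₀)) +
          ∑ l ∈ Finset.range L, c l * Real.exp (-(a l * (A / 2))) * (1 + 1 / (A * a l))) := by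
  set P : ℝ → ℝ := fun v => c₀ * Real.exp (-(a₀ * v)) +
    ∑ l ∈ Finset.range L, c l * Real.exp (-(a l * v)) with hP
  have hP_apply : ∀ v, P v = c₀ * Real.exp (-(a₀ * v)) +
      ∑ l ∈ Finset.range L, c l * Real.exp (-(a l * v)) := fun v => rfl
  have hP0 : ∀ v : ℝ, A / 2 ≤ v → 0 ≤ P v := by
    intro v _
    rw [hP_apply]
    have h1 : 0 ≤ c₀ * Real.exp (-(a₀ * v)) := mul_nonneg hc₀ (Real.exp_pos _).le
    have h2 : 0 ≤ ∑ l ∈ Finset.range L, c l * Real.exp (-(a l * v)) :=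
      Finset.sum_nonneg fun l hl => mul_nonneg (hc l (Finset.mem_range.mp hl)) (Real.exp_pos _).le
    linarith
  have hPanti : AntitoneOn P (Ici (A / 2)) := by
    intro v _ w _ hvw
    rw [hP_apply, hP_apply]
    refine add_le_add (mul_le_mul_of_nonneg_left (Real.exp_le_exp.mpr (by nlinarith)) hc₀)
      (Finset.sum_le_sum fun l hl => ?_)
    have hl' := Finset.mem_range.mp hl
    exact mul_le_mul_of_nonneg_left (Real.exp_le_exp.mpr (by nlinarith [ha l hl'])) (hc l hl')
  -- integrability and the value of the integral of one exponential
  have hexp_int : ∀ {b : ℝ}, 0 < b → ∀ d : ℝ,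
      IntegrableOn (fun v : ℝ => d * Real.exp (-(b * v))) (Ioi (A / 2)) := by
    intro b hb d
    refine ((integrableOn_exp_mul_Ioi (neg_neg_of_pos hb) (A / 2)).congr_fun (fun v _ => ?_)
      measurableSet_Ioi).const_mul d
    simp only [neg_mul]
  have hexp_val : ∀ {b : ℝ}, 0 < b → ∀ d : ℝ,
      ∫ v in Ioi (A / 2), d * Real.exp (-(b * v)) = d * Real.exp (-(b * (A / 2))) / b := by
    intro b hb d
    rw [integral_const_mul]
    have h := integral_exp_mul_Ioi (neg_neg_of_pos hb) (A / 2)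
    have heq : ∫ v in Ioi (A / 2), Real.exp (-(b * v)) = ∫ v in Ioi (A / 2), Real.exp (-b * v) :=
      setIntegral_congr_fun measurableSet_Ioi fun v _ => by rw [neg_mul]
    rw [heq, h, neg_mul]
    field_simp
  have hPint : IntegrableOn P (Ioi (A / 2)) := by
    have h1 : IntegrableOn (fun v : ℝ => c₀ * Real.exp (-(a₀ * v))) (Ioi (A / 2)) := hexp_int ha₀ c₀
    have h2 : IntegrableOn (fun v : ℝ => ∑ l ∈ Finset.range L, c l * Real.exp (-(a l * v)))
        (Ioi (A / 2)) :=
      integrable_finsetSum _ fun l hl => hexp_int (ha l (Finset.mem_range.mp hl)) (c l)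
    exact h1.add h2
  have hPval : ∫ v in Ioi (A / 2), P v = c₀ * Real.exp (-(a₀ * (A / 2))) / a₀ +
      ∑ l ∈ Finset.range L, c l * Real.exp (-(a l * (A / 2))) / a l := by
    simp only [hP_apply]
    rw [integral_add (hexp_int ha₀ c₀)
        (integrable_finsetSum _ fun l hl => hexp_int (ha l (Finset.mem_range.mp hl)) (c l)),
      hexp_val ha₀, integral_finsetSum _ fun l hl => hexp_int (ha l (Finset.mem_range.mp hl)) (c l)]
    congr 1
    exact Finset.sum_congr rfl fun l hl => hexp_val (ha l (Finset.mem_range.mp hl)) (c l)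
  have hF' : ∀ t : ℝ, A / 2 ≤ |t| → ‖F t‖ ≤ P |t| := fun t _ => by rw [hP_apply]; exact hF t
  obtain ⟨hsum, hle⟩ := lattice_two_sided hA hx hP0 hPanti hPint hF'
  refine ⟨hsum, hle.trans (le_of_eq ?_)⟩
  rw [hPval, hP_apply]
  have hA0 : A ≠ 0 := hA.ne'
  congr 1
  rw [mul_add, Finset.mul_sum, add_add_add_comm, ← Finset.sum_add_distrib]
  congr 1
  · field_simp
  · refine Finset.sum_congr rfl fun l hl => ?_
    have hal : a l ≠ 0 := (ha l (Finset.mem_range.mp hl)).ne'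
    field_simp

end Platt2017

open Platt2017 in
/-- **Platt 2017, Lemma A.7 (pp. 2460–2461), the summation step, with the pointwise bound of Lemma A.6
as a hypothesis.** Printed: «Let `m ∈ [0, N/2]` and `σ ∈ 2ℤ_{>0} + 1`. Then we have
`|Σ_{l∈ℤ≠0} G^{(k)}(m/B + lA)| ≤ 2^{k+3} π^{k+1} exp(−t₀²/(2h²)) S
+ 2(1 + 1/(Aπ(2σ−1))) C(σ,t₀,h,k) exp((2σ+1)²/(8h²) − Aπ(2σ−1)/2)`, where `S` is the sum
`Σ_{l=0}^{(σ−1)/2} (1 + 1/(Aπ(4l+1))) ((2l+1/2)² + t₀²)^{k/2}/l! · exp((4l+1)²/(8h²) − Aπ(4l+1)/2)`.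
*Proof.* The left tail from `m = N/2` majorizes every case. The first term missing is `G^{(k)}(−A/2)`
which we can bound using Lemma A.6 … Our bound for `|G^{(k)}(u)|` is decreasing over the remainder of
the left tail so we can bound it with the integral `∫_1^∞ […(2n−1)…] dn`, and the result follows on
evaluating this integral.» Lemma A.6 (p. 2460: «Let `σ ∈ 2ℤ_{>0}+1`. Then `G^{(k)}(u)` is bounded in
absolute terms by `C(σ,t₀,h,k) exp((2σ+1)²/(8h²) − (2σ−1)π|u|) + 2^{k+2} π^{k+1} exp(−t₀²/(2h²))
Σ_{l=0}^{(σ−1)/2} ((2l+1/2)²+t₀²)^{k/2}/l! · exp((4l+1)²/(8h²) − (4l+1)π|u|)`», a contour shift of the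
Fourier integral defining `G^{(k)}` past the poles of `Γ(s/2)`) is NOT typed here: it is the hypothesis
`hG`, for any function `G` and any constant `C ≥ 0` in the place of `C(σ,t₀,h,k)` (Lemma A.3,
`platt2017_lemmaA3_corrected`, bounds the latter). Typed for real `x` with `|x| ≤ A/2` (covers
`x = m/B`, `m ∈ [0, N/2]`, `N = AB`); `σ = 2M+1`; the conclusion is the printed right-hand side, as
`‖Σ_{n∈ℤ} G(x+nA) − G(x)‖`. [cite: Platt2017, Lemma A.7 pp. 2460–2461; Lemma A.6 p. 2460 (hypothesis)] -/
theorem platt2017_lemmaA7_of_bound (k : ℕ) {σ t₀ h A x C : ℝ} {M : ℕ} {G : ℝ → ℂ}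
    (hσ : σ = 2 * M + 1) (hA : 0 < A) (hx : |x| ≤ A / 2) (hC : 0 ≤ C)
    (hG : ∀ u : ℝ, ‖G u‖ ≤ C * Real.exp ((2 * σ + 1) ^ 2 / (8 * h ^ 2) - (2 * σ - 1) * π * |u|) +
      2 ^ (k + 2) * π ^ (k + 1) * Real.exp (-(t₀ ^ 2 / (2 * h ^ 2))) *
        ∑ l ∈ Finset.range (M + 1), ((2 * l + 1 / 2) ^ 2 + t₀ ^ 2) ^ ((k : ℝ) / 2) / (l.factorial : ℝ) *
          Real.exp ((4 * l + 1) ^ 2 / (8 * h ^ 2) - (4 * l + 1) * π * |u|)) :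
    Summable (fun n : ℤ => G (x + n * A)) ∧
      ‖∑' n : ℤ, G (x + n * A) - G x‖ ≤
        2 ^ (k + 3) * π ^ (k + 1) * Real.exp (-(t₀ ^ 2 / (2 * h ^ 2))) *
            ∑ l ∈ Finset.range (M + 1), (1 + 1 / (A * π * (4 * l + 1))) *
              (((2 * l + 1 / 2) ^ 2 + t₀ ^ 2) ^ ((k : ℝ) / 2) / (l.factorial : ℝ)) *
              Real.exp ((4 * l + 1) ^ 2 / (8 * h ^ 2) - A * π * (4 * l + 1) / 2) +
          2 * (1 + 1 / (A * π * (2 * σ - 1))) * C *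
            Real.exp ((2 * σ + 1) ^ 2 / (8 * h ^ 2) - A * π * (2 * σ - 1) / 2) := by
  have hM0 : (0 : ℝ) ≤ M := Nat.cast_nonneg M
  have hσ1 : 1 ≤ σ := by rw [hσ]; linarith
  -- the data of the exponential majorant
  set c₀ : ℝ := C * Real.exp ((2 * σ + 1) ^ 2 / (8 * h ^ 2)) with hc₀
  set a₀ : ℝ := (2 * σ - 1) * π with ha₀
  set Q : ℝ := 2 ^ (k + 2) * π ^ (k + 1) * Real.exp (-(t₀ ^ 2 / (2 * h ^ 2))) with hQ
  set c : ℕ → ℝ := fun l => Q * (((2 * l + 1 / 2) ^ 2 + t₀ ^ 2) ^ ((k : ℝ) / 2) / (l.factorial : ℝ)) *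
    Real.exp ((4 * l + 1) ^ 2 / (8 * h ^ 2)) with hcdef
  set a : ℕ → ℝ := fun l => (4 * l + 1) * π with hadef
  have ha₀pos : 0 < a₀ := by rw [ha₀]; nlinarith [Real.pi_pos]
  have hQ0 : 0 ≤ Q := by rw [hQ]; positivity
  have hcl : ∀ l : ℕ, l < M + 1 → 0 ≤ c l := fun l _ => by
    simp only [hcdef]; positivity
  have hal : ∀ l : ℕ, l < M + 1 → 0 < a l := fun l _ => by
    simp only [hadef]; positivity
  have hF : ∀ u : ℝ, ‖G u‖ ≤ c₀ * Real.exp (-(a₀ * |u|)) +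
      ∑ l ∈ Finset.range (M + 1), c l * Real.exp (-(a l * |u|)) := by
    intro u
    refine (hG u).trans (le_of_eq ?_)
    rw [hc₀, ha₀, Finset.mul_sum]
    congr 1
    · rw [sub_eq_add_neg, Real.exp_add]; ring
    · refine Finset.sum_congr rfl fun l _ => ?_
      simp only [hcdef, hadef]
      rw [sub_eq_add_neg, Real.exp_add]; ring
  obtain ⟨hsum, hle⟩ := lattice_two_sided_exp hA hx (by positivity) ha₀pos hcl hal hF
  refine ⟨hsum, hle.trans (le_of_eq ?_)⟩
  have hπ0 : π ≠ 0 := Real.pi_pos.ne'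
  have hA0 : A ≠ 0 := hA.ne'
  have h2σ : 2 * σ - 1 ≠ 0 := by linarith
  rw [mul_add, add_comm, hc₀, ha₀, Finset.mul_sum, Finset.mul_sum]
  congr 1
  · refine Finset.sum_congr rfl fun l _ => ?_
    simp only [hcdef, hadef, hQ]
    have h4l : (4 * (l : ℝ) + 1) ≠ 0 := by positivity
    rw [show (4 * (l : ℝ) + 1) ^ 2 / (8 * h ^ 2) - A * π * (4 * l + 1) / 2 =
        (4 * (l : ℝ) + 1) ^ 2 / (8 * h ^ 2) + -((4 * l + 1) * π * (A / 2)) by ring, Real.exp_add]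
    field_simp
    ring
  · rw [show (2 * σ + 1) ^ 2 / (8 * h ^ 2) - A * π * (2 * σ - 1) / 2 =
        (2 * σ + 1) ^ 2 / (8 * h ^ 2) + -((2 * σ - 1) * π * (A / 2)) by ring, Real.exp_add]
    field_simp

open Platt2017 in
/-- **Platt 2017, Lemma A.9 (p. 2462), the summation step, with the pointwise bound of Lemma A.8 as a
hypothesis.** Printed: «For `n ∈ [0, N/2]` we have `|F̃(n) − F(n/B)| = |Σ_{l∈ℤ≠0} F(n/B + lA)|
≤ 2ζ(σ)π^{(1−2σ)/4} C(σ,t₀,h,0) exp((2σ−1)²/(8h²) − Aπ(2σ−1)/2)(1 + 1/(Aπ(2σ−1)))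
+ 4π^{5/4} exp((1−4t₀²)/(8h²) − Aπ/2)(1 + 1/(Aπ))`. *Proof.* The left tail from `n = N/2` majorizes all
other cases. The first term missing is `F(−A/2)` which we can bound in absolute terms using Lemma A.8 …
The same bound gives a decreasing sequence for the remaining terms which we can therefore estimate with
the integral `∫_1^∞ […(2n−1)…] dn`. Again, our result follows on evaluating this integral.» Lemma A.8
(p. 2461: «Let `σ ∈ 2ℤ+1` and `1 < σ < t₀`. Then we have `|F(x)| ≤ ζ(σ)π^{(1−2σ)/4} C(σ,t₀,h,0)
exp((2σ−1)²/(8h²) − π|x|(2σ−1)) + 2π^{5/4} exp(1/(8h²) − π|x| − t₀²/(2h²))`», a contour shift past the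
pole of `ζ`) is NOT typed here: it is the hypothesis `hFb`, for any function `F` and any constant
`Cζ ≥ 0` in the place of `ζ(σ)π^{(1−2σ)/4} C(σ,t₀,h,0)`. Typed for real `x` with `|x| ≤ A/2` (covers
`x = n/B`); the conclusion is the printed right-hand side, as `‖Σ_{m∈ℤ} F(x+mA) − F(x)‖`.
[cite: Platt2017, Lemma A.9 p. 2462; Lemma A.8 p. 2461 (hypothesis)] -/
theorem platt2017_lemmaA9_of_bound {σ t₀ h A x Cζ : ℝ} {F : ℝ → ℂ} (hσ : 1 ≤ σ) (hA : 0 < A)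
    (hx : |x| ≤ A / 2) (hCζ : 0 ≤ Cζ)
    (hFb : ∀ u : ℝ, ‖F u‖ ≤ Cζ * Real.exp ((2 * σ - 1) ^ 2 / (8 * h ^ 2) - π * |u| * (2 * σ - 1)) +
      2 * π ^ (5 / 4 : ℝ) * Real.exp (1 / (8 * h ^ 2) - π * |u| - t₀ ^ 2 / (2 * h ^ 2))) :
    Summable (fun m : ℤ => F (x + m * A)) ∧
      ‖∑' m : ℤ, F (x + m * A) - F x‖ ≤
        2 * Cζ * Real.exp ((2 * σ - 1) ^ 2 / (8 * h ^ 2) - A * π * (2 * σ - 1) / 2) *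
            (1 + 1 / (A * π * (2 * σ - 1))) +
          4 * π ^ (5 / 4 : ℝ) * Real.exp ((1 - 4 * t₀ ^ 2) / (8 * h ^ 2) - A * π / 2) *
            (1 + 1 / (A * π)) := by
  set c₀ : ℝ := Cζ * Real.exp ((2 * σ - 1) ^ 2 / (8 * h ^ 2)) with hc₀
  set a₀ : ℝ := (2 * σ - 1) * π with ha₀
  set c : ℕ → ℝ := fun _ => 2 * π ^ (5 / 4 : ℝ) * Real.exp (1 / (8 * h ^ 2) - t₀ ^ 2 / (2 * h ^ 2))
    with hcdef
  set a : ℕ → ℝ := fun _ => π with hadef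
  have ha₀pos : 0 < a₀ := by rw [ha₀]; nlinarith [Real.pi_pos]
  have hcl : ∀ l : ℕ, l < 1 → 0 ≤ c l := fun l _ => by simp only [hcdef]; positivity
  have hal : ∀ l : ℕ, l < 1 → 0 < a l := fun l _ => by simp only [hadef]; exact Real.pi_pos
  have hF : ∀ u : ℝ, ‖F u‖ ≤ c₀ * Real.exp (-(a₀ * |u|)) +
      ∑ l ∈ Finset.range 1, c l * Real.exp (-(a l * |u|)) := by
    intro u
    refine (hFb u).trans (le_of_eq ?_)
    rw [Finset.sum_range_one, hc₀, ha₀]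
    simp only [hcdef, hadef]
    rw [show (2 * σ - 1) ^ 2 / (8 * h ^ 2) - π * |u| * (2 * σ - 1) =
        (2 * σ - 1) ^ 2 / (8 * h ^ 2) + -((2 * σ - 1) * π * |u|) by ring, Real.exp_add,
      show 1 / (8 * h ^ 2) - π * |u| - t₀ ^ 2 / (2 * h ^ 2) =
        (1 / (8 * h ^ 2) - t₀ ^ 2 / (2 * h ^ 2)) + -(π * |u|) by ring, Real.exp_add]
    ring
  obtain ⟨hsum, hle⟩ := lattice_two_sided_exp (L := 1) hA hx (by positivity) ha₀pos hcl hal hF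
  refine ⟨hsum, hle.trans (le_of_eq ?_)⟩
  have hπ0 : π ≠ 0 := Real.pi_pos.ne'
  have hA0 : A ≠ 0 := hA.ne'
  have h2σ : 2 * σ - 1 ≠ 0 := by linarith
  rw [Finset.sum_range_one, hc₀, ha₀]
  simp only [hcdef, hadef]
  rw [show (2 * σ - 1) ^ 2 / (8 * h ^ 2) - A * π * (2 * σ - 1) / 2 =
      (2 * σ - 1) ^ 2 / (8 * h ^ 2) + -((2 * σ - 1) * π * (A / 2)) by ring, Real.exp_add,
    show (1 - 4 * t₀ ^ 2) / (8 * h ^ 2) - A * π / 2 =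
      (1 / (8 * h ^ 2) - t₀ ^ 2 / (2 * h ^ 2)) + -(π * (A / 2)) by ring, Real.exp_add]
  field_simp
  ring


/-! ### Lemma A.6, the right shift `u ≥ 0` -/

namespace Platt2017

/-! ### Lemma A.6, right shift: the Fourier integrand of `G^{(k)}` continued into `Re s > 0` -/

/-- The substitution `s = 1/2 + i(t+t₀)` of the proof of Lemma A.6: at `s = x + iy` the time variable
`−i(s − 1/2) − t₀` equals `(y − t₀) + (1/2 − x)i`. [cite: Platt2017, Lemma A.6 p. 2460 (proof)] -/
private theorem time_var_eq (x y t₀ : ℝ) :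
    (-I * (((x : ℂ) + y * I) - 1 / 2) - t₀ : ℂ) = ((y - t₀ : ℝ) : ℂ) + ((1 / 2 - x : ℝ) : ℂ) * I := by
  apply Complex.ext <;> simp

/-- `−i(s − 1/2) = y + (1/2 − x)i` at `s = x + iy`. [cite: Platt2017, Lemma A.6 p. 2460 (proof)] -/
private theorem time_var_eq' (x y : ℝ) :
    (-I * (((x : ℂ) + y * I) - 1 / 2) : ℂ) = ((y : ℝ) : ℂ) + ((1 / 2 - x : ℝ) : ℂ) * I := by
  apply Complex.ext <;> simp

/-- `‖exp(p + qi)‖ = e^p` for real `p, q`. [folklore] -/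
private theorem norm_exp_ofReal_add (p q : ℝ) : ‖Complex.exp ((p : ℂ) + (q : ℂ) * I)‖ = Real.exp p := by
  rw [Complex.norm_exp]
  congr 1
  simp

/-- **The integrand of `G^{(k)}(u)` on the line `Re s = 1/2`** («We write
`|G^{(k)}(u)| = |∫ Γ((1/2+i(t+t₀))/2) exp(π(t+t₀)/4 − t²/(2h²)) (−2πit)^k e(−tu) dt|`. Substituting
`s = 1/2 + i(t+t₀)` …»): with `τ(s) = −i(s−1/2) − t₀` the function
`Ψ(s) = Γ(s/2) e^{π(τ+t₀)/4} e^{−τ²/(2h²)} (−2πiτ)^k e^{−2πiτu}` restricts to Platt's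
`g(t;k) e(−tu)` at `s = 1/2 + i(t+t₀)` (`τ = t`). [cite: Platt2017, Lemma A.6 p. 2460 (proof)] -/
theorem fourier_kernel_eq (k : ℕ) (t₀ h u t : ℝ) :
    Complex.Gamma ((1 / 2 + (t + t₀) * I) / 2) *
        Complex.exp ((π * (t + t₀) / 4 - t ^ 2 / (2 * h ^ 2) : ℝ) : ℂ) * (-(2 * π * t : ℝ) * I) ^ k *
        Complex.exp (-(2 * π * t * u : ℝ) * I) =
      (fun s : ℂ => Complex.Gamma (s / 2) * Complex.exp (π * (-I * (s - 1 / 2)) / 4) *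
        Complex.exp (-(-I * (s - 1 / 2) - t₀) ^ 2 / (2 * h ^ 2)) * (-2 * π * I * (-I * (s - 1 / 2) - t₀)) ^ k *
        Complex.exp (-2 * π * I * (-I * (s - 1 / 2) - t₀) * u)) (((1 / 2 : ℝ) : ℂ) + ((t + t₀ : ℝ) : ℂ) * I) := by
  have hτ := time_var_eq (1 / 2) (t + t₀) t₀
  have hτ' := time_var_eq' (1 / 2) (t + t₀)
  simp only []
  rw [hτ, hτ']
  have e1 : Complex.exp ((π * (t + t₀) / 4 - t ^ 2 / (2 * h ^ 2) : ℝ) : ℂ) =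
      Complex.exp (π * ((((t + t₀ : ℝ) : ℝ) : ℂ) + ((1 / 2 - 1 / 2 : ℝ) : ℂ) * I) / 4) *
        Complex.exp (-(((t + t₀ - t₀ : ℝ) : ℂ) + ((1 / 2 - 1 / 2 : ℝ) : ℂ) * I) ^ 2 / (2 * h ^ 2)) := by
    rw [← Complex.exp_add]
    congr 1
    push_cast
    ring
  have e2 : Complex.exp (-(2 * π * t * u : ℝ) * I) =
      Complex.exp (-2 * π * I * (((t + t₀ - t₀ : ℝ) : ℂ) + ((1 / 2 - 1 / 2 : ℝ) : ℂ) * I) * u) := by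
    congr 1
    push_cast
    ring
  have e3 : (-(2 * π * t : ℝ) * I : ℂ) ^ k =
      (-2 * π * I * (((t + t₀ - t₀ : ℝ) : ℂ) + ((1 / 2 - 1 / 2 : ℝ) : ℂ) * I)) ^ k := by
    congr 1
    push_cast
    ring
  have e4 : Complex.Gamma ((1 / 2 + (t + t₀) * I) / 2) =
      Complex.Gamma ((((1 / 2 : ℝ) : ℂ) + ((t + t₀ : ℝ) : ℂ) * I) / 2) := by
    congr 1
    push_cast
    ring
  rw [e1, e2, e3, e4]
  ring

/-- **`Ψ` is holomorphic on `Re s > 0`** (no pole of `Γ(s/2)` there; the other factors are entire).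
[cite: Platt2017, Lemma A.6 p. 2460 (proof: «we now move the line of integration right to ℜ(s) = σ»)] -/
theorem differentiableAt_fourier_kernel (k : ℕ) (t₀ h u : ℝ) {s : ℂ} (hs : 0 < s.re) :
    DifferentiableAt ℂ (fun s : ℂ => Complex.Gamma (s / 2) * Complex.exp (π * (-I * (s - 1 / 2)) / 4) *
        Complex.exp (-(-I * (s - 1 / 2) - t₀) ^ 2 / (2 * h ^ 2)) * (-2 * π * I * (-I * (s - 1 / 2) - t₀)) ^ k *
        Complex.exp (-2 * π * I * (-I * (s - 1 / 2) - t₀) * u)) s := by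
  have dΓ : DifferentiableAt ℂ (fun s : ℂ => Complex.Gamma (s / 2)) s := by
    refine (Complex.differentiableAt_Gamma _ fun m => ?_).comp s (by fun_prop)
    intro hm
    have := congrArg Complex.re hm
    simp at this
    have hm0 : (0 : ℝ) ≤ m := Nat.cast_nonneg _
    linarith
  have d2 : DifferentiableAt ℂ (fun s : ℂ => Complex.exp (π * (-I * (s - 1 / 2)) / 4)) s := by fun_prop
  have d3 : DifferentiableAt ℂ (fun s : ℂ => Complex.exp (-(-I * (s - 1 / 2) - t₀) ^ 2 / (2 * h ^ 2))) s := by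
    fun_prop
  have d4 : DifferentiableAt ℂ (fun s : ℂ => (-2 * π * I * (-I * (s - 1 / 2) - t₀)) ^ k) s := by fun_prop
  have d5 : DifferentiableAt ℂ (fun s : ℂ => Complex.exp (-2 * π * I * (-I * (s - 1 / 2) - t₀) * u)) s := by
    fun_prop
  exact (((dΓ.mul d2).mul d3).mul d4).mul d5

/-- **The modulus of `Ψ` at `s = x + iy`:**
`|Ψ(x+iy)| = |Γ((x+iy)/2)| e^{πy/4} e^{((x−1/2)² − (y−t₀)²)/(2h²)} (2π)^k ((y−t₀)² + (1/2−x)²)^{k/2}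
e^{−2πu(x−1/2)}`. [cite: Platt2017, Lemma A.6 p. 2460 (proof)] -/
theorem norm_fourier_kernel (k : ℕ) (t₀ h u x y : ℝ) :
    ‖(fun s : ℂ => Complex.Gamma (s / 2) * Complex.exp (π * (-I * (s - 1 / 2)) / 4) *
        Complex.exp (-(-I * (s - 1 / 2) - t₀) ^ 2 / (2 * h ^ 2)) * (-2 * π * I * (-I * (s - 1 / 2) - t₀)) ^ k *
        Complex.exp (-2 * π * I * (-I * (s - 1 / 2) - t₀) * u)) ((x : ℂ) + (y : ℂ) * I)‖ =
      ‖Complex.Gamma (((x : ℂ) + y * I) / 2)‖ * Real.exp (π * y / 4) *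
        Real.exp (((x - 1 / 2) ^ 2 - (y - t₀) ^ 2) / (2 * h ^ 2)) *
        ((2 * π) ^ k * Real.sqrt ((y - t₀) ^ 2 + (1 / 2 - x) ^ 2) ^ k) *
        Real.exp (-(2 * π * u * (x - 1 / 2))) := by
  have hτ := time_var_eq x y t₀
  have hτ' := time_var_eq' x y
  simp only []
  rw [hτ, hτ']
  set a : ℝ := y - t₀ with ha
  set c : ℝ := 1 / 2 - x with hc
  -- the three exponentials
  have e1 : (π * (((y : ℝ) : ℂ) + ((c : ℝ) : ℂ) * I) / 4 : ℂ) =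
      ((π * y / 4 : ℝ) : ℂ) + ((π * c / 4 : ℝ) : ℂ) * I := by push_cast; ring
  have hsq : ((((a : ℝ) : ℂ) + ((c : ℝ) : ℂ) * I) ^ 2 : ℂ) = ((a ^ 2 - c ^ 2 : ℝ) : ℂ) + ((2 * a * c : ℝ) : ℂ) * I := by
    have hI : (I : ℂ) ^ 2 = -1 := Complex.I_sq
    push_cast
    linear_combination ((c : ℂ) ^ 2) * hI
  have e2 : (-(((a : ℝ) : ℂ) + ((c : ℝ) : ℂ) * I) ^ 2 / (2 * h ^ 2) : ℂ) =
      ((-(a ^ 2 - c ^ 2) / (2 * h ^ 2) : ℝ) : ℂ) + ((-(2 * a * c) / (2 * h ^ 2) : ℝ) : ℂ) * I := by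
    rw [hsq]; push_cast; ring
  have e3 : (-2 * π * I * (((a : ℝ) : ℂ) + ((c : ℝ) : ℂ) * I) * u : ℂ) =
      ((2 * π * c * u : ℝ) : ℂ) + ((-(2 * π * a * u) : ℝ) : ℂ) * I := by
    have hI : (I : ℂ) ^ 2 = -1 := Complex.I_sq
    push_cast
    linear_combination (-2 * π * (c : ℂ) * u) * hI
  have e4 : (-2 * π * I * (((a : ℝ) : ℂ) + ((c : ℝ) : ℂ) * I) : ℂ) =
      ((2 * π * c : ℝ) : ℂ) + ((-(2 * π * a) : ℝ) : ℂ) * I := by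
    have hI : (I : ℂ) ^ 2 = -1 := Complex.I_sq
    push_cast
    linear_combination (-2 * π * (c : ℂ)) * hI
  rw [e1, e2, e3, norm_mul, norm_mul, norm_mul, norm_mul, norm_pow, e4, norm_exp_ofReal_add,
    norm_exp_ofReal_add, norm_exp_ofReal_add, Complex.norm_add_mul_I]
  have hnorm : Real.sqrt ((2 * π * c) ^ 2 + (-(2 * π * a)) ^ 2) = 2 * π * Real.sqrt (a ^ 2 + c ^ 2) := by
    rw [show (2 * π * c) ^ 2 + (-(2 * π * a)) ^ 2 = (2 * π) ^ 2 * (a ^ 2 + c ^ 2) by ring,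
      Real.sqrt_mul (by positivity), Real.sqrt_sq (by positivity)]
  have ec1 : -(a ^ 2 - c ^ 2) / (2 * h ^ 2) = ((x - 1 / 2) ^ 2 - a ^ 2) / (2 * h ^ 2) := by
    rw [hc]; ring
  have ec2 : 2 * π * c * u = -(2 * π * u * (x - 1 / 2)) := by rw [hc]; ring
  rw [hnorm, mul_pow, ec1, ec2]

/-- Convexity of `Γ` on `(0, ∞)`: `Γ(x) ≤ max (Γ lo) (Γ hi)` on `[lo, hi]` (a copy of the private lemma of
`CertifiedLFunctionWindowAliasingBound.lean`). [folklore] -/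
private theorem Real_Gamma_le_max' {x lo hi : ℝ} (hlo : 0 < lo) (h1 : lo ≤ x) (h2 : x ≤ hi) :
    Real.Gamma x ≤ max (Real.Gamma lo) (Real.Gamma hi) := by
  have hseg : x ∈ segment ℝ lo hi := by
    rw [segment_eq_Icc (h1.trans h2)]; exact ⟨h1, h2⟩
  exact Real.convexOn_Gamma.le_on_segment hlo (hlo.trans_le (h1.trans h2)) hseg

/-- `(v + d)^k e^{−v²/(4h²)} ≤ k! e^{d + h²}` for `v, d ≥ 0` (`x^k ≤ k! e^x`, `v − v²/(4h²) ≤ h²`):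
the polynomial growth of `|(−2πiτ)^k|` is absorbed by half of the Gaussian. [folklore] -/
private theorem pow_mul_gauss_le (k : ℕ) {v d h : ℝ} (hv : 0 ≤ v) (hd : 0 ≤ d) (hh : 0 < h) :
    (v + d) ^ k * Real.exp (-(v ^ 2 / (4 * h ^ 2))) ≤ k.factorial * Real.exp (d + h ^ 2) := by
  have hfac : (0 : ℝ) < k.factorial := by exact_mod_cast Nat.factorial_pos k
  have h1 : (v + d) ^ k ≤ k.factorial * Real.exp (v + d) := by
    have := Real.pow_div_factorial_le_exp (v + d) (by linarith) k
    rwa [div_le_iff₀ hfac, mul_comm] at this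
  have h2 : Real.exp (v + d) * Real.exp (-(v ^ 2 / (4 * h ^ 2))) ≤ Real.exp (d + h ^ 2) := by
    rw [← Real.exp_add]
    refine Real.exp_le_exp.mpr ?_
    have : v ≤ v ^ 2 / (4 * h ^ 2) + h ^ 2 := by
      rw [div_add' _ _ _ (by positivity), le_div_iff₀ (by positivity)]
      nlinarith [sq_nonneg (v - 2 * h ^ 2)]
    linarith
  calc (v + d) ^ k * Real.exp (-(v ^ 2 / (4 * h ^ 2)))
      ≤ k.factorial * Real.exp (v + d) * Real.exp (-(v ^ 2 / (4 * h ^ 2))) :=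
        mul_le_mul_of_nonneg_right h1 (Real.exp_pos _).le
    _ = k.factorial * (Real.exp (v + d) * Real.exp (-(v ^ 2 / (4 * h ^ 2)))) := by ring
    _ ≤ k.factorial * Real.exp (d + h ^ 2) := mul_le_mul_of_nonneg_left h2 hfac.le

/-- **A uniform Gaussian majorant for `Ψ` on the strip `1/2 ≤ Re s ≤ σ`** (what justifies moving the
line of integration: `|Γ((x+iy)/2)| ≤ Γ(x/2) ≤ max(Γ(1/4), Γ(σ/2))`, `e^{−2πu(x−1/2)} ≤ 1` for
`u ≥ 0`, completing the square `e^{πy/4 − (y−t₀)²/(2h²)} = e^{πt₀/4 + π²h²/32} e^{−(y−t₁)²/(2h²)}`,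
`t₁ = t₀ + πh²/4`, and `pow_mul_gauss_le`): `|Ψ(x+iy)| ≤ K e^{−(y−t₁)²/(4h²)}`.
[cite: Platt2017, Lemma A.6 p. 2460 (proof)] -/
theorem norm_fourier_kernel_le (k : ℕ) {σ t₀ h u x : ℝ} (hh : 0 < h) (hu : 0 ≤ u) (hx : 1 / 2 ≤ x)
    (hxσ : x ≤ σ) (y : ℝ) :
    ‖(fun s : ℂ => Complex.Gamma (s / 2) * Complex.exp (π * (-I * (s - 1 / 2)) / 4) *
        Complex.exp (-(-I * (s - 1 / 2) - t₀) ^ 2 / (2 * h ^ 2)) * (-2 * π * I * (-I * (s - 1 / 2) - t₀)) ^ k *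
        Complex.exp (-2 * π * I * (-I * (s - 1 / 2) - t₀) * u)) ((x : ℂ) + (y : ℂ) * I)‖ ≤
      max (Real.Gamma (1 / 4)) (Real.Gamma (σ / 2)) * Real.exp ((σ - 1 / 2) ^ 2 / (2 * h ^ 2)) *
        (2 * π) ^ k * Real.exp (π * t₀ / 4 + π ^ 2 * h ^ 2 / 32) *
        (k.factorial * Real.exp (π * h ^ 2 / 4 + σ + h ^ 2)) *
        Real.exp (-(1 / (4 * h ^ 2)) * (y - (t₀ + π * h ^ 2 / 4)) ^ 2) := by
  rw [norm_fourier_kernel]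
  set t₁ : ℝ := t₀ + π * h ^ 2 / 4 with ht₁
  set v : ℝ := |y - t₁| with hv
  set d : ℝ := π * h ^ 2 / 4 + σ with hd
  set ΓM : ℝ := max (Real.Gamma (1 / 4)) (Real.Gamma (σ / 2)) with hΓM
  have hx0 : 0 < x := by linarith
  have hσ0 : 0 < σ := by linarith
  have hd0 : 0 ≤ d := by rw [hd]; positivity
  -- the Gamma factor
  have hΓ : ‖Complex.Gamma (((x : ℂ) + y * I) / 2)‖ ≤ ΓM := by
    have hw : ((x : ℂ) + y * I) / 2 = ((x / 2 : ℝ) : ℂ) + ((y / 2 : ℝ) : ℂ) * I := by push_cast; ring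
    rw [hw]
    exact (Literature.Analysis.SpecialFunctions.GammaVert.norm_Gamma_le_Gamma_re
      (by positivity : (0 : ℝ) < x / 2) (y / 2)).trans
      (Real_Gamma_le_max' (by norm_num) (by linarith) (by linarith))
  -- the Gaussian with the linear exponential: complete the square
  have hgauss : Real.exp (π * y / 4) * Real.exp (((x - 1 / 2) ^ 2 - (y - t₀) ^ 2) / (2 * h ^ 2)) =
      Real.exp ((x - 1 / 2) ^ 2 / (2 * h ^ 2)) * Real.exp (π * t₀ / 4 + π ^ 2 * h ^ 2 / 32) *
        Real.exp (-((y - t₁) ^ 2 / (2 * h ^ 2))) := by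
    rw [← Real.exp_add, ← Real.exp_add, ← Real.exp_add]
    congr 1
    rw [ht₁]
    field_simp
    ring
  have hx2 : Real.exp ((x - 1 / 2) ^ 2 / (2 * h ^ 2)) ≤ Real.exp ((σ - 1 / 2) ^ 2 / (2 * h ^ 2)) := by
    refine Real.exp_le_exp.mpr (div_le_div_of_nonneg_right ?_ (by positivity))
    nlinarith
  -- the polynomial factor
  have hρ : Real.sqrt ((y - t₀) ^ 2 + (1 / 2 - x) ^ 2) ≤ v + d := by
    have h1 : Real.sqrt ((y - t₀) ^ 2 + (1 / 2 - x) ^ 2) ≤ |y - t₀| + |1 / 2 - x| := by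
      rw [show (y - t₀) ^ 2 + (1 / 2 - x) ^ 2 = |y - t₀| ^ 2 + |1 / 2 - x| ^ 2 by rw [sq_abs, sq_abs]]
      refine Real.sqrt_le_iff.mpr ⟨by positivity, ?_⟩
      nlinarith [abs_nonneg (y - t₀), abs_nonneg (1 / 2 - x)]
    have h2 : |y - t₀| ≤ v + π * h ^ 2 / 4 := by
      rw [hv, ht₁]
      have := abs_sub_abs_le_abs_sub (y - t₀) (y - (t₀ + π * h ^ 2 / 4))
      rw [show y - t₀ - (y - (t₀ + π * h ^ 2 / 4)) = π * h ^ 2 / 4 by ring,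
        abs_of_pos (by positivity : (0 : ℝ) < π * h ^ 2 / 4)] at this
      linarith
    have h3 : |1 / 2 - x| ≤ σ := by rw [abs_of_nonpos (by linarith)]; linarith
    rw [hd]; linarith
  have hρk : Real.sqrt ((y - t₀) ^ 2 + (1 / 2 - x) ^ 2) ^ k ≤ (v + d) ^ k :=
    pow_le_pow_left₀ (Real.sqrt_nonneg _) hρ k
  -- the `u`-factor
  have hu1 : Real.exp (-(2 * π * u * (x - 1 / 2))) ≤ 1 := by
    rw [Real.exp_le_one_iff, neg_nonpos]
    have := Real.pi_pos
    have : 0 ≤ x - 1 / 2 := by linarith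
    positivity
  -- split the Gaussian in two halves and absorb the polynomial
  have hsplit : Real.exp (-((y - t₁) ^ 2 / (2 * h ^ 2))) =
      Real.exp (-(v ^ 2 / (4 * h ^ 2))) * Real.exp (-(1 / (4 * h ^ 2)) * (y - t₁) ^ 2) := by
    rw [← Real.exp_add, hv, sq_abs]
    congr 1
    field_simp
    ring
  have hpoly : (v + d) ^ k * Real.exp (-(v ^ 2 / (4 * h ^ 2))) ≤ k.factorial * Real.exp (d + h ^ 2) :=
    pow_mul_gauss_le k (abs_nonneg _) hd0 hh
  -- assemble
  have hE0 : 0 < Real.exp (-(1 / (4 * h ^ 2)) * (y - t₁) ^ 2) := Real.exp_pos _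
  calc ‖Complex.Gamma (((x : ℂ) + y * I) / 2)‖ * Real.exp (π * y / 4) *
        Real.exp (((x - 1 / 2) ^ 2 - (y - t₀) ^ 2) / (2 * h ^ 2)) *
        ((2 * π) ^ k * Real.sqrt ((y - t₀) ^ 2 + (1 / 2 - x) ^ 2) ^ k) *
        Real.exp (-(2 * π * u * (x - 1 / 2)))
      = ‖Complex.Gamma (((x : ℂ) + y * I) / 2)‖ *
          (Real.exp (π * y / 4) * Real.exp (((x - 1 / 2) ^ 2 - (y - t₀) ^ 2) / (2 * h ^ 2))) *
          ((2 * π) ^ k * Real.sqrt ((y - t₀) ^ 2 + (1 / 2 - x) ^ 2) ^ k) *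
          Real.exp (-(2 * π * u * (x - 1 / 2))) := by ring
    _ ≤ ΓM * (Real.exp ((σ - 1 / 2) ^ 2 / (2 * h ^ 2)) * Real.exp (π * t₀ / 4 + π ^ 2 * h ^ 2 / 32) *
          Real.exp (-((y - t₁) ^ 2 / (2 * h ^ 2)))) * ((2 * π) ^ k * (v + d) ^ k) * 1 := by
        rw [hgauss]
        gcongr
    _ = ΓM * Real.exp ((σ - 1 / 2) ^ 2 / (2 * h ^ 2)) * (2 * π) ^ k *
          Real.exp (π * t₀ / 4 + π ^ 2 * h ^ 2 / 32) *
          ((v + d) ^ k * Real.exp (-(v ^ 2 / (4 * h ^ 2)))) *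
          Real.exp (-(1 / (4 * h ^ 2)) * (y - t₁) ^ 2) := by rw [hsplit]; ring
    _ ≤ ΓM * Real.exp ((σ - 1 / 2) ^ 2 / (2 * h ^ 2)) * (2 * π) ^ k *
          Real.exp (π * t₀ / 4 + π ^ 2 * h ^ 2 / 32) *
          (k.factorial * Real.exp (d + h ^ 2)) *
          Real.exp (-(1 / (4 * h ^ 2)) * (y - t₁) ^ 2) := by
        gcongr
    _ = _ := by rw [hd, ht₁]

/-- **`Ψ` is integrable on every vertical line `Re s = x`, `1/2 ≤ x ≤ σ`** (continuity and the
Gaussian majorant `norm_fourier_kernel_le`). [cite: Platt2017, Lemma A.6 p. 2460 (proof)] -/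
theorem integrable_fourier_kernel_vertical (k : ℕ) {σ t₀ h u x : ℝ} (hh : 0 < h) (hu : 0 ≤ u)
    (hx : 1 / 2 ≤ x) (hxσ : x ≤ σ) :
    Integrable fun y : ℝ => (fun s : ℂ => Complex.Gamma (s / 2) * Complex.exp (π * (-I * (s - 1 / 2)) / 4) *
        Complex.exp (-(-I * (s - 1 / 2) - t₀) ^ 2 / (2 * h ^ 2)) * (-2 * π * I * (-I * (s - 1 / 2) - t₀)) ^ k *
        Complex.exp (-2 * π * I * (-I * (s - 1 / 2) - t₀) * u)) ((x : ℂ) + (y : ℂ) * I) := by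
  set K : ℝ := max (Real.Gamma (1 / 4)) (Real.Gamma (σ / 2)) * Real.exp ((σ - 1 / 2) ^ 2 / (2 * h ^ 2)) *
        (2 * π) ^ k * Real.exp (π * t₀ / 4 + π ^ 2 * h ^ 2 / 32) *
        (k.factorial * Real.exp (π * h ^ 2 / 4 + σ + h ^ 2)) with hK
  have hb : (0 : ℝ) < 1 / (4 * h ^ 2) := by positivity
  have hg : Integrable fun y : ℝ => K * Real.exp (-(1 / (4 * h ^ 2)) * (y - (t₀ + π * h ^ 2 / 4)) ^ 2) :=
    ((integrable_exp_neg_mul_sq hb).comp_sub_right (t₀ + π * h ^ 2 / 4)).const_mul K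
  have hcont : Continuous fun y : ℝ => (fun s : ℂ => Complex.Gamma (s / 2) * Complex.exp (π * (-I * (s - 1 / 2)) / 4) *
        Complex.exp (-(-I * (s - 1 / 2) - t₀) ^ 2 / (2 * h ^ 2)) * (-2 * π * I * (-I * (s - 1 / 2) - t₀)) ^ k *
        Complex.exp (-2 * π * I * (-I * (s - 1 / 2) - t₀) * u)) ((x : ℂ) + (y : ℂ) * I) := by
    have hl : Continuous fun y : ℝ => ((x : ℂ) + (y : ℂ) * I) := by fun_prop
    have hon : ContinuousOn (fun s : ℂ => Complex.Gamma (s / 2) * Complex.exp (π * (-I * (s - 1 / 2)) / 4) *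
        Complex.exp (-(-I * (s - 1 / 2) - t₀) ^ 2 / (2 * h ^ 2)) * (-2 * π * I * (-I * (s - 1 / 2) - t₀)) ^ k *
        Complex.exp (-2 * π * I * (-I * (s - 1 / 2) - t₀) * u)) {s : ℂ | 0 < s.re} := fun s (hs : 0 < s.re) =>
      (differentiableAt_fourier_kernel k t₀ h u hs).continuousAt.continuousWithinAt
    have hmem : ∀ y : ℝ, ((x : ℂ) + (y : ℂ) * I) ∈ {s : ℂ | 0 < s.re} := fun y => by
      show 0 < ((x : ℂ) + (y : ℂ) * I).re
      simp; linarith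
    exact hon.comp_continuous hl hmem
  refine hg.mono' hcont.aestronglyMeasurable (ae_of_all _ fun y => ?_)
  have hb' := norm_fourier_kernel_le k (t₀ := t₀) hh hu hx hxσ y
  rw [hK]
  exact hb'

/-- **Uniform decay of `Ψ` at the top and bottom of the strip `1/2 ≤ Re s ≤ σ`** (from the Gaussian
majorant; explicit `T₀`). [cite: Platt2017, Lemma A.6 p. 2460 (proof)] -/
theorem decay_fourier_kernel (k : ℕ) {σ t₀ h u : ℝ} (hh : 0 < h) (hu : 0 ≤ u) :
    ∀ ε : ℝ, 0 < ε → ∃ T₀ : ℝ, ∀ T : ℝ, T₀ ≤ |T| → ∀ x ∈ Icc (1 / 2 : ℝ) σ,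
      ‖(fun s : ℂ => Complex.Gamma (s / 2) * Complex.exp (π * (-I * (s - 1 / 2)) / 4) *
        Complex.exp (-(-I * (s - 1 / 2) - t₀) ^ 2 / (2 * h ^ 2)) * (-2 * π * I * (-I * (s - 1 / 2) - t₀)) ^ k *
        Complex.exp (-2 * π * I * (-I * (s - 1 / 2) - t₀) * u)) ((x : ℂ) + (T : ℂ) * I)‖ ≤ ε := by
  intro ε hε
  set K : ℝ := max (Real.Gamma (1 / 4)) (Real.Gamma (σ / 2)) * Real.exp ((σ - 1 / 2) ^ 2 / (2 * h ^ 2)) *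
        (2 * π) ^ k * Real.exp (π * t₀ / 4 + π ^ 2 * h ^ 2 / 32) *
        (k.factorial * Real.exp (π * h ^ 2 / 4 + σ + h ^ 2)) with hK
  set t₁ : ℝ := t₀ + π * h ^ 2 / 4 with ht₁
  have hΓ : 0 < max (Real.Gamma (1 / 4)) (Real.Gamma (σ / 2)) :=
    lt_max_of_lt_left (Real.Gamma_pos_of_pos (by norm_num))
  have hfac : (0 : ℝ) < k.factorial := by exact_mod_cast Nat.factorial_pos k
  have hK0 : 0 < K := by rw [hK]; positivity
  set L : ℝ := max 0 (Real.log (K / ε)) with hL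
  have hL0 : 0 ≤ L := le_max_left _ _
  set R : ℝ := 2 * h * Real.sqrt L with hR
  have hR0 : 0 ≤ R := by positivity
  refine ⟨|t₁| + R, fun T hT x hx => ?_⟩
  have hb' := norm_fourier_kernel_le k (t₀ := t₀) hh hu hx.1 hx.2 T
  refine hb'.trans ?_
  rw [← hK, ← ht₁]
  -- `|T - t₁| ≥ R`, so the Gaussian is at most `ε/K`
  have hTt : R ≤ |T - t₁| := by
    have := abs_sub_abs_le_abs_sub T t₁
    linarith
  have hsq : R ^ 2 ≤ (T - t₁) ^ 2 := by
    rw [← sq_abs (T - t₁)]; exact pow_le_pow_left₀ hR0 hTt 2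
  have hR2 : R ^ 2 = 4 * h ^ 2 * L := by
    rw [hR, mul_pow, Real.sq_sqrt hL0]; ring
  have hexp : Real.exp (-(1 / (4 * h ^ 2)) * (T - t₁) ^ 2) ≤ ε / K := by
    have h1 : -(1 / (4 * h ^ 2)) * (T - t₁) ^ 2 ≤ -L := by
      rw [hR2] at hsq
      have h4 : 0 < 4 * h ^ 2 := by positivity
      have : L ≤ (T - t₁) ^ 2 / (4 * h ^ 2) := by rw [le_div_iff₀ h4]; linarith
      have e : -(1 / (4 * h ^ 2)) * (T - t₁) ^ 2 = -((T - t₁) ^ 2 / (4 * h ^ 2)) := by ring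
      rw [e]; linarith
    have h2 : Real.log (K / ε) ≤ L := le_max_right _ _
    calc Real.exp (-(1 / (4 * h ^ 2)) * (T - t₁) ^ 2) ≤ Real.exp (-Real.log (K / ε)) :=
          Real.exp_le_exp.mpr (by linarith)
      _ = ε / K := by rw [Real.exp_neg, Real.exp_log (by positivity)]; field_simp
  calc K * Real.exp (-(1 / (4 * h ^ 2)) * (T - t₁) ^ 2) ≤ K * (ε / K) :=
        mul_le_mul_of_nonneg_left hexp hK0.le
    _ = ε := by field_simp

/-- **`Ψ` on the shifted line `Re s = σ`** (the display (A.1) of p. 2460): at `s = σ + i(t+t₀)`,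
`|Ψ(s)| = exp((2σ−1)²/(8h²) − πu(2σ−1)) (2π)^k |Γ((σ+i(t+t₀))/2)| e^{π(t+t₀)/4} e^{−t²/(2h²)}
|1/2 − σ − it|^k`. [cite: Platt2017, Lemma A.6 p. 2460 (proof, display (A.1))] -/
theorem norm_fourier_kernel_far (k : ℕ) (σ t₀ h u t : ℝ) :
    ‖(fun s : ℂ => Complex.Gamma (s / 2) * Complex.exp (π * (-I * (s - 1 / 2)) / 4) *
        Complex.exp (-(-I * (s - 1 / 2) - t₀) ^ 2 / (2 * h ^ 2)) * (-2 * π * I * (-I * (s - 1 / 2) - t₀)) ^ k *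
        Complex.exp (-2 * π * I * (-I * (s - 1 / 2) - t₀) * u)) ((σ : ℂ) + ((t + t₀ : ℝ) : ℂ) * I)‖ =
      Real.exp ((2 * σ - 1) ^ 2 / (8 * h ^ 2) - π * u * (2 * σ - 1)) * (2 * π) ^ k *
        (‖Complex.Gamma ((σ + (t + t₀) * I) / 2)‖ *
          Real.exp (π * (t + t₀) / 4 - t ^ 2 / (2 * h ^ 2)) * ‖((1 / 2 - σ : ℝ) : ℂ) - t * I‖ ^ k) := by
  rw [norm_fourier_kernel]
  have hn : ‖((1 / 2 - σ : ℝ) : ℂ) - t * I‖ = Real.sqrt ((t + t₀ - t₀) ^ 2 + (1 / 2 - σ) ^ 2) := by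
    have : ((1 / 2 - σ : ℝ) : ℂ) - t * I = ((1 / 2 - σ : ℝ) : ℂ) + ((-t : ℝ) : ℂ) * I := by
      push_cast; ring
    rw [this, Complex.norm_add_mul_I]
    congr 1; ring
  rw [hn]
  have hΓ : Complex.Gamma (((σ : ℂ) + ((t + t₀ : ℝ) : ℂ) * I) / 2) =
      Complex.Gamma ((σ + (t + t₀) * I) / 2) := by
    push_cast; ring_nf
  rw [hΓ]
  have hexp : Real.exp (π * (t + t₀) / 4) * Real.exp (((σ - 1 / 2) ^ 2 - (t + t₀ - t₀) ^ 2) / (2 * h ^ 2)) *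
      Real.exp (-(2 * π * u * (σ - 1 / 2))) =
      Real.exp ((2 * σ - 1) ^ 2 / (8 * h ^ 2) - π * u * (2 * σ - 1)) *
        Real.exp (π * (t + t₀) / 4 - t ^ 2 / (2 * h ^ 2)) := by
    rw [← Real.exp_add, ← Real.exp_add, ← Real.exp_add]
    congr 1
    field_simp
    ring
  linear_combination (‖Complex.Gamma ((σ + (t + t₀) * I) / 2)‖ * ((2 * π) ^ k *
    Real.sqrt ((t + t₀ - t₀) ^ 2 + (1 / 2 - σ) ^ 2) ^ k)) * hexp

/-! ### Lemma A.6, left shift: `u`-free strip bounds and the Mellin–Barnes form `Ψ(2z) = Φ(z) w^{−z} Γ(z)` -/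

/-- The strip majorant of `norm_fourier_kernel_le` for `u` of either sign: on `1/2 ≤ Re s ≤ σ`,
`|e^{−2πu(x−1/2)}| ≤ e^{2π|u|(σ−1/2)}`, so `|Ψ(x+iy)| ≤ K e^{2π|u|(σ−1/2)} e^{−(y−t₁)²/(4h²)}`.
[cite: Platt2017, Lemma A.6 p. 2460 (proof)] -/
theorem norm_fourier_kernel_le' (k : ℕ) {σ t₀ h x : ℝ} (u : ℝ) (hh : 0 < h) (hx : 1 / 2 ≤ x)
    (hxσ : x ≤ σ) (y : ℝ) :
    ‖(fun s : ℂ => Complex.Gamma (s / 2) * Complex.exp (π * (-I * (s - 1 / 2)) / 4) *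
        Complex.exp (-(-I * (s - 1 / 2) - t₀) ^ 2 / (2 * h ^ 2)) * (-2 * π * I * (-I * (s - 1 / 2) - t₀)) ^ k *
        Complex.exp (-2 * π * I * (-I * (s - 1 / 2) - t₀) * u)) ((x : ℂ) + (y : ℂ) * I)‖ ≤
      max (Real.Gamma (1 / 4)) (Real.Gamma (σ / 2)) * Real.exp ((σ - 1 / 2) ^ 2 / (2 * h ^ 2)) *
        (2 * π) ^ k * Real.exp (π * t₀ / 4 + π ^ 2 * h ^ 2 / 32) *
        (k.factorial * Real.exp (π * h ^ 2 / 4 + σ + h ^ 2)) * Real.exp (2 * π * |u| * (σ - 1 / 2)) *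
        Real.exp (-(1 / (4 * h ^ 2)) * (y - (t₀ + π * h ^ 2 / 4)) ^ 2) := by
  -- compare with the `u = |u|·sign` bound at `u' = 0`... we redo the estimate of `norm_fourier_kernel_le`
  have h0 := norm_fourier_kernel_le k (σ := σ) (t₀ := t₀) (u := 0) (x := x) hh le_rfl hx hxσ y
  rw [norm_fourier_kernel] at h0 ⊢
  have hfac : Real.exp (-(2 * π * u * (x - 1 / 2))) ≤ Real.exp (2 * π * |u| * (σ - 1 / 2)) := by
    refine Real.exp_le_exp.mpr ?_
    have h1 : -(2 * π * u * (x - 1 / 2)) ≤ 2 * π * |u| * (x - 1 / 2) := by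
      have hx' : 0 ≤ x - 1 / 2 := by linarith
      have key := mul_le_mul_of_nonneg_left (neg_le_abs u)
        (by positivity : (0 : ℝ) ≤ 2 * π * (x - 1 / 2))
      linarith [key]
    have h2 : 2 * π * |u| * (x - 1 / 2) ≤ 2 * π * |u| * (σ - 1 / 2) := by
      have := abs_nonneg u
      have := Real.pi_pos
      gcongr
    linarith
  have hzero : Real.exp (-(2 * π * (0 : ℝ) * (x - 1 / 2))) = 1 := by simp
  rw [hzero, mul_one] at h0
  have hnn : 0 ≤ ‖Complex.Gamma (((x : ℂ) + y * I) / 2)‖ * Real.exp (π * y / 4) *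
      Real.exp (((x - 1 / 2) ^ 2 - (y - t₀) ^ 2) / (2 * h ^ 2)) *
      ((2 * π) ^ k * Real.sqrt ((y - t₀) ^ 2 + (1 / 2 - x) ^ 2) ^ k) := by positivity
  calc ‖Complex.Gamma (((x : ℂ) + y * I) / 2)‖ * Real.exp (π * y / 4) *
        Real.exp (((x - 1 / 2) ^ 2 - (y - t₀) ^ 2) / (2 * h ^ 2)) *
        ((2 * π) ^ k * Real.sqrt ((y - t₀) ^ 2 + (1 / 2 - x) ^ 2) ^ k) *
        Real.exp (-(2 * π * u * (x - 1 / 2)))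
      ≤ (max (Real.Gamma (1 / 4)) (Real.Gamma (σ / 2)) * Real.exp ((σ - 1 / 2) ^ 2 / (2 * h ^ 2)) *
          (2 * π) ^ k * Real.exp (π * t₀ / 4 + π ^ 2 * h ^ 2 / 32) *
          (k.factorial * Real.exp (π * h ^ 2 / 4 + σ + h ^ 2)) *
          Real.exp (-(1 / (4 * h ^ 2)) * (y - (t₀ + π * h ^ 2 / 4)) ^ 2)) *
          Real.exp (2 * π * |u| * (σ - 1 / 2)) := mul_le_mul h0 hfac (Real.exp_pos _).le (hnn.trans h0)
    _ = _ := by ring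

/-- Integrability of `Ψ` on the vertical lines `1/2 ≤ Re s ≤ σ`, `u` of either sign.
[cite: Platt2017, Lemma A.6 p. 2460 (proof)] -/
theorem integrable_fourier_kernel_vertical' (k : ℕ) {σ t₀ h x : ℝ} (u : ℝ) (hh : 0 < h)
    (hx : 1 / 2 ≤ x) (hxσ : x ≤ σ) :
    Integrable fun y : ℝ => (fun s : ℂ => Complex.Gamma (s / 2) * Complex.exp (π * (-I * (s - 1 / 2)) / 4) *
        Complex.exp (-(-I * (s - 1 / 2) - t₀) ^ 2 / (2 * h ^ 2)) * (-2 * π * I * (-I * (s - 1 / 2) - t₀)) ^ k *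
        Complex.exp (-2 * π * I * (-I * (s - 1 / 2) - t₀) * u)) ((x : ℂ) + (y : ℂ) * I) := by
  set K : ℝ := max (Real.Gamma (1 / 4)) (Real.Gamma (σ / 2)) * Real.exp ((σ - 1 / 2) ^ 2 / (2 * h ^ 2)) *
        (2 * π) ^ k * Real.exp (π * t₀ / 4 + π ^ 2 * h ^ 2 / 32) *
        (k.factorial * Real.exp (π * h ^ 2 / 4 + σ + h ^ 2)) * Real.exp (2 * π * |u| * (σ - 1 / 2)) with hK
  have hb : (0 : ℝ) < 1 / (4 * h ^ 2) := by positivity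
  have hg : Integrable fun y : ℝ => K * Real.exp (-(1 / (4 * h ^ 2)) * (y - (t₀ + π * h ^ 2 / 4)) ^ 2) :=
    ((integrable_exp_neg_mul_sq hb).comp_sub_right (t₀ + π * h ^ 2 / 4)).const_mul K
  have hcont : Continuous fun y : ℝ => (fun s : ℂ => Complex.Gamma (s / 2) * Complex.exp (π * (-I * (s - 1 / 2)) / 4) *
        Complex.exp (-(-I * (s - 1 / 2) - t₀) ^ 2 / (2 * h ^ 2)) * (-2 * π * I * (-I * (s - 1 / 2) - t₀)) ^ k *
        Complex.exp (-2 * π * I * (-I * (s - 1 / 2) - t₀) * u)) ((x : ℂ) + (y : ℂ) * I) := by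
    have hl : Continuous fun y : ℝ => ((x : ℂ) + (y : ℂ) * I) := by fun_prop
    have hon : ContinuousOn (fun s : ℂ => Complex.Gamma (s / 2) * Complex.exp (π * (-I * (s - 1 / 2)) / 4) *
        Complex.exp (-(-I * (s - 1 / 2) - t₀) ^ 2 / (2 * h ^ 2)) * (-2 * π * I * (-I * (s - 1 / 2) - t₀)) ^ k *
        Complex.exp (-2 * π * I * (-I * (s - 1 / 2) - t₀) * u)) {s : ℂ | 0 < s.re} := fun s (hs : 0 < s.re) =>
      (differentiableAt_fourier_kernel k t₀ h u hs).continuousAt.continuousWithinAt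
    have hmem : ∀ y : ℝ, ((x : ℂ) + (y : ℂ) * I) ∈ {s : ℂ | 0 < s.re} := fun y => by
      show 0 < ((x : ℂ) + (y : ℂ) * I).re
      simp; linarith
    exact hon.comp_continuous hl hmem
  refine hg.mono' hcont.aestronglyMeasurable (ae_of_all _ fun y => ?_)
  have hb' := norm_fourier_kernel_le' k (σ := σ) (t₀ := t₀) u hh hx hxσ y
  rw [hK]
  exact hb'

/-- Uniform decay of `Ψ` on the horizontal segments of the strip `1/2 ≤ Re s ≤ σ`, `u` of either sign.
[cite: Platt2017, Lemma A.6 p. 2460 (proof)] -/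
theorem decay_fourier_kernel' (k : ℕ) {σ t₀ h : ℝ} (u : ℝ) (hh : 0 < h) :
    ∀ ε : ℝ, 0 < ε → ∃ T₀ : ℝ, ∀ T : ℝ, T₀ ≤ |T| → ∀ x ∈ Icc (1 / 2 : ℝ) σ,
      ‖(fun s : ℂ => Complex.Gamma (s / 2) * Complex.exp (π * (-I * (s - 1 / 2)) / 4) *
        Complex.exp (-(-I * (s - 1 / 2) - t₀) ^ 2 / (2 * h ^ 2)) * (-2 * π * I * (-I * (s - 1 / 2) - t₀)) ^ k *
        Complex.exp (-2 * π * I * (-I * (s - 1 / 2) - t₀) * u)) ((x : ℂ) + (T : ℂ) * I)‖ ≤ ε := by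
  intro ε hε
  set K : ℝ := max (Real.Gamma (1 / 4)) (Real.Gamma (σ / 2)) * Real.exp ((σ - 1 / 2) ^ 2 / (2 * h ^ 2)) *
        (2 * π) ^ k * Real.exp (π * t₀ / 4 + π ^ 2 * h ^ 2 / 32) *
        (k.factorial * Real.exp (π * h ^ 2 / 4 + σ + h ^ 2)) * Real.exp (2 * π * |u| * (σ - 1 / 2)) with hK
  set t₁ : ℝ := t₀ + π * h ^ 2 / 4 with ht₁
  have hΓ : 0 < max (Real.Gamma (1 / 4)) (Real.Gamma (σ / 2)) :=
    lt_max_of_lt_left (Real.Gamma_pos_of_pos (by norm_num))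
  have hfac : (0 : ℝ) < k.factorial := by exact_mod_cast Nat.factorial_pos k
  have hK0 : 0 < K := by rw [hK]; positivity
  set L : ℝ := max 0 (Real.log (K / ε)) with hL
  have hL0 : 0 ≤ L := le_max_left _ _
  set R : ℝ := 2 * h * Real.sqrt L with hR
  have hR0 : 0 ≤ R := by positivity
  refine ⟨|t₁| + R, fun T hT x hx => ?_⟩
  have hb' := norm_fourier_kernel_le' k (σ := σ) (t₀ := t₀) u hh hx.1 hx.2 T
  refine hb'.trans ?_
  rw [← hK, ← ht₁]
  have hTt : R ≤ |T - t₁| := by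
    have := abs_sub_abs_le_abs_sub T t₁
    linarith
  have hsq : R ^ 2 ≤ (T - t₁) ^ 2 := by
    rw [← sq_abs (T - t₁)]; exact pow_le_pow_left₀ hR0 hTt 2
  have hR2 : R ^ 2 = 4 * h ^ 2 * L := by
    rw [hR, mul_pow, Real.sq_sqrt hL0]; ring
  have hexp : Real.exp (-(1 / (4 * h ^ 2)) * (T - t₁) ^ 2) ≤ ε / K := by
    have h1 : -(1 / (4 * h ^ 2)) * (T - t₁) ^ 2 ≤ -L := by
      rw [hR2] at hsq
      have h4 : 0 < 4 * h ^ 2 := by positivity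
      have : L ≤ (T - t₁) ^ 2 / (4 * h ^ 2) := by rw [le_div_iff₀ h4]; linarith
      have e : -(1 / (4 * h ^ 2)) * (T - t₁) ^ 2 = -((T - t₁) ^ 2 / (4 * h ^ 2)) := by ring
      rw [e]; linarith
    have h2 : Real.log (K / ε) ≤ L := le_max_right _ _
    calc Real.exp (-(1 / (4 * h ^ 2)) * (T - t₁) ^ 2) ≤ Real.exp (-Real.log (K / ε)) :=
          Real.exp_le_exp.mpr (by linarith)
      _ = ε / K := by rw [Real.exp_neg, Real.exp_log (by positivity)]; field_simp
  calc K * Real.exp (-(1 / (4 * h ^ 2)) * (T - t₁) ^ 2) ≤ K * (ε / K) :=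
        mul_le_mul_of_nonneg_left hexp hK0.le
    _ = ε := by field_simp

/-- **«We now move the line of integration»**, `u` of either sign: for `σ ≥ 1/2`,
`∫ Ψ(1/2+iy) dy = ∫ Ψ(σ+iy) dy` (the tree's `integral_vertical_eq_of_differentiableOn`).
[cite: Platt2017, Lemma A.6 p. 2460 (proof)] -/
theorem integral_fourier_kernel_shift (k : ℕ) {σ : ℝ} (t₀ : ℝ) {h : ℝ} (u : ℝ) (hσ : 1 / 2 ≤ σ)
    (hh : 0 < h) :
    ∫ y : ℝ, (fun s : ℂ => Complex.Gamma (s / 2) * Complex.exp (π * (-I * (s - 1 / 2)) / 4) *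
        Complex.exp (-(-I * (s - 1 / 2) - t₀) ^ 2 / (2 * h ^ 2)) * (-2 * π * I * (-I * (s - 1 / 2) - t₀)) ^ k *
        Complex.exp (-2 * π * I * (-I * (s - 1 / 2) - t₀) * u)) (((1 / 2 : ℝ) : ℂ) + ((y : ℝ) : ℂ) * I) = ∫ y : ℝ, (fun s : ℂ => Complex.Gamma (s / 2) * Complex.exp (π * (-I * (s - 1 / 2)) / 4) *
        Complex.exp (-(-I * (s - 1 / 2) - t₀) ^ 2 / (2 * h ^ 2)) * (-2 * π * I * (-I * (s - 1 / 2) - t₀)) ^ k *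
        Complex.exp (-2 * π * I * (-I * (s - 1 / 2) - t₀) * u)) ((σ : ℂ) + ((y : ℝ) : ℂ) * I) := by
  refine Literature.Analysis.Complex.integral_vertical_eq_of_differentiableOn
    (F := (fun s : ℂ => Complex.Gamma (s / 2) * Complex.exp (π * (-I * (s - 1 / 2)) / 4) *
        Complex.exp (-(-I * (s - 1 / 2) - t₀) ^ 2 / (2 * h ^ 2)) * (-2 * π * I * (-I * (s - 1 / 2) - t₀)) ^ k *
        Complex.exp (-2 * π * I * (-I * (s - 1 / 2) - t₀) * u)))
    (a := 1 / 2) (b := σ) hσ ?_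
    (integrable_fourier_kernel_vertical' k (σ := σ) (t₀ := t₀) u hh le_rfl hσ)
    (integrable_fourier_kernel_vertical' k (σ := σ) (t₀ := t₀) u hh hσ le_rfl)
    (decay_fourier_kernel' k (σ := σ) (t₀ := t₀) u hh)
  intro s hs
  have hs' : 1 / 2 ≤ s.re := hs.1
  exact (differentiableAt_fourier_kernel k t₀ h u (by linarith)).differentiableWithinAt

/-- **The Mellin–Barnes form of `Ψ`:** with `w = e^{4πu}` and the ENTIRE function
`Φ(z) = e^{π(−i(2z−1/2))/4} e^{−τ²/(2h²)} (−2πiτ)^k e^{πu + 2πiut₀}` (`τ = −i(2z−1/2) − t₀`),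
`Ψ(2z) = Φ(z) w^{−z} Γ(z)` — the poles of `Γ(s/2)` at `s = 0, −2, …` become the poles of `Γ(z)` at
`z = 0, −1, …`, the setting of the tree's `mellinBarnes_shift_eq_sum`.
[cite: Platt2017, Lemma A.6 p. 2460 (proof: «For u < 0, we move the line of integration left to ℜ(s) = −σ, picking up the poles of Γ(s/2) at s = 0, −2, …, 1−σ»)] -/
theorem fourier_kernel_two_mul (k : ℕ) (t₀ h u : ℝ) (z : ℂ) :
    (fun s : ℂ => Complex.Gamma (s / 2) * Complex.exp (π * (-I * (s - 1 / 2)) / 4) *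
        Complex.exp (-(-I * (s - 1 / 2) - t₀) ^ 2 / (2 * h ^ 2)) * (-2 * π * I * (-I * (s - 1 / 2) - t₀)) ^ k *
        Complex.exp (-2 * π * I * (-I * (s - 1 / 2) - t₀) * u)) (2 * z) = (fun z : ℂ => Complex.exp (π * (-I * (2 * z - 1 / 2)) / 4) *
        Complex.exp (-(-I * (2 * z - 1 / 2) - t₀) ^ 2 / (2 * h ^ 2)) * (-2 * π * I * (-I * (2 * z - 1 / 2) - t₀)) ^ k *
        Complex.exp (π * u + 2 * π * u * t₀ * I)) z * (((Real.exp (4 * π * u) : ℝ) : ℂ) ^ (-z) * Complex.Gamma z) := by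
  have hw : (((Real.exp (4 * π * u) : ℝ) : ℂ) ^ (-z) : ℂ) = Complex.exp (-(4 * π * u) * z) := by
    rw [Complex.cpow_def_of_ne_zero (by exact_mod_cast (Real.exp_pos _).ne'),
      ← Complex.ofReal_log (Real.exp_pos _).le, Real.log_exp]
    congr 1
    push_cast
    ring
  simp only []
  rw [hw, show (2 : ℂ) * z / 2 = z by ring]
  have h4 : Complex.exp (-2 * π * I * (-I * (2 * z - 1 / 2) - t₀) * u) =
      Complex.exp (π * u + 2 * π * u * t₀ * I) * Complex.exp (-(4 * π * u) * z) := by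
    rw [← Complex.exp_add]
    congr 1
    have hI : (I : ℂ) ^ 2 = -1 := Complex.I_sq
    linear_combination (π * u * (4 * z - 1)) * hI
  rw [h4]
  ring

/-- `Φ` is entire. [cite: Platt2017, Lemma A.6 p. 2460 (proof)] -/
theorem differentiable_fourier_cofactor (k : ℕ) (t₀ h u : ℝ) : Differentiable ℂ (fun z : ℂ => Complex.exp (π * (-I * (2 * z - 1 / 2)) / 4) *
        Complex.exp (-(-I * (2 * z - 1 / 2) - t₀) ^ 2 / (2 * h ^ 2)) * (-2 * π * I * (-I * (2 * z - 1 / 2) - t₀)) ^ k *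
        Complex.exp (π * u + 2 * π * u * t₀ * I)) := by
  fun_prop

/-- **The modulus of `Φ` at `z = x + iy`:**
`|Φ(x+iy)| = e^{πy/2} e^{((2x−1/2)² − (2y−t₀)²)/(2h²)} (2π)^k ((2y−t₀)² + (1/2−2x)²)^{k/2} e^{πu}`.
[cite: Platt2017, Lemma A.6 p. 2460 (proof)] -/
theorem norm_fourier_cofactor (k : ℕ) (t₀ h u x y : ℝ) :
    ‖(fun z : ℂ => Complex.exp (π * (-I * (2 * z - 1 / 2)) / 4) *
        Complex.exp (-(-I * (2 * z - 1 / 2) - t₀) ^ 2 / (2 * h ^ 2)) * (-2 * π * I * (-I * (2 * z - 1 / 2) - t₀)) ^ k *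
        Complex.exp (π * u + 2 * π * u * t₀ * I)) ((x : ℂ) + (y : ℂ) * I)‖ =
      Real.exp (π * (2 * y) / 4) * Real.exp (((2 * x - 1 / 2) ^ 2 - (2 * y - t₀) ^ 2) / (2 * h ^ 2)) *
        ((2 * π) ^ k * Real.sqrt ((2 * y - t₀) ^ 2 + (1 / 2 - 2 * x) ^ 2) ^ k) * Real.exp (π * u) := by
  have h2 : (2 : ℂ) * ((x : ℂ) + (y : ℂ) * I) = ((2 * x : ℝ) : ℂ) + ((2 * y : ℝ) : ℂ) * I := by
    push_cast; ring
  have hτ := time_var_eq (2 * x) (2 * y) t₀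
  have hτ' := time_var_eq' (2 * x) (2 * y)
  simp only []
  rw [h2, hτ, hτ']
  set a : ℝ := 2 * y - t₀ with ha
  set c : ℝ := 1 / 2 - 2 * x with hc
  have e1 : (π * ((((2 * y : ℝ)) : ℂ) + ((c : ℝ) : ℂ) * I) / 4 : ℂ) =
      ((π * (2 * y) / 4 : ℝ) : ℂ) + ((π * c / 4 : ℝ) : ℂ) * I := by push_cast; ring
  have hsq : ((((a : ℝ) : ℂ) + ((c : ℝ) : ℂ) * I) ^ 2 : ℂ) = ((a ^ 2 - c ^ 2 : ℝ) : ℂ) + ((2 * a * c : ℝ) : ℂ) * I := by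
    have hI : (I : ℂ) ^ 2 = -1 := Complex.I_sq
    push_cast
    linear_combination ((c : ℂ) ^ 2) * hI
  have e2 : (-(((a : ℝ) : ℂ) + ((c : ℝ) : ℂ) * I) ^ 2 / (2 * h ^ 2) : ℂ) =
      ((-(a ^ 2 - c ^ 2) / (2 * h ^ 2) : ℝ) : ℂ) + ((-(2 * a * c) / (2 * h ^ 2) : ℝ) : ℂ) * I := by
    rw [hsq]; push_cast; ring
  have e3 : (π * u + 2 * π * u * t₀ * I : ℂ) = ((π * u : ℝ) : ℂ) + ((2 * π * u * t₀ : ℝ) : ℂ) * I := by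
    push_cast; ring
  have e4 : (-2 * π * I * (((a : ℝ) : ℂ) + ((c : ℝ) : ℂ) * I) : ℂ) =
      ((2 * π * c : ℝ) : ℂ) + ((-(2 * π * a) : ℝ) : ℂ) * I := by
    have hI : (I : ℂ) ^ 2 = -1 := Complex.I_sq
    push_cast
    linear_combination (-2 * π * (c : ℂ)) * hI
  rw [e1, e2, e3, norm_mul, norm_mul, norm_mul, norm_pow, e4, norm_exp_ofReal_add,
    norm_exp_ofReal_add, norm_exp_ofReal_add, Complex.norm_add_mul_I]
  have hnorm : Real.sqrt ((2 * π * c) ^ 2 + (-(2 * π * a)) ^ 2) = 2 * π * Real.sqrt (a ^ 2 + c ^ 2) := by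
    rw [show (2 * π * c) ^ 2 + (-(2 * π * a)) ^ 2 = (2 * π) ^ 2 * (a ^ 2 + c ^ 2) by ring,
      Real.sqrt_mul (by positivity), Real.sqrt_sq (by positivity)]
  have ec1 : -(a ^ 2 - c ^ 2) / (2 * h ^ 2) = ((2 * x - 1 / 2) ^ 2 - a ^ 2) / (2 * h ^ 2) := by
    rw [hc]; ring
  rw [hnorm, mul_pow, ec1]

/-- **A bound for `Φ` uniform in `Im z`:**
`|Φ(x+iy)| ≤ e^{(2|x|+1/2)²/(2h²)} (2π)^k e^{πt₀/4 + π²h²/32} k! e^{πh²/4 + 1/2 + 2|x| + h²} e^{πu}`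
(completing the square and `(v+d)^k e^{−v²/(4h²)} ≤ k! e^{d+h²}` as in `norm_fourier_kernel_le`).
[cite: Platt2017, Lemma A.6 p. 2460 (proof)] -/
theorem norm_fourier_cofactor_le (k : ℕ) {t₀ h : ℝ} (u : ℝ) (hh : 0 < h) (x y : ℝ) :
    ‖(fun z : ℂ => Complex.exp (π * (-I * (2 * z - 1 / 2)) / 4) *
        Complex.exp (-(-I * (2 * z - 1 / 2) - t₀) ^ 2 / (2 * h ^ 2)) * (-2 * π * I * (-I * (2 * z - 1 / 2) - t₀)) ^ k *
        Complex.exp (π * u + 2 * π * u * t₀ * I)) ((x : ℂ) + (y : ℂ) * I)‖ ≤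
      Real.exp ((2 * |x| + 1 / 2) ^ 2 / (2 * h ^ 2)) * (2 * π) ^ k *
        Real.exp (π * t₀ / 4 + π ^ 2 * h ^ 2 / 32) *
        (k.factorial * Real.exp (π * h ^ 2 / 4 + (1 / 2 + 2 * |x|) + h ^ 2)) * Real.exp (π * u) := by
  rw [norm_fourier_cofactor]
  set t₁ : ℝ := t₀ + π * h ^ 2 / 4 with ht₁
  set v : ℝ := |2 * y - t₁| with hv
  set d : ℝ := π * h ^ 2 / 4 + (1 / 2 + 2 * |x|) with hd
  have hd0 : 0 ≤ d := by rw [hd]; positivity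
  have hgauss : Real.exp (π * (2 * y) / 4) * Real.exp (((2 * x - 1 / 2) ^ 2 - (2 * y - t₀) ^ 2) / (2 * h ^ 2)) =
      Real.exp ((2 * x - 1 / 2) ^ 2 / (2 * h ^ 2)) * Real.exp (π * t₀ / 4 + π ^ 2 * h ^ 2 / 32) *
        Real.exp (-((2 * y - t₁) ^ 2 / (2 * h ^ 2))) := by
    rw [← Real.exp_add, ← Real.exp_add, ← Real.exp_add]
    congr 1
    rw [ht₁]
    field_simp
    ring
  have hx2 : Real.exp ((2 * x - 1 / 2) ^ 2 / (2 * h ^ 2)) ≤ Real.exp ((2 * |x| + 1 / 2) ^ 2 / (2 * h ^ 2)) := by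
    refine Real.exp_le_exp.mpr (div_le_div_of_nonneg_right ?_ (by positivity))
    have h1 : |2 * x - 1 / 2| ≤ 2 * |x| + 1 / 2 := by
      have := abs_sub (2 * x) (1 / 2)
      rw [abs_mul, abs_of_pos (by norm_num : (0 : ℝ) < 2), abs_of_pos (by norm_num : (0 : ℝ) < 1 / 2)] at this
      exact this
    have h2 : 0 ≤ 2 * |x| + 1 / 2 := by positivity
    rw [← sq_abs (2 * x - 1 / 2)]
    exact pow_le_pow_left₀ (abs_nonneg _) h1 2
  have hρ : Real.sqrt ((2 * y - t₀) ^ 2 + (1 / 2 - 2 * x) ^ 2) ≤ v + d := by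
    have h1 : Real.sqrt ((2 * y - t₀) ^ 2 + (1 / 2 - 2 * x) ^ 2) ≤ |2 * y - t₀| + |1 / 2 - 2 * x| := by
      rw [show (2 * y - t₀) ^ 2 + (1 / 2 - 2 * x) ^ 2 = |2 * y - t₀| ^ 2 + |1 / 2 - 2 * x| ^ 2 by
        rw [sq_abs, sq_abs]]
      refine Real.sqrt_le_iff.mpr ⟨by positivity, ?_⟩
      nlinarith [abs_nonneg (2 * y - t₀), abs_nonneg (1 / 2 - 2 * x)]
    have h2 : |2 * y - t₀| ≤ v + π * h ^ 2 / 4 := by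
      rw [hv, ht₁]
      have := abs_sub_abs_le_abs_sub (2 * y - t₀) (2 * y - (t₀ + π * h ^ 2 / 4))
      rw [show 2 * y - t₀ - (2 * y - (t₀ + π * h ^ 2 / 4)) = π * h ^ 2 / 4 by ring,
        abs_of_pos (by positivity : (0 : ℝ) < π * h ^ 2 / 4)] at this
      linarith
    have h3 : |1 / 2 - 2 * x| ≤ 1 / 2 + 2 * |x| := by
      have := abs_sub (1 / 2 : ℝ) (2 * x)
      rw [abs_mul, abs_of_pos (by norm_num : (0 : ℝ) < 2), abs_of_pos (by norm_num : (0 : ℝ) < 1 / 2)] at this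
      exact this
    rw [hd]; linarith
  have hρk : Real.sqrt ((2 * y - t₀) ^ 2 + (1 / 2 - 2 * x) ^ 2) ^ k ≤ (v + d) ^ k :=
    pow_le_pow_left₀ (Real.sqrt_nonneg _) hρ k
  have hsplit : Real.exp (-((2 * y - t₁) ^ 2 / (2 * h ^ 2))) ≤ Real.exp (-(v ^ 2 / (4 * h ^ 2))) := by
    refine Real.exp_le_exp.mpr ?_
    rw [hv, sq_abs]
    have : 0 ≤ (2 * y - t₁) ^ 2 / (4 * h ^ 2) := by positivity
    have e : (2 * y - t₁) ^ 2 / (2 * h ^ 2) = 2 * ((2 * y - t₁) ^ 2 / (4 * h ^ 2)) := by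
      field_simp; ring
    rw [e]; linarith
  have hpoly : (v + d) ^ k * Real.exp (-(v ^ 2 / (4 * h ^ 2))) ≤ k.factorial * Real.exp (d + h ^ 2) :=
    pow_mul_gauss_le k (abs_nonneg _) hd0 hh
  calc Real.exp (π * (2 * y) / 4) * Real.exp (((2 * x - 1 / 2) ^ 2 - (2 * y - t₀) ^ 2) / (2 * h ^ 2)) *
        ((2 * π) ^ k * Real.sqrt ((2 * y - t₀) ^ 2 + (1 / 2 - 2 * x) ^ 2) ^ k) * Real.exp (π * u)
      = (Real.exp (π * (2 * y) / 4) * Real.exp (((2 * x - 1 / 2) ^ 2 - (2 * y - t₀) ^ 2) / (2 * h ^ 2))) *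
          ((2 * π) ^ k * Real.sqrt ((2 * y - t₀) ^ 2 + (1 / 2 - 2 * x) ^ 2) ^ k) * Real.exp (π * u) := by
        ring
    _ ≤ (Real.exp ((2 * |x| + 1 / 2) ^ 2 / (2 * h ^ 2)) * Real.exp (π * t₀ / 4 + π ^ 2 * h ^ 2 / 32) *
          Real.exp (-(v ^ 2 / (4 * h ^ 2)))) * ((2 * π) ^ k * (v + d) ^ k) * Real.exp (π * u) := by
        rw [hgauss]
        gcongr
    _ = Real.exp ((2 * |x| + 1 / 2) ^ 2 / (2 * h ^ 2)) * (2 * π) ^ k *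
          Real.exp (π * t₀ / 4 + π ^ 2 * h ^ 2 / 32) *
          ((v + d) ^ k * Real.exp (-(v ^ 2 / (4 * h ^ 2)))) * Real.exp (π * u) := by ring
    _ ≤ Real.exp ((2 * |x| + 1 / 2) ^ 2 / (2 * h ^ 2)) * (2 * π) ^ k *
          Real.exp (π * t₀ / 4 + π ^ 2 * h ^ 2 / 32) *
          (k.factorial * Real.exp (d + h ^ 2)) * Real.exp (π * u) := by
        gcongr
    _ = _ := by rw [hd]

/-- The bound of `norm_fourier_cofactor_le` is monotone in `|x|`: on a strip `|Re z| ≤ X` it is at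
most its value at `X`. [cite: Platt2017, Lemma A.6 p. 2460 (proof)] -/
theorem norm_fourier_cofactor_le_of_abs_le (k : ℕ) {t₀ h X : ℝ} (u : ℝ) (hh : 0 < h) {x : ℝ}
    (hx : |x| ≤ X) (y : ℝ) :
    ‖(fun z : ℂ => Complex.exp (π * (-I * (2 * z - 1 / 2)) / 4) *
        Complex.exp (-(-I * (2 * z - 1 / 2) - t₀) ^ 2 / (2 * h ^ 2)) * (-2 * π * I * (-I * (2 * z - 1 / 2) - t₀)) ^ k *
        Complex.exp (π * u + 2 * π * u * t₀ * I)) ((x : ℂ) + (y : ℂ) * I)‖ ≤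
      Real.exp ((2 * X + 1 / 2) ^ 2 / (2 * h ^ 2)) * (2 * π) ^ k *
        Real.exp (π * t₀ / 4 + π ^ 2 * h ^ 2 / 32) *
        (k.factorial * Real.exp (π * h ^ 2 / 4 + (1 / 2 + 2 * X) + h ^ 2)) * Real.exp (π * u) := by
  refine (norm_fourier_cofactor_le k u hh x y).trans ?_
  have h0 : 0 ≤ |x| := abs_nonneg x
  have h1 : Real.exp ((2 * |x| + 1 / 2) ^ 2 / (2 * h ^ 2)) ≤ Real.exp ((2 * X + 1 / 2) ^ 2 / (2 * h ^ 2)) := by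
    refine Real.exp_le_exp.mpr (div_le_div_of_nonneg_right ?_ (by positivity))
    exact pow_le_pow_left₀ (by positivity) (by linarith) 2
  have h2 : Real.exp (π * h ^ 2 / 4 + (1 / 2 + 2 * |x|) + h ^ 2) ≤
      Real.exp (π * h ^ 2 / 4 + (1 / 2 + 2 * X) + h ^ 2) := Real.exp_le_exp.mpr (by linarith)
  have hfac : (0 : ℝ) ≤ k.factorial := Nat.cast_nonneg _
  gcongr

/-- **`Ψ` on the left line `Re s = −σ`:** at `s = −σ + i(t+t₀)`,
`|Ψ(s)| = exp((2σ+1)²/(8h²) + (2σ+1)πu) (2π)^k |Γ((−σ+i(t+t₀))/2)| e^{π(t+t₀)/4} e^{−t²/(2h²)}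
|σ + 1/2 − it|^k` (the display «The integral which remains is now …» of p. 2460).
[cite: Platt2017, Lemma A.6 p. 2460 (proof)] -/
theorem norm_fourier_kernel_far_left (k : ℕ) (σ t₀ h u t : ℝ) :
    ‖(fun s : ℂ => Complex.Gamma (s / 2) * Complex.exp (π * (-I * (s - 1 / 2)) / 4) *
        Complex.exp (-(-I * (s - 1 / 2) - t₀) ^ 2 / (2 * h ^ 2)) * (-2 * π * I * (-I * (s - 1 / 2) - t₀)) ^ k *
        Complex.exp (-2 * π * I * (-I * (s - 1 / 2) - t₀) * u)) (((-σ : ℝ) : ℂ) + ((t + t₀ : ℝ) : ℂ) * I)‖ =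
      Real.exp ((2 * σ + 1) ^ 2 / (8 * h ^ 2) + (2 * σ + 1) * π * u) * (2 * π) ^ k *
        (‖Complex.Gamma ((-σ + (t + t₀) * I) / 2)‖ *
          Real.exp (π * (t + t₀) / 4 - t ^ 2 / (2 * h ^ 2)) * ‖((σ + 1 / 2 : ℝ) : ℂ) - t * I‖ ^ k) := by
  rw [norm_fourier_kernel]
  have hn : ‖((σ + 1 / 2 : ℝ) : ℂ) - t * I‖ = Real.sqrt ((t + t₀ - t₀) ^ 2 + (1 / 2 - (-σ)) ^ 2) := by
    have : ((σ + 1 / 2 : ℝ) : ℂ) - t * I = ((σ + 1 / 2 : ℝ) : ℂ) + ((-t : ℝ) : ℂ) * I := by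
      push_cast; ring
    rw [this, Complex.norm_add_mul_I]
    congr 1; ring
  rw [hn]
  have hΓ : Complex.Gamma ((((-σ : ℝ) : ℂ) + ((t + t₀ : ℝ) : ℂ) * I) / 2) =
      Complex.Gamma ((-σ + (t + t₀) * I) / 2) := by
    push_cast; ring_nf
  rw [hΓ]
  have hexp : Real.exp (π * (t + t₀) / 4) * Real.exp ((((-σ) - 1 / 2) ^ 2 - (t + t₀ - t₀) ^ 2) / (2 * h ^ 2)) *
      Real.exp (-(2 * π * u * ((-σ) - 1 / 2))) =
      Real.exp ((2 * σ + 1) ^ 2 / (8 * h ^ 2) + (2 * σ + 1) * π * u) *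
        Real.exp (π * (t + t₀) / 4 - t ^ 2 / (2 * h ^ 2)) := by
    rw [← Real.exp_add, ← Real.exp_add, ← Real.exp_add]
    congr 1
    field_simp
    ring
  linear_combination (‖Complex.Gamma ((-σ + (t + t₀) * I) / 2)‖ * ((2 * π) ^ k *
    Real.sqrt ((t + t₀ - t₀) ^ 2 + (1 / 2 - (-σ)) ^ 2) ^ k)) * hexp

/-- **The residues:** `4π |Φ(−j)| w^j / j! = 2^{k+2} π^{k+1} e^{−t₀²/(2h²)} ((2j+1/2)²+t₀²)^{k/2}/j! ·
e^{(4j+1)²/(8h²) + (4j+1)πu}` (`w = e^{4πu}`) — the `j`-th term of the second sum of Lemma A.6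
(`|2πi Res_{s=−2j}| = 2π · 2/j! · |Φ̃(−2j)|`). [cite: Platt2017, Lemma A.6 p. 2460 (statement, second term)] -/
theorem residue_term_eq (k : ℕ) (t₀ h u : ℝ) (j : ℕ) :
    4 * π * (‖(fun z : ℂ => Complex.exp (π * (-I * (2 * z - 1 / 2)) / 4) *
        Complex.exp (-(-I * (2 * z - 1 / 2) - t₀) ^ 2 / (2 * h ^ 2)) * (-2 * π * I * (-I * (2 * z - 1 / 2) - t₀)) ^ k *
        Complex.exp (π * u + 2 * π * u * t₀ * I)) (-(j : ℂ))‖ * Real.exp (4 * π * u) ^ j / (j.factorial : ℝ)) =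
      2 ^ (k + 2) * π ^ (k + 1) * Real.exp (-(t₀ ^ 2 / (2 * h ^ 2))) *
        (((2 * j + 1 / 2) ^ 2 + t₀ ^ 2) ^ ((k : ℝ) / 2) / (j.factorial : ℝ) *
          Real.exp ((4 * j + 1) ^ 2 / (8 * h ^ 2) + (4 * j + 1) * π * u)) := by
  have hj : (-(j : ℂ)) = (((-(j : ℝ)) : ℝ) : ℂ) + (((0 : ℝ) : ℝ) : ℂ) * I := by push_cast; ring
  rw [hj, norm_fourier_cofactor]
  have hsq : Real.sqrt ((2 * (0 : ℝ) - t₀) ^ 2 + (1 / 2 - 2 * (-(j : ℝ))) ^ 2) ^ k =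
      ((2 * j + 1 / 2) ^ 2 + t₀ ^ 2) ^ ((k : ℝ) / 2) := by
    rw [show (2 * (0 : ℝ) - t₀) ^ 2 + (1 / 2 - 2 * (-(j : ℝ))) ^ 2 = (2 * j + 1 / 2) ^ 2 + t₀ ^ 2 by ring,
      Real.sqrt_eq_rpow, ← Real.rpow_natCast, ← Real.rpow_mul (by positivity)]
    congr 1; ring
  have hexp : Real.exp (π * (2 * (0 : ℝ)) / 4) *
      Real.exp (((2 * (-(j : ℝ)) - 1 / 2) ^ 2 - (2 * (0 : ℝ) - t₀) ^ 2) / (2 * h ^ 2)) * Real.exp (π * u) *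
      Real.exp (4 * π * u) ^ j =
      Real.exp (-(t₀ ^ 2 / (2 * h ^ 2))) * Real.exp ((4 * j + 1) ^ 2 / (8 * h ^ 2) + (4 * j + 1) * π * u) := by
    rw [← Real.exp_nat_mul, ← Real.exp_add, ← Real.exp_add, ← Real.exp_add, ← Real.exp_add]
    congr 1
    field_simp
    ring
  rw [hsq]
  linear_combination ((2 * π) ^ k * ((2 * j + 1 / 2) ^ 2 + t₀ ^ 2) ^ ((k : ℝ) / 2) * 4 * π /
    (j.factorial : ℝ)) * hexp

end Platt2017

open Platt2017 in
/-- **Platt 2017, Lemma A.6 (p. 2460) — the right shift (`u ≥ 0`), PROVED:** «Proof. First we consider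
`u ≥ 0`. We write `|G^{(k)}(u)| = |∫_{−∞}^{∞} Γ((1/2+i(t+t₀))/2) exp(π(t+t₀)/4 − t²/(2h²)) (−2πit)^k
e(−tu) dt|`. Substituting `s = 1/2 + i(t+t₀)`, we now move the line of integration right to
`ℜ(s) = σ` giving (A.1) `|G^{(k)}(u)| ≤ exp((2σ−1)²/(8h²) − πu(2σ−1)) (2π)^k
× ∫_{−∞}^{∞} |Γ((σ+i(t+t₀))/2) exp(π(t+t₀)/4) exp(−t²/(2h²)) (1/2 − σ − it)^k| dt`.» Here
`e(x) = e^{2πix}`, `G^{(k)}` is the Fourier transform of `g(t;k)` (step (3) of §3), the right-hand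
integral is at most `C(σ,t₀,h,k)/(2π)^k` of Lemma A.3 (`|1/2−σ−it| ≤ |1/2+σ−it|`;
`platt2017_lemmaA3_corrected`), and the statement holds for every real `σ ≥ 1/2`, `h > 0`, `u ≥ 0`,
`t₀ ∈ ℝ`, `k ∈ ℕ`. The contour shift is the tree's
`Literature.Analysis.Complex.integral_vertical_eq_of_differentiableOn` (rectangles `|Im s| ≤ T`,
`T → ∞`), justified by `Platt2017.differentiableAt_fourier_kernel` (no pole of `Γ(s/2)` on
`Re s > 0`), `integrable_fourier_kernel_vertical` and `decay_fourier_kernel` (the Gaussian majorant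
`norm_fourier_kernel_le` on the strip); the modulus on the far line is `norm_fourier_kernel_far`.
NOT typed: the case `u < 0` (shift left to `Re s = −σ` past the poles `s = 0, −2, …, 1−σ` of
`Γ(s/2)`, whose residues give the second term of Lemma A.6).
[cite: Platt2017, Lemma A.6 p. 2460 (statement and proof, display (A.1))] -/
theorem platt2017_lemmaA6_right (k : ℕ) {σ t₀ h u : ℝ} (hσ : 1 / 2 ≤ σ) (hh : 0 < h) (hu : 0 ≤ u) :
    ‖∫ t : ℝ, Complex.Gamma ((1 / 2 + (t + t₀) * I) / 2) *
        Complex.exp ((π * (t + t₀) / 4 - t ^ 2 / (2 * h ^ 2) : ℝ) : ℂ) * (-(2 * π * t : ℝ) * I) ^ k *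
        Complex.exp (-(2 * π * t * u : ℝ) * I)‖ ≤
      Real.exp ((2 * σ - 1) ^ 2 / (8 * h ^ 2) - π * u * (2 * σ - 1)) * (2 * π) ^ k *
        ∫ t : ℝ, ‖Complex.Gamma ((σ + (t + t₀) * I) / 2)‖ *
          Real.exp (π * (t + t₀) / 4 - t ^ 2 / (2 * h ^ 2)) * ‖((1 / 2 - σ : ℝ) : ℂ) - t * I‖ ^ k := by
  -- the integrand is `Ψ(1/2 + i(t+t₀))`
  have hker : (fun t : ℝ => Complex.Gamma ((1 / 2 + (t + t₀) * I) / 2) *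
      Complex.exp ((π * (t + t₀) / 4 - t ^ 2 / (2 * h ^ 2) : ℝ) : ℂ) * (-(2 * π * t : ℝ) * I) ^ k *
      Complex.exp (-(2 * π * t * u : ℝ) * I)) =
      fun t : ℝ => (fun s : ℂ => Complex.Gamma (s / 2) * Complex.exp (π * (-I * (s - 1 / 2)) / 4) *
        Complex.exp (-(-I * (s - 1 / 2) - t₀) ^ 2 / (2 * h ^ 2)) * (-2 * π * I * (-I * (s - 1 / 2) - t₀)) ^ k *
        Complex.exp (-2 * π * I * (-I * (s - 1 / 2) - t₀) * u)) (((1 / 2 : ℝ) : ℂ) + ((t + t₀ : ℝ) : ℂ) * I) :=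
    funext fun t => fourier_kernel_eq k t₀ h u t
  rw [hker]
  -- translate `t ↦ t + t₀`, shift the line, translate back
  have htr1 : ∫ t : ℝ, (fun s : ℂ => Complex.Gamma (s / 2) * Complex.exp (π * (-I * (s - 1 / 2)) / 4) *
        Complex.exp (-(-I * (s - 1 / 2) - t₀) ^ 2 / (2 * h ^ 2)) * (-2 * π * I * (-I * (s - 1 / 2) - t₀)) ^ k *
        Complex.exp (-2 * π * I * (-I * (s - 1 / 2) - t₀) * u)) (((1 / 2 : ℝ) : ℂ) + ((t + t₀ : ℝ) : ℂ) * I) =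
      ∫ y : ℝ, (fun s : ℂ => Complex.Gamma (s / 2) * Complex.exp (π * (-I * (s - 1 / 2)) / 4) *
        Complex.exp (-(-I * (s - 1 / 2) - t₀) ^ 2 / (2 * h ^ 2)) * (-2 * π * I * (-I * (s - 1 / 2) - t₀)) ^ k *
        Complex.exp (-2 * π * I * (-I * (s - 1 / 2) - t₀) * u)) (((1 / 2 : ℝ) : ℂ) + ((y : ℝ) : ℂ) * I) :=
    integral_add_right_eq_self (μ := volume) (fun y : ℝ => (fun s : ℂ => Complex.Gamma (s / 2) * Complex.exp (π * (-I * (s - 1 / 2)) / 4) *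
        Complex.exp (-(-I * (s - 1 / 2) - t₀) ^ 2 / (2 * h ^ 2)) * (-2 * π * I * (-I * (s - 1 / 2) - t₀)) ^ k *
        Complex.exp (-2 * π * I * (-I * (s - 1 / 2) - t₀) * u)) (((1 / 2 : ℝ) : ℂ) + ((y : ℝ) : ℂ) * I)) t₀
  have htr2 : ∫ t : ℝ, (fun s : ℂ => Complex.Gamma (s / 2) * Complex.exp (π * (-I * (s - 1 / 2)) / 4) *
        Complex.exp (-(-I * (s - 1 / 2) - t₀) ^ 2 / (2 * h ^ 2)) * (-2 * π * I * (-I * (s - 1 / 2) - t₀)) ^ k *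
        Complex.exp (-2 * π * I * (-I * (s - 1 / 2) - t₀) * u)) ((σ : ℂ) + ((t + t₀ : ℝ) : ℂ) * I) =
      ∫ y : ℝ, (fun s : ℂ => Complex.Gamma (s / 2) * Complex.exp (π * (-I * (s - 1 / 2)) / 4) *
        Complex.exp (-(-I * (s - 1 / 2) - t₀) ^ 2 / (2 * h ^ 2)) * (-2 * π * I * (-I * (s - 1 / 2) - t₀)) ^ k *
        Complex.exp (-2 * π * I * (-I * (s - 1 / 2) - t₀) * u)) ((σ : ℂ) + ((y : ℝ) : ℂ) * I) :=
    integral_add_right_eq_self (μ := volume) (fun y : ℝ => (fun s : ℂ => Complex.Gamma (s / 2) * Complex.exp (π * (-I * (s - 1 / 2)) / 4) *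
        Complex.exp (-(-I * (s - 1 / 2) - t₀) ^ 2 / (2 * h ^ 2)) * (-2 * π * I * (-I * (s - 1 / 2) - t₀)) ^ k *
        Complex.exp (-2 * π * I * (-I * (s - 1 / 2) - t₀) * u)) ((σ : ℂ) + ((y : ℝ) : ℂ) * I)) t₀
  have hshift : ∫ y : ℝ, (fun s : ℂ => Complex.Gamma (s / 2) * Complex.exp (π * (-I * (s - 1 / 2)) / 4) *
        Complex.exp (-(-I * (s - 1 / 2) - t₀) ^ 2 / (2 * h ^ 2)) * (-2 * π * I * (-I * (s - 1 / 2) - t₀)) ^ k *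
        Complex.exp (-2 * π * I * (-I * (s - 1 / 2) - t₀) * u)) (((1 / 2 : ℝ) : ℂ) + ((y : ℝ) : ℂ) * I) =
      ∫ y : ℝ, (fun s : ℂ => Complex.Gamma (s / 2) * Complex.exp (π * (-I * (s - 1 / 2)) / 4) *
        Complex.exp (-(-I * (s - 1 / 2) - t₀) ^ 2 / (2 * h ^ 2)) * (-2 * π * I * (-I * (s - 1 / 2) - t₀)) ^ k *
        Complex.exp (-2 * π * I * (-I * (s - 1 / 2) - t₀) * u)) ((σ : ℂ) + ((y : ℝ) : ℂ) * I) := by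
    refine Literature.Analysis.Complex.integral_vertical_eq_of_differentiableOn
      (F := (fun s : ℂ => Complex.Gamma (s / 2) * Complex.exp (π * (-I * (s - 1 / 2)) / 4) *
        Complex.exp (-(-I * (s - 1 / 2) - t₀) ^ 2 / (2 * h ^ 2)) * (-2 * π * I * (-I * (s - 1 / 2) - t₀)) ^ k *
        Complex.exp (-2 * π * I * (-I * (s - 1 / 2) - t₀) * u)))
      (a := 1 / 2) (b := σ) hσ ?_
      (integrable_fourier_kernel_vertical k (t₀ := t₀) hh hu le_rfl hσ)
      (integrable_fourier_kernel_vertical k (t₀ := t₀) hh hu hσ le_rfl)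
      (decay_fourier_kernel k (σ := σ) (t₀ := t₀) hh hu)
    intro s hs
    have hs' : 1 / 2 ≤ s.re := hs.1
    exact (differentiableAt_fourier_kernel k t₀ h u (by linarith)).differentiableWithinAt
  rw [htr1, hshift, ← htr2]
  refine (norm_integral_le_integral_norm _).trans (le_of_eq ?_)
  have hfar : (fun t : ℝ => ‖(fun s : ℂ => Complex.Gamma (s / 2) * Complex.exp (π * (-I * (s - 1 / 2)) / 4) *
        Complex.exp (-(-I * (s - 1 / 2) - t₀) ^ 2 / (2 * h ^ 2)) * (-2 * π * I * (-I * (s - 1 / 2) - t₀)) ^ k *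
        Complex.exp (-2 * π * I * (-I * (s - 1 / 2) - t₀) * u)) ((σ : ℂ) + ((t + t₀ : ℝ) : ℂ) * I)‖) = fun t : ℝ =>
      Real.exp ((2 * σ - 1) ^ 2 / (8 * h ^ 2) - π * u * (2 * σ - 1)) * (2 * π) ^ k *
        (‖Complex.Gamma ((σ + (t + t₀) * I) / 2)‖ *
          Real.exp (π * (t + t₀) / 4 - t ^ 2 / (2 * h ^ 2)) * ‖((1 / 2 - σ : ℝ) : ℂ) - t * I‖ ^ k) :=
    funext fun t => norm_fourier_kernel_far k σ t₀ h u t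
  rw [hfar, integral_const_mul]

open Platt2017 in
/-- **Platt 2017, Lemma A.6 (p. 2460) — the left shift, PROVED in the form the printed proof reaches
before its last sentence:** «For `u < 0`, we move the line of integration left to `ℜ(s) = −σ`,
picking up the poles of `Γ(s/2)` at `s = 0, −2, …, 1 − σ`. These give a contribution bounded by
`2^{k+2} π^{k+1} exp(−t₀²/(2h²)) Σ_{l=0}^{(σ−1)/2} ((2l+1/2)² + t₀²)^{k/2}/l! · exp((4l+1)²/(8h²) + (4l+1)πu)`.
The integral which remains is now `(2π)^k exp((2σ+1)²/(8h²) + (2σ+1)πu)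
× ∫_{−∞}^{∞} |Γ((−σ+i(t+t₀))/2) exp(π(t+t₀)/4 − t²/(2h²)) (σ + 1/2 − it)^k| dt`. Finally, for our
range of `σ` and for `t ∈ ℝ`, we have `|Γ(−σ/2 + it)| < |Γ(σ/2 + it)|` and the result follows.» Here
`σ = 2m + 1` (`m ∈ ℕ`), `h > 0`, `t₀, u ∈ ℝ` (the bound holds for every `u`; it is the useful one for
`u < 0`), `G^{(k)}(u) = ∫ g(t;k) e(−tu) dt` written out as in `platt2017_lemmaA6_right`:
`|G^{(k)}(u)| ≤ [the integral which remains] + [the contribution of the poles]`, both exactly as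
displayed. Proof: with `z = s/2` the continued integrand is `Ψ(2z) = Φ(z) w^{−z} Γ(z)`, `w = e^{4πu}`,
`Φ` entire and bounded on vertical strips (`Platt2017.fourier_kernel_two_mul`,
`norm_fourier_cofactor_le`); the line `Re s = 1/2` is first moved to `Re s = 3`
(`Platt2017.integral_fourier_kernel_shift`, pole-free), i.e. `Re z = 3/2`, and then to
`Re z = −m − 1/2`, i.e. `Re s = −σ`, across the simple poles `z = 0, −1, …, −m` of `Γ` by the
tree's Mellin–Barnes shift `Literature.Analysis.Complex.mellinBarnes_shift_eq_sum` (residues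
`(−1)^j Φ(−j) w^j/j!`; `Platt2017.residue_term_eq` identifies `4π|Φ(−j)|w^j/j!` with the printed
`j`-th term), and the remaining line integral has the printed modulus
(`Platt2017.norm_fourier_kernel_far_left`). NOT typed: the last sentence — the comparison
`|Γ(−σ/2+it)| < |Γ(σ/2+it)|` «for `t ∈ ℝ`» is false as printed at small `|t|` (`Γ(−3/2) = 4√π/3 >
Γ(3/2)`); it holds for `|t| ≥ 1` (`Γ(z) = Γ(z+σ)/∏_{j<σ}(z+j)`), which is where the Gaussian weight
lives, so the printed final form of Lemma A.6 (with `C(σ,t₀,h,k)`) is not asserted here.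
[cite: Platt2017, Lemma A.6 p. 2460 (statement and proof)] -/
theorem platt2017_lemmaA6_left (k : ℕ) {σ t₀ h : ℝ} {m : ℕ} (hσ : σ = 2 * m + 1) (hh : 0 < h)
    (u : ℝ) :
    ‖∫ t : ℝ, Complex.Gamma ((1 / 2 + (t + t₀) * I) / 2) *
        Complex.exp ((π * (t + t₀) / 4 - t ^ 2 / (2 * h ^ 2) : ℝ) : ℂ) * (-(2 * π * t : ℝ) * I) ^ k *
        Complex.exp (-(2 * π * t * u : ℝ) * I)‖ ≤
      Real.exp ((2 * σ + 1) ^ 2 / (8 * h ^ 2) + (2 * σ + 1) * π * u) * (2 * π) ^ k *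
          (∫ t : ℝ, ‖Complex.Gamma ((-σ + (t + t₀) * I) / 2)‖ *
            Real.exp (π * (t + t₀) / 4 - t ^ 2 / (2 * h ^ 2)) * ‖((σ + 1 / 2 : ℝ) : ℂ) - t * I‖ ^ k) +
        2 ^ (k + 2) * π ^ (k + 1) * Real.exp (-(t₀ ^ 2 / (2 * h ^ 2))) *
          ∑ l ∈ Finset.range (m + 1), ((2 * l + 1 / 2) ^ 2 + t₀ ^ 2) ^ ((k : ℝ) / 2) / (l.factorial : ℝ) *
            Real.exp ((4 * l + 1) ^ 2 / (8 * h ^ 2) + (4 * l + 1) * π * u) := by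
  have hm0 : (0 : ℝ) ≤ m := Nat.cast_nonneg m
  have hπ0 : 0 < π := Real.pi_pos
  -- the integrand is `Ψ(1/2 + i(t+t₀))`; translate and shift to `Re s = 3`
  have hker : (fun t : ℝ => Complex.Gamma ((1 / 2 + (t + t₀) * I) / 2) *
      Complex.exp ((π * (t + t₀) / 4 - t ^ 2 / (2 * h ^ 2) : ℝ) : ℂ) * (-(2 * π * t : ℝ) * I) ^ k *
      Complex.exp (-(2 * π * t * u : ℝ) * I)) =
      fun t : ℝ => (fun s : ℂ => Complex.Gamma (s / 2) * Complex.exp (π * (-I * (s - 1 / 2)) / 4) *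
        Complex.exp (-(-I * (s - 1 / 2) - t₀) ^ 2 / (2 * h ^ 2)) * (-2 * π * I * (-I * (s - 1 / 2) - t₀)) ^ k *
        Complex.exp (-2 * π * I * (-I * (s - 1 / 2) - t₀) * u)) (((1 / 2 : ℝ) : ℂ) + ((t + t₀ : ℝ) : ℂ) * I) :=
    funext fun t => fourier_kernel_eq k t₀ h u t
  have htr : ∫ t : ℝ, (fun s : ℂ => Complex.Gamma (s / 2) * Complex.exp (π * (-I * (s - 1 / 2)) / 4) *
        Complex.exp (-(-I * (s - 1 / 2) - t₀) ^ 2 / (2 * h ^ 2)) * (-2 * π * I * (-I * (s - 1 / 2) - t₀)) ^ k *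
        Complex.exp (-2 * π * I * (-I * (s - 1 / 2) - t₀) * u)) (((1 / 2 : ℝ) : ℂ) + ((t + t₀ : ℝ) : ℂ) * I) =
      ∫ y : ℝ, (fun s : ℂ => Complex.Gamma (s / 2) * Complex.exp (π * (-I * (s - 1 / 2)) / 4) *
        Complex.exp (-(-I * (s - 1 / 2) - t₀) ^ 2 / (2 * h ^ 2)) * (-2 * π * I * (-I * (s - 1 / 2) - t₀)) ^ k *
        Complex.exp (-2 * π * I * (-I * (s - 1 / 2) - t₀) * u)) (((1 / 2 : ℝ) : ℂ) + ((y : ℝ) : ℂ) * I) :=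
    integral_add_right_eq_self (μ := volume) (fun y : ℝ => (fun s : ℂ => Complex.Gamma (s / 2) * Complex.exp (π * (-I * (s - 1 / 2)) / 4) *
        Complex.exp (-(-I * (s - 1 / 2) - t₀) ^ 2 / (2 * h ^ 2)) * (-2 * π * I * (-I * (s - 1 / 2) - t₀)) ^ k *
        Complex.exp (-2 * π * I * (-I * (s - 1 / 2) - t₀) * u)) (((1 / 2 : ℝ) : ℂ) + ((y : ℝ) : ℂ) * I)) t₀
  have hshift := integral_fourier_kernel_shift k (σ := 3) t₀ u (by norm_num) hh
  -- scaling `y ↦ 2y`: `∫ Ψ(3+iy) dy = 2 ∫ Ψ(3+2iy) dy` and similarly on `Re s = −σ`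
  have hscale : ∀ a : ℝ, ∫ y : ℝ, (fun s : ℂ => Complex.Gamma (s / 2) * Complex.exp (π * (-I * (s - 1 / 2)) / 4) *
        Complex.exp (-(-I * (s - 1 / 2) - t₀) ^ 2 / (2 * h ^ 2)) * (-2 * π * I * (-I * (s - 1 / 2) - t₀)) ^ k *
        Complex.exp (-2 * π * I * (-I * (s - 1 / 2) - t₀) * u)) ((a : ℂ) + ((y : ℝ) : ℂ) * I) =
      2 * ∫ y : ℝ, (fun s : ℂ => Complex.Gamma (s / 2) * Complex.exp (π * (-I * (s - 1 / 2)) / 4) *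
        Complex.exp (-(-I * (s - 1 / 2) - t₀) ^ 2 / (2 * h ^ 2)) * (-2 * π * I * (-I * (s - 1 / 2) - t₀)) ^ k *
        Complex.exp (-2 * π * I * (-I * (s - 1 / 2) - t₀) * u)) ((a : ℂ) + ((2 * y : ℝ) : ℂ) * I) := by
    intro a
    have h2 := Measure.integral_comp_mul_left (fun y : ℝ => (fun s : ℂ => Complex.Gamma (s / 2) * Complex.exp (π * (-I * (s - 1 / 2)) / 4) *
        Complex.exp (-(-I * (s - 1 / 2) - t₀) ^ 2 / (2 * h ^ 2)) * (-2 * π * I * (-I * (s - 1 / 2) - t₀)) ^ k *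
        Complex.exp (-2 * π * I * (-I * (s - 1 / 2) - t₀) * u)) ((a : ℂ) + ((y : ℝ) : ℂ) * I)) 2
    simp only [] at h2 ⊢
    rw [h2, abs_of_pos (by norm_num : (0 : ℝ) < 2⁻¹), Complex.real_smul]
    push_cast
    ring
  -- the Mellin–Barnes form on the lines `Re z = 3/2` and `Re z = −m−1/2`
  have hpt : ∀ (a y : ℝ), (fun s : ℂ => Complex.Gamma (s / 2) * Complex.exp (π * (-I * (s - 1 / 2)) / 4) *
        Complex.exp (-(-I * (s - 1 / 2) - t₀) ^ 2 / (2 * h ^ 2)) * (-2 * π * I * (-I * (s - 1 / 2) - t₀)) ^ k *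
        Complex.exp (-2 * π * I * (-I * (s - 1 / 2) - t₀) * u)) ((((2 * a : ℝ)) : ℂ) + ((2 * y : ℝ) : ℂ) * I) =
      (fun z : ℂ => Complex.exp (π * (-I * (2 * z - 1 / 2)) / 4) *
        Complex.exp (-(-I * (2 * z - 1 / 2) - t₀) ^ 2 / (2 * h ^ 2)) * (-2 * π * I * (-I * (2 * z - 1 / 2) - t₀)) ^ k *
        Complex.exp (π * u + 2 * π * u * t₀ * I)) ((a : ℂ) + (y : ℂ) * I) *
        ((((Real.exp (4 * π * u) : ℝ) : ℂ)) ^ (-((a : ℂ) + (y : ℂ) * I)) *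
          Complex.Gamma ((a : ℂ) + (y : ℂ) * I)) := by
    intro a y
    have e : (((2 * a : ℝ) : ℂ) + ((2 * y : ℝ) : ℂ) * I) = 2 * ((a : ℂ) + (y : ℂ) * I) := by
      push_cast; ring
    rw [e]
    exact fourier_kernel_two_mul k t₀ h u _
  -- the strip constant for `Φ`
  set X : ℝ := m + 3 / 2 with hX
  set C : ℝ := Real.exp ((2 * X + 1 / 2) ^ 2 / (2 * h ^ 2)) * (2 * π) ^ k *
      Real.exp (π * t₀ / 4 + π ^ 2 * h ^ 2 / 32) *
      (k.factorial * Real.exp (π * h ^ 2 / 4 + (1 / 2 + 2 * X) + h ^ 2)) * Real.exp (π * u) with hC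
  have hfac : (0 : ℝ) < k.factorial := by exact_mod_cast Nat.factorial_pos k
  have hC0 : 0 < C := by rw [hC]; positivity
  have hleft : ∀ t : ℝ, ‖(fun z : ℂ => Complex.exp (π * (-I * (2 * z - 1 / 2)) / 4) *
        Complex.exp (-(-I * (2 * z - 1 / 2) - t₀) ^ 2 / (2 * h ^ 2)) * (-2 * π * I * (-I * (2 * z - 1 / 2) - t₀)) ^ k *
        Complex.exp (π * u + 2 * π * u * t₀ * I)) (((-(m : ℝ) - 1 / 2 : ℝ) : ℂ) + t * I)‖ ≤ C * (1 + |t|) ^ (0 : ℝ) := by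
    intro t
    rw [Real.rpow_zero, mul_one, hC]
    exact norm_fourier_cofactor_le_of_abs_le k u hh (by rw [hX, abs_of_neg (by linarith)]; linarith) t
  have hright : ∀ t : ℝ, ‖(fun z : ℂ => Complex.exp (π * (-I * (2 * z - 1 / 2)) / 4) *
        Complex.exp (-(-I * (2 * z - 1 / 2) - t₀) ^ 2 / (2 * h ^ 2)) * (-2 * π * I * (-I * (2 * z - 1 / 2) - t₀)) ^ k *
        Complex.exp (π * u + 2 * π * u * t₀ * I)) (((3 / 2 : ℝ) : ℂ) + t * I)‖ ≤ C := by
    intro t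
    rw [hC]
    exact norm_fourier_cofactor_le_of_abs_le k u hh
      (by rw [hX, abs_of_pos (by norm_num : (0 : ℝ) < 3 / 2)]; linarith) t
  have hfin : ∀ s : ℂ, -(m : ℝ) - 1 / 2 ≤ s.re → s.re ≤ 3 / 2 → ‖(fun z : ℂ => Complex.exp (π * (-I * (2 * z - 1 / 2)) / 4) *
        Complex.exp (-(-I * (2 * z - 1 / 2) - t₀) ^ 2 / (2 * h ^ 2)) * (-2 * π * I * (-I * (2 * z - 1 / 2) - t₀)) ^ k *
        Complex.exp (π * u + 2 * π * u * t₀ * I)) s‖ ≤ C * Real.exp (‖s‖ ^ (1 : ℝ)) := by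
    intro s h1 h2
    have hs : s = ((s.re : ℝ) : ℂ) + ((s.im : ℝ) : ℂ) * I := (Complex.re_add_im s).symm
    have hb := norm_fourier_cofactor_le_of_abs_le k (t₀ := t₀) (X := X) u hh (x := s.re)
      (by rw [hX, abs_le]; constructor <;> linarith) s.im
    rw [← hs] at hb
    refine hb.trans ?_
    rw [← hC]
    have : 1 ≤ Real.exp (‖s‖ ^ (1 : ℝ)) := Real.one_le_exp (by positivity)
    nlinarith
  obtain ⟨_, hMB⟩ := Literature.Analysis.Complex.mellinBarnes_shift_eq_sum
    (Φ := (fun z : ℂ => Complex.exp (π * (-I * (2 * z - 1 / 2)) / 4) *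
        Complex.exp (-(-I * (2 * z - 1 / 2) - t₀) ^ 2 / (2 * h ^ 2)) * (-2 * π * I * (-I * (2 * z - 1 / 2) - t₀)) ^ k *
        Complex.exp (π * u + 2 * π * u * t₀ * I)))
    (differentiable_fourier_cofactor k t₀ h u) m (Real.exp_pos (4 * π * u)) (A₁ := C) (K₁ := 1)
    (α := 0) (A₂ := C) (C := C) (B := 1) hC0 le_rfl le_rfl hC0 one_pos hleft hright hfin
  -- rewrite the two line integrals as integrals of `Ψ`
  have i1 : (fun y : ℝ => (fun z : ℂ => Complex.exp (π * (-I * (2 * z - 1 / 2)) / 4) *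
        Complex.exp (-(-I * (2 * z - 1 / 2) - t₀) ^ 2 / (2 * h ^ 2)) * (-2 * π * I * (-I * (2 * z - 1 / 2) - t₀)) ^ k *
        Complex.exp (π * u + 2 * π * u * t₀ * I)) (((3 / 2 : ℝ) : ℂ) + y * I) *
      ((((Real.exp (4 * π * u) : ℝ) : ℂ)) ^ (-((((3 / 2 : ℝ) : ℂ) + y * I))) *
        Complex.Gamma (((3 / 2 : ℝ) : ℂ) + y * I))) =
      fun y : ℝ => (fun s : ℂ => Complex.Gamma (s / 2) * Complex.exp (π * (-I * (s - 1 / 2)) / 4) *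
        Complex.exp (-(-I * (s - 1 / 2) - t₀) ^ 2 / (2 * h ^ 2)) * (-2 * π * I * (-I * (s - 1 / 2) - t₀)) ^ k *
        Complex.exp (-2 * π * I * (-I * (s - 1 / 2) - t₀) * u)) ((((2 * (3 / 2) : ℝ)) : ℂ) + ((2 * y : ℝ) : ℂ) * I) :=
    funext fun y => (hpt (3 / 2) y).symm
  have i2 : (fun y : ℝ => (fun z : ℂ => Complex.exp (π * (-I * (2 * z - 1 / 2)) / 4) *
        Complex.exp (-(-I * (2 * z - 1 / 2) - t₀) ^ 2 / (2 * h ^ 2)) * (-2 * π * I * (-I * (2 * z - 1 / 2) - t₀)) ^ k *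
        Complex.exp (π * u + 2 * π * u * t₀ * I)) (((-(m : ℝ) - 1 / 2 : ℝ) : ℂ) + y * I) *
      ((((Real.exp (4 * π * u) : ℝ) : ℂ)) ^ (-((((-(m : ℝ) - 1 / 2 : ℝ) : ℂ) + y * I))) *
        Complex.Gamma (((-(m : ℝ) - 1 / 2 : ℝ) : ℂ) + y * I))) =
      fun y : ℝ => (fun s : ℂ => Complex.Gamma (s / 2) * Complex.exp (π * (-I * (s - 1 / 2)) / 4) *
        Complex.exp (-(-I * (s - 1 / 2) - t₀) ^ 2 / (2 * h ^ 2)) * (-2 * π * I * (-I * (s - 1 / 2) - t₀)) ^ k *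
        Complex.exp (-2 * π * I * (-I * (s - 1 / 2) - t₀) * u)) ((((2 * (-(m : ℝ) - 1 / 2) : ℝ)) : ℂ) + ((2 * y : ℝ) : ℂ) * I) :=
    funext fun y => (hpt (-(m : ℝ) - 1 / 2) y).symm
  rw [i1, i2] at hMB
  have e3 : (2 * (3 / 2) : ℝ) = 3 := by norm_num
  have eσ : (2 * (-(m : ℝ) - 1 / 2) : ℝ) = -σ := by rw [hσ]; ring
  rw [e3, eσ] at hMB
  set A : ℂ := ∫ y : ℝ, (fun s : ℂ => Complex.Gamma (s / 2) * Complex.exp (π * (-I * (s - 1 / 2)) / 4) *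
        Complex.exp (-(-I * (s - 1 / 2) - t₀) ^ 2 / (2 * h ^ 2)) * (-2 * π * I * (-I * (s - 1 / 2) - t₀)) ^ k *
        Complex.exp (-2 * π * I * (-I * (s - 1 / 2) - t₀) * u)) (((3 : ℝ) : ℂ) + ((2 * y : ℝ) : ℂ) * I) with hA
  set B : ℂ := ∫ y : ℝ, (fun s : ℂ => Complex.Gamma (s / 2) * Complex.exp (π * (-I * (s - 1 / 2)) / 4) *
        Complex.exp (-(-I * (s - 1 / 2) - t₀) ^ 2 / (2 * h ^ 2)) * (-2 * π * I * (-I * (s - 1 / 2) - t₀)) ^ k *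
        Complex.exp (-2 * π * I * (-I * (s - 1 / 2) - t₀) * u)) (((-σ : ℝ) : ℂ) + ((2 * y : ℝ) : ℂ) * I) with hB
  set S : ℂ := ∑ j ∈ Finset.range (m + 1),
      (-1) ^ j * (fun z : ℂ => Complex.exp (π * (-I * (2 * z - 1 / 2)) / 4) *
        Complex.exp (-(-I * (2 * z - 1 / 2) - t₀) ^ 2 / (2 * h ^ 2)) * (-2 * π * I * (-I * (2 * z - 1 / 2) - t₀)) ^ k *
        Complex.exp (π * u + 2 * π * u * t₀ * I)) (-(j : ℂ)) * ((Real.exp (4 * π * u) : ℝ) : ℂ) ^ (j : ℕ) / (j.factorial : ℂ) with hS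
  have hπC : (π : ℂ) ≠ 0 := by exact_mod_cast Real.pi_pos.ne'
  have hAB : A = B + 2 * (π : ℂ) * S := by
    have h := hMB
    rw [← mul_sub] at h
    have : A - B = 2 * (π : ℂ) * S := by
      rw [← h]; field_simp
    linear_combination this
  -- the value of `G`
  have hG : (∫ t : ℝ, (fun s : ℂ => Complex.Gamma (s / 2) * Complex.exp (π * (-I * (s - 1 / 2)) / 4) *
        Complex.exp (-(-I * (s - 1 / 2) - t₀) ^ 2 / (2 * h ^ 2)) * (-2 * π * I * (-I * (s - 1 / 2) - t₀)) ^ k *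
        Complex.exp (-2 * π * I * (-I * (s - 1 / 2) - t₀) * u)) (((1 / 2 : ℝ) : ℂ) + ((t + t₀ : ℝ) : ℂ) * I)) = 2 * A := by
    rw [htr, hshift, hscale 3, hA]
  -- the remaining integral
  have hBle : ‖B‖ ≤ ∫ y : ℝ, ‖(fun s : ℂ => Complex.Gamma (s / 2) * Complex.exp (π * (-I * (s - 1 / 2)) / 4) *
        Complex.exp (-(-I * (s - 1 / 2) - t₀) ^ 2 / (2 * h ^ 2)) * (-2 * π * I * (-I * (s - 1 / 2) - t₀)) ^ k *
        Complex.exp (-2 * π * I * (-I * (s - 1 / 2) - t₀) * u)) (((-σ : ℝ) : ℂ) + ((2 * y : ℝ) : ℂ) * I)‖ :=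
    norm_integral_le_integral_norm _
  have hscaleN : ∫ y : ℝ, ‖(fun s : ℂ => Complex.Gamma (s / 2) * Complex.exp (π * (-I * (s - 1 / 2)) / 4) *
        Complex.exp (-(-I * (s - 1 / 2) - t₀) ^ 2 / (2 * h ^ 2)) * (-2 * π * I * (-I * (s - 1 / 2) - t₀)) ^ k *
        Complex.exp (-2 * π * I * (-I * (s - 1 / 2) - t₀) * u)) (((-σ : ℝ) : ℂ) + ((y : ℝ) : ℂ) * I)‖ =
      2 * ∫ y : ℝ, ‖(fun s : ℂ => Complex.Gamma (s / 2) * Complex.exp (π * (-I * (s - 1 / 2)) / 4) *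
        Complex.exp (-(-I * (s - 1 / 2) - t₀) ^ 2 / (2 * h ^ 2)) * (-2 * π * I * (-I * (s - 1 / 2) - t₀)) ^ k *
        Complex.exp (-2 * π * I * (-I * (s - 1 / 2) - t₀) * u)) (((-σ : ℝ) : ℂ) + ((2 * y : ℝ) : ℂ) * I)‖ := by
    have h2 := Measure.integral_comp_mul_left
      (fun y : ℝ => ‖(fun s : ℂ => Complex.Gamma (s / 2) * Complex.exp (π * (-I * (s - 1 / 2)) / 4) *
        Complex.exp (-(-I * (s - 1 / 2) - t₀) ^ 2 / (2 * h ^ 2)) * (-2 * π * I * (-I * (s - 1 / 2) - t₀)) ^ k *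
        Complex.exp (-2 * π * I * (-I * (s - 1 / 2) - t₀) * u)) (((-σ : ℝ) : ℂ) + ((y : ℝ) : ℂ) * I)‖) 2
    simp only [] at h2 ⊢
    rw [h2, abs_of_pos (by norm_num : (0 : ℝ) < 2⁻¹), smul_eq_mul]
    ring
  have htrN : ∫ t : ℝ, ‖(fun s : ℂ => Complex.Gamma (s / 2) * Complex.exp (π * (-I * (s - 1 / 2)) / 4) *
        Complex.exp (-(-I * (s - 1 / 2) - t₀) ^ 2 / (2 * h ^ 2)) * (-2 * π * I * (-I * (s - 1 / 2) - t₀)) ^ k *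
        Complex.exp (-2 * π * I * (-I * (s - 1 / 2) - t₀) * u)) (((-σ : ℝ) : ℂ) + ((t + t₀ : ℝ) : ℂ) * I)‖ =
      ∫ y : ℝ, ‖(fun s : ℂ => Complex.Gamma (s / 2) * Complex.exp (π * (-I * (s - 1 / 2)) / 4) *
        Complex.exp (-(-I * (s - 1 / 2) - t₀) ^ 2 / (2 * h ^ 2)) * (-2 * π * I * (-I * (s - 1 / 2) - t₀)) ^ k *
        Complex.exp (-2 * π * I * (-I * (s - 1 / 2) - t₀) * u)) (((-σ : ℝ) : ℂ) + ((y : ℝ) : ℂ) * I)‖ :=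
    integral_add_right_eq_self (μ := volume)
      (fun y : ℝ => ‖(fun s : ℂ => Complex.Gamma (s / 2) * Complex.exp (π * (-I * (s - 1 / 2)) / 4) *
        Complex.exp (-(-I * (s - 1 / 2) - t₀) ^ 2 / (2 * h ^ 2)) * (-2 * π * I * (-I * (s - 1 / 2) - t₀)) ^ k *
        Complex.exp (-2 * π * I * (-I * (s - 1 / 2) - t₀) * u)) (((-σ : ℝ) : ℂ) + ((y : ℝ) : ℂ) * I)‖) t₀
  have hfarL : (fun t : ℝ => ‖(fun s : ℂ => Complex.Gamma (s / 2) * Complex.exp (π * (-I * (s - 1 / 2)) / 4) *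
        Complex.exp (-(-I * (s - 1 / 2) - t₀) ^ 2 / (2 * h ^ 2)) * (-2 * π * I * (-I * (s - 1 / 2) - t₀)) ^ k *
        Complex.exp (-2 * π * I * (-I * (s - 1 / 2) - t₀) * u)) (((-σ : ℝ) : ℂ) + ((t + t₀ : ℝ) : ℂ) * I)‖) = fun t : ℝ =>
      Real.exp ((2 * σ + 1) ^ 2 / (8 * h ^ 2) + (2 * σ + 1) * π * u) * (2 * π) ^ k *
        (‖Complex.Gamma ((-σ + (t + t₀) * I) / 2)‖ *
          Real.exp (π * (t + t₀) / 4 - t ^ 2 / (2 * h ^ 2)) * ‖((σ + 1 / 2 : ℝ) : ℂ) - t * I‖ ^ k) :=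
    funext fun t => norm_fourier_kernel_far_left k σ t₀ h u t
  have hT1 : 2 * ‖B‖ ≤ Real.exp ((2 * σ + 1) ^ 2 / (8 * h ^ 2) + (2 * σ + 1) * π * u) * (2 * π) ^ k *
      ∫ t : ℝ, ‖Complex.Gamma ((-σ + (t + t₀) * I) / 2)‖ *
        Real.exp (π * (t + t₀) / 4 - t ^ 2 / (2 * h ^ 2)) * ‖((σ + 1 / 2 : ℝ) : ℂ) - t * I‖ ^ k := by
    rw [← integral_const_mul, ← hfarL, htrN, hscaleN]
    linarith
  -- the residues
  have hSle : ‖S‖ ≤ ∑ j ∈ Finset.range (m + 1),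
      ‖(fun z : ℂ => Complex.exp (π * (-I * (2 * z - 1 / 2)) / 4) *
        Complex.exp (-(-I * (2 * z - 1 / 2) - t₀) ^ 2 / (2 * h ^ 2)) * (-2 * π * I * (-I * (2 * z - 1 / 2) - t₀)) ^ k *
        Complex.exp (π * u + 2 * π * u * t₀ * I)) (-(j : ℂ))‖ * Real.exp (4 * π * u) ^ j / (j.factorial : ℝ) := by
    refine (norm_sum_le _ _).trans (le_of_eq (Finset.sum_congr rfl fun j _ => ?_))
    rw [norm_div, norm_mul, norm_mul, norm_pow, norm_neg, norm_one, one_pow, one_mul, norm_pow,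
      Complex.norm_real, Real.norm_eq_abs, abs_of_pos (Real.exp_pos _), Complex.norm_natCast]
  have hT2 : 4 * π * ‖S‖ ≤ 2 ^ (k + 2) * π ^ (k + 1) * Real.exp (-(t₀ ^ 2 / (2 * h ^ 2))) *
      ∑ l ∈ Finset.range (m + 1), ((2 * l + 1 / 2) ^ 2 + t₀ ^ 2) ^ ((k : ℝ) / 2) / (l.factorial : ℝ) *
        Real.exp ((4 * l + 1) ^ 2 / (8 * h ^ 2) + (4 * l + 1) * π * u) := by
    refine (mul_le_mul_of_nonneg_left hSle (by positivity)).trans (le_of_eq ?_)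
    rw [Finset.mul_sum, Finset.mul_sum]
    exact Finset.sum_congr rfl fun j _ => residue_term_eq k t₀ h u j
  -- assemble
  rw [hker, hG, hAB]
  have hn : ‖(2 : ℂ) * (B + 2 * (π : ℂ) * S)‖ ≤ 2 * ‖B‖ + 4 * π * ‖S‖ := by
    rw [norm_mul, Complex.norm_two]
    have h1 : ‖B + 2 * (π : ℂ) * S‖ ≤ ‖B‖ + ‖2 * (π : ℂ) * S‖ := norm_add_le _ _
    have h2 : ‖2 * (π : ℂ) * S‖ = 2 * π * ‖S‖ := by
      rw [norm_mul, norm_mul, Complex.norm_two, Complex.norm_real, Real.norm_eq_abs, abs_of_pos hπ0]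
    rw [h2] at h1
    linarith
  linarith


/-! ### Lemma B.1 (the `j > J` tail of step (5)) and Lemma C.1 (the outer integral of the up-sampling leakage) -/

namespace Platt2017

/-- Integral test: `Σ_{n≥0} (n+N+1)^{−a} ≤ N^{1−a}/(a−1)` for `a > 1`, `N ≥ 1` (a copy of the private lemma
of `Zhang2022/Section6TailBounds.lean`; Mathlib's `AntitoneOn.tsum_comp_add_le_integral` against
`∫_N^∞ x^{−a} dx`). [folklore] -/
private theorem tsum_rpow_neg_tail_le' {a : ℝ} (ha : 1 < a) {N : ℕ} (hN : 1 ≤ N) :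
    ∑' k : ℕ, ((k + N + 1 : ℕ) : ℝ) ^ (-a) ≤ (N : ℝ) ^ (1 - a) / (a - 1) := by
  have hN0 : (0 : ℝ) < N := by exact_mod_cast hN
  have anti : AntitoneOn (fun x : ℝ => x ^ (-a)) (Ici (N : ℝ)) :=
    (Real.antitoneOn_rpow_Ioi_of_exponent_nonpos (by linarith)).mono
      fun x hx => lt_of_lt_of_le hN0 hx
  have integrable : IntegrableOn (fun x : ℝ => x ^ (-a)) (Ioi (N : ℝ)) :=
    integrableOn_Ioi_rpow_of_lt (by linarith) hN0
  have nonneg : ∀ t ∈ Ioi (N : ℝ), 0 ≤ t ^ (-a) := fun t ht =>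
    Real.rpow_nonneg (hN0.trans ht).le _
  have h := anti.tsum_comp_add_le_integral N integrable nonneg
  rw [integral_Ioi_rpow_of_lt (by linarith) hN0] at h
  have e : -(N : ℝ) ^ (-a + 1) / (-a + 1) = (N : ℝ) ^ (1 - a) / (a - 1) := by
    rw [show -a + 1 = -(a - 1) by ring, neg_div_neg_eq, show -(a - 1) = 1 - a by ring]
  rw [e] at h
  exact h

end Platt2017

open Platt2017 in
/-- **Platt 2017, Lemma B.1 (p. 2463), PROVED:** «Let `x ≥ 0`. Then
`|Σ_{j>J} (1/√j) (j√π)^{−it₀} G(x + log(j√π)/(2π))| ≤ C(σ,t₀,h,0) exp((2σ−1)²/(8h²)) π^{(1−2σ)/4}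
J^{1−σ}/(σ−1)`. *Proof.* Take `x = 0` and apply Equation A.1 of Lemma A.6.» This is the truncation
error of the `j`-sum of Lemma 3.2 (`F(x) = Σ_{j≥1} (1/√j)(j√π)^{−it₀} G(x + log(j√π)/(2π)) + …`,
step (5)); `G = G^{(0)}` is the Fourier transform of `g(t;0)`, written out, and
`C(σ,t₀,h,0) = ∫ |Γ((σ+i(t+t₀))/2)| e^{π(t+t₀)/4 − t²/(2h²)} dt`. Each term is bounded by display (A.1)
(`platt2017_lemmaA6_right` with `k = 0`, `u = x + log(j√π)/(2π) ≥ 0`): `|(j√π)^{−it₀}| = 1`,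
`e^{−πu(2σ−1)} ≤ (j√π)^{−(2σ−1)/2}`, so the `j`-th term is `≤ C e^{(2σ−1)²/(8h²)} π^{(1−2σ)/4} j^{−σ}`,
and `Σ_{j>J} j^{−σ} ≤ J^{1−σ}/(σ−1)` (integral test). Typed for every real `σ > 1`, `h > 0`, `J ≥ 1`;
the sum over `j > J` is written `Σ_{n≥0}` at `j = n + J + 1`, and its convergence is part of the
conclusion. [cite: Platt2017, Lemma B.1 p. 2463 (proof p. 2464)] -/
theorem platt2017_lemmaB1 {σ t₀ h x : ℝ} {J : ℕ} (hσ : 1 < σ) (hh : 0 < h) (hx : 0 ≤ x) (hJ : 1 ≤ J) :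
    Summable (fun n : ℕ => ((1 / Real.sqrt ((n + J + 1 : ℕ) : ℝ) : ℝ) : ℂ) *
        ((((n + J + 1 : ℕ) : ℝ) * Real.sqrt π : ℝ) : ℂ) ^ (-(I * t₀)) *
        ∫ t : ℝ, Complex.Gamma ((1 / 2 + (t + t₀) * I) / 2) *
          Complex.exp ((π * (t + t₀) / 4 - t ^ 2 / (2 * h ^ 2) : ℝ) : ℂ) *
          Complex.exp (-(2 * π * t * (x + Real.log (((n + J + 1 : ℕ) : ℝ) * Real.sqrt π) / (2 * π)) : ℝ) * I)) ∧
    ‖∑' n : ℕ, ((1 / Real.sqrt ((n + J + 1 : ℕ) : ℝ) : ℝ) : ℂ) *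
        ((((n + J + 1 : ℕ) : ℝ) * Real.sqrt π : ℝ) : ℂ) ^ (-(I * t₀)) *
        ∫ t : ℝ, Complex.Gamma ((1 / 2 + (t + t₀) * I) / 2) *
          Complex.exp ((π * (t + t₀) / 4 - t ^ 2 / (2 * h ^ 2) : ℝ) : ℂ) *
          Complex.exp (-(2 * π * t * (x + Real.log (((n + J + 1 : ℕ) : ℝ) * Real.sqrt π) / (2 * π)) : ℝ) * I)‖ ≤
      (∫ t : ℝ, ‖Complex.Gamma ((σ + (t + t₀) * I) / 2)‖ * Real.exp (π * (t + t₀) / 4 - t ^ 2 / (2 * h ^ 2))) *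
        Real.exp ((2 * σ - 1) ^ 2 / (8 * h ^ 2)) * π ^ ((1 - 2 * σ) / 4) *
        ((J : ℝ) ^ (1 - σ) / (σ - 1)) := by
  set C₀ : ℝ := ∫ t : ℝ, ‖Complex.Gamma ((σ + (t + t₀) * I) / 2)‖ *
    Real.exp (π * (t + t₀) / 4 - t ^ 2 / (2 * h ^ 2)) with hC₀
  have hC₀0 : 0 ≤ C₀ := integral_nonneg fun t => by positivity
  set M : ℝ := C₀ * Real.exp ((2 * σ - 1) ^ 2 / (8 * h ^ 2)) * π ^ ((1 - 2 * σ) / 4) with hM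
  have hM0 : 0 ≤ M := by positivity
  have hsqrtπ : 0 < Real.sqrt π := Real.sqrt_pos.mpr Real.pi_pos
  have hsqrtπ1 : 1 < Real.sqrt π := by
    rw [show (1 : ℝ) = Real.sqrt 1 by simp]
    exact Real.sqrt_lt_sqrt (by norm_num) (by linarith [Real.pi_gt_three])
  -- the bound for one term, `j ≥ 1`
  have hterm : ∀ j : ℕ, 1 ≤ j →
      ‖((1 / Real.sqrt (j : ℝ) : ℝ) : ℂ) * (((j : ℝ) * Real.sqrt π : ℝ) : ℂ) ^ (-(I * t₀)) *
        ∫ t : ℝ, Complex.Gamma ((1 / 2 + (t + t₀) * I) / 2) *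
          Complex.exp ((π * (t + t₀) / 4 - t ^ 2 / (2 * h ^ 2) : ℝ) : ℂ) *
          Complex.exp (-(2 * π * t * (x + Real.log ((j : ℝ) * Real.sqrt π) / (2 * π)) : ℝ) * I)‖ ≤
        M * (j : ℝ) ^ (-σ) := by
    intro j hj
    have hj0 : (0 : ℝ) < j := by exact_mod_cast hj
    have hjπ : 1 < (j : ℝ) * Real.sqrt π := by
      have : (1 : ℝ) ≤ j := by exact_mod_cast hj
      nlinarith
    have hjπ0 : 0 < (j : ℝ) * Real.sqrt π := by linarith
    set L : ℝ := Real.log ((j : ℝ) * Real.sqrt π) with hL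
    have hL0 : 0 < L := Real.log_pos hjπ
    set uj : ℝ := x + L / (2 * π) with huj
    have huj0 : 0 ≤ uj := by rw [huj]; positivity
    -- Lemma A.6 (A.1) with `k = 0`
    have hA6 := platt2017_lemmaA6_right 0 (σ := σ) (t₀ := t₀) (h := h) (u := uj) (by linarith) hh huj0
    simp only [pow_zero, mul_one] at hA6
    -- norms of the scalar factors
    have hn1 : ‖((1 / Real.sqrt (j : ℝ) : ℝ) : ℂ)‖ = (j : ℝ) ^ (-(1 / 2 : ℝ)) := by
      rw [Complex.norm_real, Real.norm_eq_abs, abs_of_pos (by positivity), Real.sqrt_eq_rpow,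
        Real.rpow_neg hj0.le, one_div]
    have hn2 : ‖(((j : ℝ) * Real.sqrt π : ℝ) : ℂ) ^ (-(I * t₀))‖ = 1 := by
      rw [Complex.norm_cpow_eq_rpow_re_of_pos hjπ0]
      simp
    rw [norm_mul, norm_mul, hn1, hn2, mul_one]
    -- `e^{-π u (2σ-1)} ≤ (j√π)^{-(2σ-1)/2} = j^{1/2-σ} π^{(1-2σ)/4}`
    have hdec : Real.exp ((2 * σ - 1) ^ 2 / (8 * h ^ 2) - π * uj * (2 * σ - 1)) ≤
        Real.exp ((2 * σ - 1) ^ 2 / (8 * h ^ 2)) * ((j : ℝ) ^ (1 / 2 - σ) * π ^ ((1 - 2 * σ) / 4)) := by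
      have e1 : Real.exp ((2 * σ - 1) ^ 2 / (8 * h ^ 2) - π * uj * (2 * σ - 1)) =
          Real.exp ((2 * σ - 1) ^ 2 / (8 * h ^ 2)) * (Real.exp (-(π * x * (2 * σ - 1))) *
            Real.exp (L * (-(2 * σ - 1) / 2))) := by
        rw [← Real.exp_add, ← Real.exp_add]; congr 1; rw [huj]; field_simp; ring
      have e2 : Real.exp (L * (-(2 * σ - 1) / 2)) = (j : ℝ) ^ (1 / 2 - σ) * π ^ ((1 - 2 * σ) / 4) := by
        rw [hL, ← Real.rpow_def_of_pos hjπ0, Real.mul_rpow hj0.le hsqrtπ.le, Real.sqrt_eq_rpow,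
          ← Real.rpow_mul Real.pi_pos.le]
        congr 1 <;> [congr 1; congr 1] <;> ring
      rw [e1, e2]
      have hx1 : Real.exp (-(π * x * (2 * σ - 1))) ≤ 1 := by
        rw [Real.exp_le_one_iff, neg_nonpos]
        have : 0 ≤ 2 * σ - 1 := by linarith
        positivity
      have h0 : 0 ≤ (j : ℝ) ^ (1 / 2 - σ) * π ^ ((1 - 2 * σ) / 4) := by positivity
      calc Real.exp ((2 * σ - 1) ^ 2 / (8 * h ^ 2)) * (Real.exp (-(π * x * (2 * σ - 1))) *
            ((j : ℝ) ^ (1 / 2 - σ) * π ^ ((1 - 2 * σ) / 4)))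
          ≤ Real.exp ((2 * σ - 1) ^ 2 / (8 * h ^ 2)) * (1 * ((j : ℝ) ^ (1 / 2 - σ) * π ^ ((1 - 2 * σ) / 4))) := by
            gcongr
        _ = _ := by ring
    have hjpow : (j : ℝ) ^ (-(1 / 2 : ℝ)) * (j : ℝ) ^ (1 / 2 - σ) = (j : ℝ) ^ (-σ) := by
      rw [← Real.rpow_add hj0]; congr 1; ring
    calc (j : ℝ) ^ (-(1 / 2 : ℝ)) * ‖∫ t : ℝ, Complex.Gamma ((1 / 2 + (t + t₀) * I) / 2) *
          Complex.exp ((π * (t + t₀) / 4 - t ^ 2 / (2 * h ^ 2) : ℝ) : ℂ) *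
          Complex.exp (-(2 * π * t * uj : ℝ) * I)‖
        ≤ (j : ℝ) ^ (-(1 / 2 : ℝ)) * (Real.exp ((2 * σ - 1) ^ 2 / (8 * h ^ 2) - π * uj * (2 * σ - 1)) * C₀) :=
          mul_le_mul_of_nonneg_left hA6 (by positivity)
      _ ≤ (j : ℝ) ^ (-(1 / 2 : ℝ)) * (Real.exp ((2 * σ - 1) ^ 2 / (8 * h ^ 2)) *
          ((j : ℝ) ^ (1 / 2 - σ) * π ^ ((1 - 2 * σ) / 4)) * C₀) := by gcongr
      _ = M * ((j : ℝ) ^ (-(1 / 2 : ℝ)) * (j : ℝ) ^ (1 / 2 - σ)) := by rw [hM]; ring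
      _ = M * (j : ℝ) ^ (-σ) := by rw [hjpow]
  -- the majorant `b n = M (n+J+1)^{-σ}` is summable with the integral-test tail bound
  set b : ℕ → ℝ := fun n => M * ((n + J + 1 : ℕ) : ℝ) ^ (-σ) with hb
  have hbs : Summable b := by
    have h1 : Summable fun n : ℕ => ((n + J + 1 : ℕ) : ℝ) ^ (-σ) := by
      have := (Real.summable_nat_rpow.2 (by linarith : -σ < -1)).comp_injective
        (i := fun n : ℕ => n + J + 1) (fun a b hab => by simpa using hab)
      exact this
    exact h1.mul_left M
  have hle : ∀ n : ℕ, ‖((1 / Real.sqrt ((n + J + 1 : ℕ) : ℝ) : ℝ) : ℂ) *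
        ((((n + J + 1 : ℕ) : ℝ) * Real.sqrt π : ℝ) : ℂ) ^ (-(I * t₀)) *
        ∫ t : ℝ, Complex.Gamma ((1 / 2 + (t + t₀) * I) / 2) *
          Complex.exp ((π * (t + t₀) / 4 - t ^ 2 / (2 * h ^ 2) : ℝ) : ℂ) *
          Complex.exp (-(2 * π * t * (x + Real.log (((n + J + 1 : ℕ) : ℝ) * Real.sqrt π) / (2 * π)) : ℝ) * I)‖ ≤
      b n := fun n => hterm (n + J + 1) (by omega)
  refine ⟨Summable.of_norm_bounded hbs hle, (tsum_of_norm_bounded hbs.hasSum hle).trans ?_⟩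
  simp only [hb]
  rw [tsum_mul_left]
  have htail := tsum_rpow_neg_tail_le' hσ hJ
  calc M * ∑' n : ℕ, ((n + J + 1 : ℕ) : ℝ) ^ (-σ) ≤ M * ((J : ℝ) ^ (1 - σ) / (σ - 1)) :=
        mul_le_mul_of_nonneg_left htail hM0
    _ = _ := by rw [hM]

/-- **Platt 2017, Lemma C.1 (p. 2464), the outer integration, with the pointwise bound of Lemma A.8 as
a hypothesis.** Printed: «Define `I` by `I := 4 ∫_{A/2}^{∞} |∫_{−∞}^{∞} W(t) e(−xt) dt| dx`. Then we
have `I ≤ 4ζ(σ)/(2σ−1) π^{(−3−2σ)/4} C(σ,t₀,H,0) exp((2σ−1)²/(8H²) − πA(2σ−1)/2)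
+ 8π^{1/4} exp((1−4t₀²)/(8H²) − πA/2)`. *Proof.* Using the substitution `t → t + t₀` the inner
integral looks exactly like the definition of `F(x)` with `H` taking the place of `h`. We bound this
using Lemma A.8 and the outer integral is then trivial.» Typed: for any function `FW : ℝ → ℂ` (the
inner integral) obeying the bound of Lemma A.8 with `H` for `h` — `|FW(x)| ≤ Cζ e^{(2σ−1)²/(8H²) −
π|x|(2σ−1)} + 2π^{5/4} e^{1/(8H²) − π|x| − t₀²/(2H²)}`, any constant `Cζ ≥ 0` in place of
`ζ(σ)π^{(1−2σ)/4}C(σ,t₀,H,0)` (Lemma A.8 is not typed) — `4∫_{A/2}^∞ |FW| ≤ 4Cζ/((2σ−1)π)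
e^{(2σ−1)²/(8H²) − πA(2σ−1)/2} + 8π^{1/4} e^{(1−4t₀²)/(8H²) − πA/2}` (the printed right-hand side:
`π^{(1−2σ)/4}/π = π^{(−3−2σ)/4}`, `2π^{5/4}/π = 2π^{1/4}`), for every real `A` and `σ > 1/2`.
[cite: Platt2017, Lemma C.1 p. 2464; Lemma A.8 p. 2461 (hypothesis)] -/
theorem platt2017_lemmaC1_of_bound {σ t₀ H A Cζ : ℝ} {FW : ℝ → ℂ} (hσ : 1 / 2 < σ) (hCζ : 0 ≤ Cζ)
    (hFW : ∀ x : ℝ, ‖FW x‖ ≤ Cζ * Real.exp ((2 * σ - 1) ^ 2 / (8 * H ^ 2) - π * |x| * (2 * σ - 1)) +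
      2 * π ^ (5 / 4 : ℝ) * Real.exp (1 / (8 * H ^ 2) - π * |x| - t₀ ^ 2 / (2 * H ^ 2))) :
    4 * ∫ x in Ioi (A / 2), ‖FW x‖ ≤
      4 * Cζ / ((2 * σ - 1) * π) * Real.exp ((2 * σ - 1) ^ 2 / (8 * H ^ 2) - π * A * (2 * σ - 1) / 2) +
        8 * π ^ (1 / 4 : ℝ) * Real.exp ((1 - 4 * t₀ ^ 2) / (8 * H ^ 2) - π * A / 2) := by
  have hπ := Real.pi_pos
  set a₀ : ℝ := π * (2 * σ - 1) with ha₀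
  have ha₀0 : 0 < a₀ := by rw [ha₀]; nlinarith
  set c₀ : ℝ := Cζ * Real.exp ((2 * σ - 1) ^ 2 / (8 * H ^ 2)) with hc₀
  set c₁ : ℝ := 2 * π ^ (5 / 4 : ℝ) * Real.exp (1 / (8 * H ^ 2) - t₀ ^ 2 / (2 * H ^ 2)) with hc₁
  -- majorant without absolute values on `x`
  set P : ℝ → ℝ := fun x => c₀ * Real.exp (-a₀ * x) + c₁ * Real.exp (-π * x) with hP
  have hP_apply : ∀ x, P x = c₀ * Real.exp (-a₀ * x) + c₁ * Real.exp (-π * x) := fun x => rfl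
  have hdom : ∀ x : ℝ, ‖FW x‖ ≤ P x := by
    intro x
    refine (hFW x).trans ?_
    rw [hP_apply]
    have hxa : -|x| ≤ -x ∨ True := Or.inr trivial
    have h1 : Real.exp ((2 * σ - 1) ^ 2 / (8 * H ^ 2) - π * |x| * (2 * σ - 1)) ≤
        Real.exp ((2 * σ - 1) ^ 2 / (8 * H ^ 2)) * Real.exp (-a₀ * x) := by
      rw [← Real.exp_add]
      refine Real.exp_le_exp.mpr ?_
      rw [ha₀]
      have : x ≤ |x| := le_abs_self x
      nlinarith
    have h2 : Real.exp (1 / (8 * H ^ 2) - π * |x| - t₀ ^ 2 / (2 * H ^ 2)) ≤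
        Real.exp (1 / (8 * H ^ 2) - t₀ ^ 2 / (2 * H ^ 2)) * Real.exp (-π * x) := by
      rw [← Real.exp_add]
      refine Real.exp_le_exp.mpr ?_
      have : x ≤ |x| := le_abs_self x
      nlinarith
    rw [hc₀, hc₁]
    have hπ54 : 0 ≤ 2 * π ^ (5 / 4 : ℝ) := by positivity
    calc Cζ * Real.exp ((2 * σ - 1) ^ 2 / (8 * H ^ 2) - π * |x| * (2 * σ - 1)) +
          2 * π ^ (5 / 4 : ℝ) * Real.exp (1 / (8 * H ^ 2) - π * |x| - t₀ ^ 2 / (2 * H ^ 2))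
        ≤ Cζ * (Real.exp ((2 * σ - 1) ^ 2 / (8 * H ^ 2)) * Real.exp (-a₀ * x)) +
          2 * π ^ (5 / 4 : ℝ) * (Real.exp (1 / (8 * H ^ 2) - t₀ ^ 2 / (2 * H ^ 2)) * Real.exp (-π * x)) :=
          add_le_add (mul_le_mul_of_nonneg_left h1 hCζ) (mul_le_mul_of_nonneg_left h2 hπ54)
      _ = _ := by ring
  have hPint : IntegrableOn P (Ioi (A / 2)) := by
    have i1 := (integrableOn_exp_mul_Ioi (neg_neg_of_pos ha₀0) (A / 2)).const_mul c₀
    have i2 := (integrableOn_exp_mul_Ioi (neg_neg_of_pos hπ) (A / 2)).const_mul c₁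
    exact i1.add i2
  have hmono : ∫ x in Ioi (A / 2), ‖FW x‖ ≤ ∫ x in Ioi (A / 2), P x :=
    integral_mono_of_nonneg (ae_of_all _ fun x => norm_nonneg _) hPint (ae_of_all _ hdom)
  have hval : ∫ x in Ioi (A / 2), P x =
      c₀ * (Real.exp (-a₀ * (A / 2)) / a₀) + c₁ * (Real.exp (-π * (A / 2)) / π) := by
    simp only [hP_apply]
    rw [integral_add ((integrableOn_exp_mul_Ioi (neg_neg_of_pos ha₀0) (A / 2)).const_mul c₀)
        ((integrableOn_exp_mul_Ioi (neg_neg_of_pos hπ) (A / 2)).const_mul c₁),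
      integral_const_mul, integral_const_mul, integral_exp_mul_Ioi (neg_neg_of_pos ha₀0),
      integral_exp_mul_Ioi (neg_neg_of_pos hπ)]
    congr 2
    · rw [neg_div_neg_eq]
    · rw [neg_div_neg_eq]
  rw [hval] at hmono
  have hπ0 : π ≠ 0 := hπ.ne'
  have h2σ : 2 * σ - 1 ≠ 0 := by linarith
  refine (mul_le_mul_of_nonneg_left hmono (by norm_num : (0 : ℝ) ≤ 4)).trans (le_of_eq ?_)
  rw [hc₀, hc₁, ha₀]
  have e1 : Real.exp ((2 * σ - 1) ^ 2 / (8 * H ^ 2)) * Real.exp (-(π * (2 * σ - 1)) * (A / 2)) =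
      Real.exp ((2 * σ - 1) ^ 2 / (8 * H ^ 2) - π * A * (2 * σ - 1) / 2) := by
    rw [← Real.exp_add]; congr 1; ring
  have e2 : Real.exp (1 / (8 * H ^ 2) - t₀ ^ 2 / (2 * H ^ 2)) * Real.exp (-π * (A / 2)) =
      Real.exp ((1 - 4 * t₀ ^ 2) / (8 * H ^ 2) - π * A / 2) := by
    rw [← Real.exp_add]; congr 1; field_simp; ring
  have e3 : π ^ (5 / 4 : ℝ) / π = π ^ (1 / 4 : ℝ) := by
    rw [div_eq_iff hπ0, show (5 / 4 : ℝ) = 1 / 4 + 1 by norm_num, Real.rpow_add hπ, Real.rpow_one]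
  rw [← e1, ← e2, ← e3]
  field_simp
  ring


/-! ### Lemma A.8: the Fourier transform `F` of `f`, shifted across the pole of `ζ` -/

namespace Platt2017

/-! #### The continued integrand of `F(x)`, `Ξ(s) = π^{1/4} Λ(s) e^{π(τ+t₀)/4} e^{−τ²/(2h²)} e^{−2πiτx}` -/

/-- The modulus of the three exponential weights at `s = v + iy`:
`|e^{π(τ+t₀)/4} e^{−τ²/(2h²)} e^{−2πiτx}| = e^{πy/4} e^{((v−1/2)² − (y−t₀)²)/(2h²)} e^{−2πx(v−1/2)}`,
`τ = −i(s−1/2) − t₀`. [cite: Platt2017, Lemma A.8 p. 2461 (proof)] -/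
theorem norm_fourier_weight (t₀ h x v y : ℝ) :
    ‖Complex.exp (π * (-I * (((v : ℂ) + (y : ℂ) * I) - 1 / 2)) / 4) *
        Complex.exp (-(-I * (((v : ℂ) + (y : ℂ) * I) - 1 / 2) - t₀) ^ 2 / (2 * h ^ 2)) *
        Complex.exp (-2 * π * I * (-I * (((v : ℂ) + (y : ℂ) * I) - 1 / 2) - t₀) * x)‖ =
      Real.exp (π * y / 4) * Real.exp (((v - 1 / 2) ^ 2 - (y - t₀) ^ 2) / (2 * h ^ 2)) *
        Real.exp (-(2 * π * x * (v - 1 / 2))) := by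
  have hτ := time_var_eq v y t₀
  have hτ' := time_var_eq' v y
  rw [hτ, hτ']
  set a : ℝ := y - t₀ with ha
  set c : ℝ := 1 / 2 - v with hc
  have e1 : (π * (((y : ℝ) : ℂ) + ((c : ℝ) : ℂ) * I) / 4 : ℂ) =
      ((π * y / 4 : ℝ) : ℂ) + ((π * c / 4 : ℝ) : ℂ) * I := by push_cast; ring
  have hsq : ((((a : ℝ) : ℂ) + ((c : ℝ) : ℂ) * I) ^ 2 : ℂ) = ((a ^ 2 - c ^ 2 : ℝ) : ℂ) + ((2 * a * c : ℝ) : ℂ) * I := by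
    have hI : (I : ℂ) ^ 2 = -1 := Complex.I_sq
    push_cast
    linear_combination ((c : ℂ) ^ 2) * hI
  have e2 : (-(((a : ℝ) : ℂ) + ((c : ℝ) : ℂ) * I) ^ 2 / (2 * h ^ 2) : ℂ) =
      ((-(a ^ 2 - c ^ 2) / (2 * h ^ 2) : ℝ) : ℂ) + ((-(2 * a * c) / (2 * h ^ 2) : ℝ) : ℂ) * I := by
    rw [hsq]; push_cast; ring
  have e3 : (-2 * π * I * (((a : ℝ) : ℂ) + ((c : ℝ) : ℂ) * I) * x : ℂ) =
      ((2 * π * c * x : ℝ) : ℂ) + ((-(2 * π * a * x) : ℝ) : ℂ) * I := by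
    have hI : (I : ℂ) ^ 2 = -1 := Complex.I_sq
    push_cast
    linear_combination (-2 * π * (c : ℂ) * x) * hI
  rw [e1, e2, e3, norm_mul, norm_mul, norm_exp_ofReal_add, norm_exp_ofReal_add, norm_exp_ofReal_add]
  have ec1 : -(a ^ 2 - c ^ 2) / (2 * h ^ 2) = ((v - 1 / 2) ^ 2 - a ^ 2) / (2 * h ^ 2) := by
    rw [hc]; ring
  have ec2 : 2 * π * c * x = -(2 * π * x * (v - 1 / 2)) := by rw [hc]; ring
  rw [ec1, ec2]

/-- **The integrand of `F(x)` on the line `Re s = 1/2`:** with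
`f(t) = Λ(t+t₀) exp(π(t+t₀)/4 − t²/(2h²))`, `Λ(t) = π^{−it/2} Γ((1/2+it)/2) ζ(1/2+it)` ((3.1), p. 2451)
and `s = 1/2 + i(t+t₀)`, `f(t) e(−tx) = Ξ(s)` where `Ξ(s) = π^{1/4} Λ(s) e^{π(τ+t₀)/4} e^{−τ²/(2h²)}
e^{−2πiτx}`, `Λ(s) = π^{−s/2} Γ(s/2) ζ(s)` Mathlib's `completedRiemannZeta` (so `π^{1/4} Λ(s)` is
Platt's `Λ(t)` at `s = 1/2+it`). [cite: Platt2017, Lemma A.8 p. 2461 (proof: «We write s = 1/2 + i(t+t₀) and shift the line of integration right»)] -/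
theorem fourierF_kernel_eq (t₀ h x t : ℝ) :
    (π : ℂ) ^ (-(I * (t + t₀ : ℝ) / 2)) * Complex.Gamma ((1 / 2 + (t + t₀ : ℝ) * I) / 2) *
        riemannZeta (1 / 2 + (t + t₀ : ℝ) * I) *
        Complex.exp ((π * (t + t₀) / 4 - t ^ 2 / (2 * h ^ 2) : ℝ) : ℂ) *
        Complex.exp (-(2 * π * t * x : ℝ) * I) =
      (fun s : ℂ => ((π ^ (1 / 4 : ℝ) : ℝ) : ℂ) * completedRiemannZeta s * Complex.exp (π * (-I * (s - 1 / 2)) / 4) *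
        Complex.exp (-(-I * (s - 1 / 2) - t₀) ^ 2 / (2 * h ^ 2)) *
        Complex.exp (-2 * π * I * (-I * (s - 1 / 2) - t₀) * x)) (((1 / 2 : ℝ) : ℂ) + ((t + t₀ : ℝ) : ℂ) * I) := by
  set s₀ : ℂ := ((1 / 2 : ℝ) : ℂ) + ((t + t₀ : ℝ) : ℂ) * I with hs₀
  have hs₀' : (1 / 2 + (t + t₀ : ℝ) * I : ℂ) = s₀ := by rw [hs₀]; push_cast; ring
  have hre : s₀.re = 1 / 2 := by rw [hs₀]; simp
  have hs0 : s₀ ≠ 0 := fun h0 => by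
    have := congrArg Complex.re h0; rw [hre] at this; simp at this
  have hπ0 : (π : ℂ) ≠ 0 := by exact_mod_cast Real.pi_pos.ne'
  -- `Λ(s₀) = π^{-s₀/2} Γ(s₀/2) ζ(s₀)`
  have hG : (π : ℂ) ^ (-s₀ / 2) * Complex.Gamma (s₀ / 2) ≠ 0 := by
    rw [← Complex.Gammaℝ_def]; exact Complex.Gammaℝ_ne_zero_of_re_pos (by rw [hre]; norm_num)
  have hΛ : completedRiemannZeta s₀ = (π : ℂ) ^ (-s₀ / 2) * Complex.Gamma (s₀ / 2) * riemannZeta s₀ := by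
    rw [riemannZeta_def_of_ne_zero hs0, ← Complex.Gammaℝ_def,
      mul_div_cancel₀ _ (Complex.Gammaℝ_ne_zero_of_re_pos (by rw [hre]; norm_num))]
  -- `π^{-i(t+t₀)/2} = π^{1/4} π^{-s₀/2}`
  have hπpow : (π : ℂ) ^ (-(I * (t + t₀ : ℝ) / 2)) =
      ((π ^ (1 / 4 : ℝ) : ℝ) : ℂ) * (π : ℂ) ^ (-s₀ / 2) := by
    rw [Complex.ofReal_cpow Real.pi_pos.le, ← Complex.cpow_add _ _ hπ0]
    congr 1
    rw [hs₀]; push_cast; ring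
  have hτ := time_var_eq (1 / 2) (t + t₀) t₀
  have hτ' := time_var_eq' (1 / 2) (t + t₀)
  simp only []
  rw [hs₀', hΛ, hπpow]
  rw [hs₀, hτ, hτ']
  have e1 : Complex.exp ((π * (t + t₀) / 4 - t ^ 2 / (2 * h ^ 2) : ℝ) : ℂ) =
      Complex.exp (π * ((((t + t₀ : ℝ) : ℝ) : ℂ) + ((1 / 2 - 1 / 2 : ℝ) : ℂ) * I) / 4) *
        Complex.exp (-(((t + t₀ - t₀ : ℝ) : ℂ) + ((1 / 2 - 1 / 2 : ℝ) : ℂ) * I) ^ 2 / (2 * h ^ 2)) := by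
    rw [← Complex.exp_add]
    congr 1
    push_cast
    ring
  have e2 : Complex.exp (-(2 * π * t * x : ℝ) * I) =
      Complex.exp (-2 * π * I * (((t + t₀ - t₀ : ℝ) : ℂ) + ((1 / 2 - 1 / 2 : ℝ) : ℂ) * I) * x) := by
    congr 1
    push_cast
    ring
  rw [e1, e2]
  ring

/-- **`Ξ` is holomorphic away from `s = 0, 1`** (the poles of `Λ`).
[cite: Platt2017, Lemma A.8 p. 2461 (proof)] -/
theorem differentiableAt_fourierF_kernel (t₀ h x : ℝ) {s : ℂ} (hs0 : s ≠ 0) (hs1 : s ≠ 1) :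
    DifferentiableAt ℂ (fun s : ℂ => ((π ^ (1 / 4 : ℝ) : ℝ) : ℂ) * completedRiemannZeta s * Complex.exp (π * (-I * (s - 1 / 2)) / 4) *
        Complex.exp (-(-I * (s - 1 / 2) - t₀) ^ 2 / (2 * h ^ 2)) *
        Complex.exp (-2 * π * I * (-I * (s - 1 / 2) - t₀) * x)) s := by
  have d1 : DifferentiableAt ℂ (fun s : ℂ => ((π ^ (1 / 4 : ℝ) : ℝ) : ℂ) * completedRiemannZeta s) s :=
    (differentiableAt_completedZeta hs0 hs1).const_mul _
  have d2 : DifferentiableAt ℂ (fun s : ℂ => Complex.exp (π * (-I * (s - 1 / 2)) / 4)) s := by fun_prop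
  have d3 : DifferentiableAt ℂ (fun s : ℂ => Complex.exp (-(-I * (s - 1 / 2) - t₀) ^ 2 / (2 * h ^ 2))) s := by
    fun_prop
  have d5 : DifferentiableAt ℂ (fun s : ℂ => Complex.exp (-2 * π * I * (-I * (s - 1 / 2) - t₀) * x)) s := by
    fun_prop
  exact ((d1.mul d2).mul d3).mul d5

/-- The modulus of `Ξ` at `s = v + iy`:
`|Ξ(s)| = π^{1/4} |Λ(s)| e^{πy/4} e^{((v−1/2)² − (y−t₀)²)/(2h²)} e^{−2πx(v−1/2)}`.
[cite: Platt2017, Lemma A.8 p. 2461 (proof)] -/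
theorem norm_fourierF_kernel (t₀ h x v y : ℝ) :
    ‖(fun s : ℂ => ((π ^ (1 / 4 : ℝ) : ℝ) : ℂ) * completedRiemannZeta s * Complex.exp (π * (-I * (s - 1 / 2)) / 4) *
        Complex.exp (-(-I * (s - 1 / 2) - t₀) ^ 2 / (2 * h ^ 2)) *
        Complex.exp (-2 * π * I * (-I * (s - 1 / 2) - t₀) * x)) ((v : ℂ) + (y : ℂ) * I)‖ =
      π ^ (1 / 4 : ℝ) * ‖completedRiemannZeta ((v : ℂ) + (y : ℂ) * I)‖ *
        (Real.exp (π * y / 4) * Real.exp (((v - 1 / 2) ^ 2 - (y - t₀) ^ 2) / (2 * h ^ 2)) *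
          Real.exp (-(2 * π * x * (v - 1 / 2)))) := by
  simp only []
  rw [norm_mul, norm_mul, ← norm_fourier_weight t₀ h x v y, norm_mul, norm_mul, norm_mul, norm_mul,
    Complex.norm_real, Real.norm_eq_abs, abs_of_pos (by positivity)]
  ring

/-- **`ζ` on the strip away from the pole:** for `1/2 ≤ Re s ≤ σ` and `‖s − 1‖ ≥ 1/2`,
`‖ζ(s)‖ ≤ (σ + 3 + |Im s|)³` (from the Euler–Maclaurin bound
`Literature.NumberTheory.LFunctions.norm_riemannZeta_le_of_neg_one_le_re`). [folklore] -/
private theorem norm_zeta_strip_le {σ : ℝ} {s : ℂ} (h1 : 1 / 2 ≤ s.re) (h2 : s.re ≤ σ)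
    (hs : 1 / 2 ≤ ‖s - 1‖) : ‖riemannZeta s‖ ≤ (σ + 3 + |s.im|) ^ 3 := by
  have hs1 : s ≠ 1 := by
    intro h; rw [h, sub_self, norm_zero] at hs; norm_num at hs
  have h := norm_riemannZeta_le_of_neg_one_le_re (s := s) (by linarith) hs1
  have hn : ‖s‖ ≤ σ + |s.im| := by
    refine (Complex.norm_le_abs_re_add_abs_im s).trans ?_
    have : |s.re| ≤ σ := abs_le.2 ⟨by linarith, h2⟩
    linarith
  have hn1 : ‖s + 1‖ ≤ σ + |s.im| + 1 := (norm_add_le _ _).trans (by simp; exact hn)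
  have hn2 : ‖s + 2‖ ≤ σ + |s.im| + 2 := (norm_add_le _ _).trans (by
    rw [Complex.norm_two]; linarith)
  have hinv : 1 / ‖s - 1‖ ≤ 2 := by
    rw [div_le_iff₀ (by linarith)]; linarith
  set n : ℝ := σ + |s.im| with hn'
  have hσ0 : 0 ≤ σ := by linarith
  have hn0 : 0 ≤ n := by rw [hn']; positivity
  have hprod : ‖s‖ * ‖s + 1‖ * ‖s + 2‖ ≤ n * (n + 1) * (n + 2) :=
    mul_le_mul (mul_le_mul hn hn1 (norm_nonneg _) hn0) hn2 (norm_nonneg _) (by positivity)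
  calc ‖riemannZeta s‖ ≤ 1 / ‖s - 1‖ + 1 / 2 + ‖s‖ / 12 + ‖s‖ * ‖s + 1‖ * ‖s + 2‖ / 48 := h
    _ ≤ 2 + 1 / 2 + n / 12 + n * (n + 1) * (n + 2) / 48 := by gcongr
    _ ≤ (n + 3) ^ 3 := by nlinarith [pow_nonneg hn0 2, pow_nonneg hn0 3]
    _ = (σ + 3 + |s.im|) ^ 3 := by rw [hn']; ring

/-- **`Λ` on the strip away from the pole:** for `1/2 ≤ v ≤ σ`, `‖(v+iy) − 1‖ ≥ 1/2`:
`‖Λ(v+iy)‖ ≤ max(Γ(1/4), Γ(σ/2)) (σ + 3 + |y|)³` (`Λ = Γ_ℝ ζ`, `|π^{−s/2}| ≤ 1`,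
`|Γ(s/2)| ≤ Γ(Re s/2)` and convexity of `Γ`). [cite: Platt2017, Lemma A.8 p. 2461 (proof)] -/
theorem norm_completedZeta_strip_le {σ v : ℝ} (hv : 1 / 2 ≤ v) (hvσ : v ≤ σ) (y : ℝ)
    (hs : 1 / 2 ≤ ‖((v : ℂ) + (y : ℂ) * I) - 1‖) :
    ‖completedRiemannZeta ((v : ℂ) + (y : ℂ) * I)‖ ≤
      max (Real.Gamma (1 / 4)) (Real.Gamma (σ / 2)) * (σ + 3 + |y|) ^ 3 := by
  set s : ℂ := (v : ℂ) + (y : ℂ) * I with hs'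
  have hre : s.re = v := by rw [hs']; simp
  have him : s.im = y := by rw [hs']; simp
  have hv0 : 0 < v := by linarith
  have hs0 : s ≠ 0 := fun h0 => by
    have := congrArg Complex.re h0; rw [hre] at this; simp at this; linarith
  have hΛ : completedRiemannZeta s = Complex.Gammaℝ s * riemannZeta s := by
    rw [riemannZeta_def_of_ne_zero hs0, mul_div_cancel₀ _ (Complex.Gammaℝ_ne_zero_of_re_pos (by rw [hre]; exact hv0))]
  have hGℝ : ‖Complex.Gammaℝ s‖ ≤ max (Real.Gamma (1 / 4)) (Real.Gamma (σ / 2)) := by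
    rw [Complex.Gammaℝ_def, norm_mul, Complex.norm_cpow_eq_rpow_re_of_pos Real.pi_pos]
    have h1 : π ^ ((-s / 2).re) ≤ 1 := by
      refine Real.rpow_le_one_of_one_le_of_nonpos (by linarith [Real.pi_gt_three]) ?_
      simp [hre]; linarith
    have h2 : ‖Complex.Gamma (s / 2)‖ ≤ max (Real.Gamma (1 / 4)) (Real.Gamma (σ / 2)) := by
      have hw : s / 2 = ((v / 2 : ℝ) : ℂ) + ((y / 2 : ℝ) : ℂ) * I := by rw [hs']; push_cast; ring
      rw [hw]
      exact (Literature.Analysis.SpecialFunctions.GammaVert.norm_Gamma_le_Gamma_re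
        (by positivity : (0 : ℝ) < v / 2) (y / 2)).trans
        (Real_Gamma_le_max' (by norm_num) (by linarith) (by linarith))
    have h0 : 0 ≤ max (Real.Gamma (1 / 4)) (Real.Gamma (σ / 2)) :=
      le_max_of_le_left (Real.Gamma_pos_of_pos (by norm_num)).le
    calc π ^ ((-s / 2).re) * ‖Complex.Gamma (s / 2)‖ ≤ 1 * max (Real.Gamma (1 / 4)) (Real.Gamma (σ / 2)) :=
          mul_le_mul h1 h2 (norm_nonneg _) zero_le_one
      _ = _ := one_mul _
  have hζ : ‖riemannZeta s‖ ≤ (σ + 3 + |y|) ^ 3 := by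
    rw [← him]; exact norm_zeta_strip_le (by rw [hre]; exact hv) (by rw [hre]; exact hvσ) hs
  rw [hΛ, norm_mul]
  have h0 : 0 ≤ max (Real.Gamma (1 / 4)) (Real.Gamma (σ / 2)) :=
    le_max_of_le_left (Real.Gamma_pos_of_pos (by norm_num)).le
  exact mul_le_mul hGℝ hζ (norm_nonneg _) h0

/-- **A uniform Gaussian majorant for `Ξ` on the strip `1/2 ≤ Re s ≤ σ` away from the pole**
(`‖s − 1‖ ≥ 1/2`, `x ≥ 0`): `|Ξ(v+iy)| ≤ K e^{−(y−t₁)²/(4h²)}`, `t₁ = t₀ + πh²/4` (completing the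
square and `(w+d)³ e^{−w²/(4h²)} ≤ 3! e^{d+h²}`). [cite: Platt2017, Lemma A.8 p. 2461 (proof)] -/
theorem norm_fourierF_kernel_le {σ t₀ h x v : ℝ} (hh : 0 < h) (hx : 0 ≤ x) (hv : 1 / 2 ≤ v)
    (hvσ : v ≤ σ) (y : ℝ) (hs : 1 / 2 ≤ ‖((v : ℂ) + (y : ℂ) * I) - 1‖) :
    ‖(fun s : ℂ => ((π ^ (1 / 4 : ℝ) : ℝ) : ℂ) * completedRiemannZeta s * Complex.exp (π * (-I * (s - 1 / 2)) / 4) *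
        Complex.exp (-(-I * (s - 1 / 2) - t₀) ^ 2 / (2 * h ^ 2)) *
        Complex.exp (-2 * π * I * (-I * (s - 1 / 2) - t₀) * x)) ((v : ℂ) + (y : ℂ) * I)‖ ≤
      π ^ (1 / 4 : ℝ) * max (Real.Gamma (1 / 4)) (Real.Gamma (σ / 2)) *
        Real.exp ((σ - 1 / 2) ^ 2 / (2 * h ^ 2)) * Real.exp (π * t₀ / 4 + π ^ 2 * h ^ 2 / 32) *
        ((3 : ℕ).factorial * Real.exp ((|t₀ + π * h ^ 2 / 4| + σ + 3) + h ^ 2)) *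
        Real.exp (-(1 / (4 * h ^ 2)) * (y - (t₀ + π * h ^ 2 / 4)) ^ 2) := by
  rw [norm_fourierF_kernel]
  set t₁ : ℝ := t₀ + π * h ^ 2 / 4 with ht₁
  set w : ℝ := |y - t₁| with hw
  set d : ℝ := |t₁| + σ + 3 with hd
  set ΓM : ℝ := max (Real.Gamma (1 / 4)) (Real.Gamma (σ / 2)) with hΓM
  have hσ0 : 0 < σ := by linarith
  have hd0 : 0 ≤ d := by rw [hd]; positivity
  have hΓM0 : 0 ≤ ΓM := le_max_of_le_left (Real.Gamma_pos_of_pos (by norm_num)).le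
  have hΛ := norm_completedZeta_strip_le (σ := σ) hv hvσ y hs
  have hgauss : Real.exp (π * y / 4) * Real.exp (((v - 1 / 2) ^ 2 - (y - t₀) ^ 2) / (2 * h ^ 2)) =
      Real.exp ((v - 1 / 2) ^ 2 / (2 * h ^ 2)) * Real.exp (π * t₀ / 4 + π ^ 2 * h ^ 2 / 32) *
        Real.exp (-((y - t₁) ^ 2 / (2 * h ^ 2))) := by
    rw [← Real.exp_add, ← Real.exp_add, ← Real.exp_add]
    congr 1
    rw [ht₁]
    field_simp
    ring
  have hv2 : Real.exp ((v - 1 / 2) ^ 2 / (2 * h ^ 2)) ≤ Real.exp ((σ - 1 / 2) ^ 2 / (2 * h ^ 2)) := by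
    refine Real.exp_le_exp.mpr (div_le_div_of_nonneg_right ?_ (by positivity))
    nlinarith
  have hpoly : (σ + 3 + |y|) ^ 3 ≤ (w + d) ^ 3 := by
    have h1 : |y| ≤ w + |t₁| := by
      rw [hw]
      have := abs_add_le (y - t₁) t₁
      rw [sub_add_cancel] at this
      exact this
    have h2 : 0 ≤ σ + 3 + |y| := by positivity
    exact pow_le_pow_left₀ h2 (by rw [hd]; linarith) 3
  have hx1 : Real.exp (-(2 * π * x * (v - 1 / 2))) ≤ 1 := by
    rw [Real.exp_le_one_iff, neg_nonpos]
    have := Real.pi_pos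
    have : 0 ≤ v - 1 / 2 := by linarith
    positivity
  have hsplit : Real.exp (-((y - t₁) ^ 2 / (2 * h ^ 2))) =
      Real.exp (-(w ^ 2 / (4 * h ^ 2))) * Real.exp (-(1 / (4 * h ^ 2)) * (y - t₁) ^ 2) := by
    rw [← Real.exp_add, hw, sq_abs]
    congr 1
    field_simp
    ring
  have hpg : (w + d) ^ 3 * Real.exp (-(w ^ 2 / (4 * h ^ 2))) ≤ (3 : ℕ).factorial * Real.exp (d + h ^ 2) :=
    pow_mul_gauss_le 3 (abs_nonneg _) hd0 hh
  have hE0 : 0 < Real.exp (-(1 / (4 * h ^ 2)) * (y - t₁) ^ 2) := Real.exp_pos _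
  have hπ4 : 0 < π ^ (1 / 4 : ℝ) := by positivity
  calc π ^ (1 / 4 : ℝ) * ‖completedRiemannZeta ((v : ℂ) + (y : ℂ) * I)‖ *
        (Real.exp (π * y / 4) * Real.exp (((v - 1 / 2) ^ 2 - (y - t₀) ^ 2) / (2 * h ^ 2)) *
          Real.exp (-(2 * π * x * (v - 1 / 2))))
      ≤ π ^ (1 / 4 : ℝ) * (ΓM * (w + d) ^ 3) *
          ((Real.exp ((σ - 1 / 2) ^ 2 / (2 * h ^ 2)) * Real.exp (π * t₀ / 4 + π ^ 2 * h ^ 2 / 32) *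
            Real.exp (-((y - t₁) ^ 2 / (2 * h ^ 2)))) * 1) := by
        rw [hgauss]
        have hΛ' : ‖completedRiemannZeta ((v : ℂ) + (y : ℂ) * I)‖ ≤ ΓM * (w + d) ^ 3 :=
          hΛ.trans (mul_le_mul_of_nonneg_left hpoly hΓM0)
        gcongr
    _ = π ^ (1 / 4 : ℝ) * ΓM * Real.exp ((σ - 1 / 2) ^ 2 / (2 * h ^ 2)) *
          Real.exp (π * t₀ / 4 + π ^ 2 * h ^ 2 / 32) *
          ((w + d) ^ 3 * Real.exp (-(w ^ 2 / (4 * h ^ 2)))) *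
          Real.exp (-(1 / (4 * h ^ 2)) * (y - t₁) ^ 2) := by rw [hsplit]; ring
    _ ≤ π ^ (1 / 4 : ℝ) * ΓM * Real.exp ((σ - 1 / 2) ^ 2 / (2 * h ^ 2)) *
          Real.exp (π * t₀ / 4 + π ^ 2 * h ^ 2 / 32) *
          ((3 : ℕ).factorial * Real.exp (d + h ^ 2)) *
          Real.exp (-(1 / (4 * h ^ 2)) * (y - t₁) ^ 2) := by gcongr
    _ = _ := by rw [hd, ht₁]

/-- **`Ξ` is integrable on the vertical lines `Re s = v`, `v = 1/2` or `3/2 ≤ v ≤ σ`** (there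
`‖s − 1‖ ≥ 1/2`; continuity and the Gaussian majorant). [cite: Platt2017, Lemma A.8 p. 2461 (proof)] -/
theorem integrable_fourierF_kernel_vertical {σ t₀ h x v : ℝ} (hh : 0 < h) (hx : 0 ≤ x)
    (hv : 1 / 2 ≤ v) (hvσ : v ≤ σ) (hv1 : 1 / 2 ≤ |v - 1|) :
    Integrable fun y : ℝ => (fun s : ℂ => ((π ^ (1 / 4 : ℝ) : ℝ) : ℂ) * completedRiemannZeta s * Complex.exp (π * (-I * (s - 1 / 2)) / 4) *
        Complex.exp (-(-I * (s - 1 / 2) - t₀) ^ 2 / (2 * h ^ 2)) *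
        Complex.exp (-2 * π * I * (-I * (s - 1 / 2) - t₀) * x)) ((v : ℂ) + (y : ℂ) * I) := by
  set K : ℝ := π ^ (1 / 4 : ℝ) * max (Real.Gamma (1 / 4)) (Real.Gamma (σ / 2)) *
        Real.exp ((σ - 1 / 2) ^ 2 / (2 * h ^ 2)) * Real.exp (π * t₀ / 4 + π ^ 2 * h ^ 2 / 32) *
        ((3 : ℕ).factorial * Real.exp ((|t₀ + π * h ^ 2 / 4| + σ + 3) + h ^ 2)) with hK
  have hb : (0 : ℝ) < 1 / (4 * h ^ 2) := by positivity
  have hg : Integrable fun y : ℝ => K * Real.exp (-(1 / (4 * h ^ 2)) * (y - (t₀ + π * h ^ 2 / 4)) ^ 2) :=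
    ((integrable_exp_neg_mul_sq hb).comp_sub_right (t₀ + π * h ^ 2 / 4)).const_mul K
  have hdist : ∀ y : ℝ, 1 / 2 ≤ ‖((v : ℂ) + (y : ℂ) * I) - 1‖ := fun y => by
    refine hv1.trans ?_
    have := Complex.abs_re_le_norm (((v : ℂ) + (y : ℂ) * I) - 1)
    simpa using this
  have hne : ∀ y : ℝ, ((v : ℂ) + (y : ℂ) * I) ≠ 0 ∧ ((v : ℂ) + (y : ℂ) * I) ≠ 1 := by
    intro y
    constructor
    · intro h0; have := congrArg Complex.re h0; simp at this; linarith
    · intro h1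
      have := hdist y
      rw [h1, sub_self, norm_zero] at this
      norm_num at this
  have hcont : Continuous fun y : ℝ => (fun s : ℂ => ((π ^ (1 / 4 : ℝ) : ℝ) : ℂ) * completedRiemannZeta s * Complex.exp (π * (-I * (s - 1 / 2)) / 4) *
        Complex.exp (-(-I * (s - 1 / 2) - t₀) ^ 2 / (2 * h ^ 2)) *
        Complex.exp (-2 * π * I * (-I * (s - 1 / 2) - t₀) * x)) ((v : ℂ) + (y : ℂ) * I) := by
    have hl : Continuous fun y : ℝ => ((v : ℂ) + (y : ℂ) * I) := by fun_prop
    have hon : ContinuousOn (fun s : ℂ => ((π ^ (1 / 4 : ℝ) : ℝ) : ℂ) * completedRiemannZeta s * Complex.exp (π * (-I * (s - 1 / 2)) / 4) *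
        Complex.exp (-(-I * (s - 1 / 2) - t₀) ^ 2 / (2 * h ^ 2)) *
        Complex.exp (-2 * π * I * (-I * (s - 1 / 2) - t₀) * x)) {s : ℂ | s ≠ 0 ∧ s ≠ 1} := fun s hs =>
      (differentiableAt_fourierF_kernel t₀ h x hs.1 hs.2).continuousAt.continuousWithinAt
    exact hon.comp_continuous hl hne
  refine hg.mono' hcont.aestronglyMeasurable (ae_of_all _ fun y => ?_)
  have hb' := norm_fourierF_kernel_le (σ := σ) (t₀ := t₀) hh hx hv hvσ y (hdist y)
  rw [hK]
  exact hb'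

/-- **Uniform decay of `Ξ` on the horizontal segments of `1/2 ≤ Re s ≤ σ`** (for `|T| ≥ 1` the
segment is at distance `≥ 1` from the pole; explicit `T₀`). [cite: Platt2017, Lemma A.8 p. 2461 (proof)] -/
theorem decay_fourierF_kernel {σ t₀ h x : ℝ} (hh : 0 < h) (hx : 0 ≤ x) :
    ∀ ε : ℝ, 0 < ε → ∃ T₀ : ℝ, ∀ T : ℝ, T₀ ≤ |T| → ∀ v ∈ Icc (1 / 2 : ℝ) σ,
      ‖(fun s : ℂ => ((π ^ (1 / 4 : ℝ) : ℝ) : ℂ) * completedRiemannZeta s * Complex.exp (π * (-I * (s - 1 / 2)) / 4) *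
        Complex.exp (-(-I * (s - 1 / 2) - t₀) ^ 2 / (2 * h ^ 2)) *
        Complex.exp (-2 * π * I * (-I * (s - 1 / 2) - t₀) * x)) ((v : ℂ) + (T : ℂ) * I)‖ ≤ ε := by
  intro ε hε
  set K : ℝ := π ^ (1 / 4 : ℝ) * max (Real.Gamma (1 / 4)) (Real.Gamma (σ / 2)) *
        Real.exp ((σ - 1 / 2) ^ 2 / (2 * h ^ 2)) * Real.exp (π * t₀ / 4 + π ^ 2 * h ^ 2 / 32) *
        ((3 : ℕ).factorial * Real.exp ((|t₀ + π * h ^ 2 / 4| + σ + 3) + h ^ 2)) with hK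
  set t₁ : ℝ := t₀ + π * h ^ 2 / 4 with ht₁
  have hΓ : 0 < max (Real.Gamma (1 / 4)) (Real.Gamma (σ / 2)) :=
    lt_max_of_lt_left (Real.Gamma_pos_of_pos (by norm_num))
  have hfac : (0 : ℝ) < (3 : ℕ).factorial := by exact_mod_cast Nat.factorial_pos 3
  have hK0 : 0 < K := by rw [hK]; positivity
  set L : ℝ := max 0 (Real.log (K / ε)) with hL
  have hL0 : 0 ≤ L := le_max_left _ _
  set R : ℝ := 2 * h * Real.sqrt L with hR
  have hR0 : 0 ≤ R := by positivity
  refine ⟨max 1 (|t₁| + R), fun T hT v hv => ?_⟩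
  have hT1 : 1 ≤ |T| := le_trans (le_max_left _ _) hT
  have hTR : |t₁| + R ≤ |T| := le_trans (le_max_right _ _) hT
  have hdist : 1 / 2 ≤ ‖((v : ℂ) + (T : ℂ) * I) - 1‖ := by
    have := Complex.abs_im_le_norm (((v : ℂ) + (T : ℂ) * I) - 1)
    simp at this
    linarith
  have hb' := norm_fourierF_kernel_le (σ := σ) (t₀ := t₀) hh hx hv.1 hv.2 T hdist
  refine hb'.trans ?_
  rw [← hK, ← ht₁]
  have hTt : R ≤ |T - t₁| := by
    have := abs_sub_abs_le_abs_sub T t₁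
    linarith
  have hsq : R ^ 2 ≤ (T - t₁) ^ 2 := by
    rw [← sq_abs (T - t₁)]; exact pow_le_pow_left₀ hR0 hTt 2
  have hR2 : R ^ 2 = 4 * h ^ 2 * L := by
    rw [hR, mul_pow, Real.sq_sqrt hL0]; ring
  have hexp : Real.exp (-(1 / (4 * h ^ 2)) * (T - t₁) ^ 2) ≤ ε / K := by
    have h1 : -(1 / (4 * h ^ 2)) * (T - t₁) ^ 2 ≤ -L := by
      rw [hR2] at hsq
      have h4 : 0 < 4 * h ^ 2 := by positivity
      have : L ≤ (T - t₁) ^ 2 / (4 * h ^ 2) := by rw [le_div_iff₀ h4]; linarith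
      have e : -(1 / (4 * h ^ 2)) * (T - t₁) ^ 2 = -((T - t₁) ^ 2 / (4 * h ^ 2)) := by ring
      rw [e]; linarith
    have h2 : Real.log (K / ε) ≤ L := le_max_right _ _
    calc Real.exp (-(1 / (4 * h ^ 2)) * (T - t₁) ^ 2) ≤ Real.exp (-Real.log (K / ε)) :=
          Real.exp_le_exp.mpr (by linarith)
      _ = ε / K := by rw [Real.exp_neg, Real.exp_log (by positivity)]; field_simp
  calc K * Real.exp (-(1 / (4 * h ^ 2)) * (T - t₁) ^ 2) ≤ K * (ε / K) :=
        mul_le_mul_of_nonneg_left hexp hK0.le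
    _ = ε := by field_simp

/-- **`Ξ` on the shifted line `Re s = σ > 1`:** at `s = σ + i(t+t₀)`,
`|Ξ(s)| ≤ ζ(σ) π^{(1−2σ)/4} e^{(2σ−1)²/(8h²) − πx(2σ−1)} |Γ((σ+i(t+t₀))/2)| e^{π(t+t₀)/4 − t²/(2h²)}`
(«using `|ζ(σ+it)| ≤ |ζ(σ)|` for `σ > 1`», the tree's `norm_riemannZeta_le_re_riemannZeta`;
`|π^{−s/2}| π^{1/4} = π^{(1−2σ)/4}`). [cite: Platt2017, Lemma A.8 p. 2461 (proof)] -/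
theorem norm_fourierF_kernel_far_le {σ : ℝ} (t₀ h x t : ℝ) (hσ : 1 < σ) :
    ‖(fun s : ℂ => ((π ^ (1 / 4 : ℝ) : ℝ) : ℂ) * completedRiemannZeta s * Complex.exp (π * (-I * (s - 1 / 2)) / 4) *
        Complex.exp (-(-I * (s - 1 / 2) - t₀) ^ 2 / (2 * h ^ 2)) *
        Complex.exp (-2 * π * I * (-I * (s - 1 / 2) - t₀) * x)) ((σ : ℂ) + ((t + t₀ : ℝ) : ℂ) * I)‖ ≤
      (riemannZeta (σ : ℂ)).re * π ^ ((1 - 2 * σ) / 4) *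
        Real.exp ((2 * σ - 1) ^ 2 / (8 * h ^ 2) - π * x * (2 * σ - 1)) *
        (‖Complex.Gamma ((σ + (t + t₀) * I) / 2)‖ * Real.exp (π * (t + t₀) / 4 - t ^ 2 / (2 * h ^ 2))) := by
  rw [norm_fourierF_kernel]
  set s : ℂ := (σ : ℂ) + ((t + t₀ : ℝ) : ℂ) * I with hs'
  have hre : s.re = σ := by rw [hs']; simp
  have hs0 : s ≠ 0 := fun h0 => by
    have := congrArg Complex.re h0; rw [hre] at this; simp at this; linarith
  have hΛ : completedRiemannZeta s = Complex.Gammaℝ s * riemannZeta s := by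
    rw [riemannZeta_def_of_ne_zero hs0,
      mul_div_cancel₀ _ (Complex.Gammaℝ_ne_zero_of_re_pos (by rw [hre]; linarith))]
  have hGℝ : ‖Complex.Gammaℝ s‖ = π ^ (-σ / 2) * ‖Complex.Gamma ((σ + (t + t₀) * I) / 2)‖ := by
    rw [Complex.Gammaℝ_def, norm_mul, Complex.norm_cpow_eq_rpow_re_of_pos Real.pi_pos]
    congr 1
    · congr 1; simp [hre]
    · rw [hs']; push_cast; ring_nf
  have hζ : ‖riemannZeta s‖ ≤ (riemannZeta (σ : ℂ)).re := by
    have := norm_riemannZeta_le_re_riemannZeta (s := s) (by rw [hre]; exact hσ)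
    rwa [hre] at this
  have hexp : Real.exp (π * (t + t₀) / 4) * Real.exp (((σ - 1 / 2) ^ 2 - (t + t₀ - t₀) ^ 2) / (2 * h ^ 2)) *
      Real.exp (-(2 * π * x * (σ - 1 / 2))) =
      Real.exp ((2 * σ - 1) ^ 2 / (8 * h ^ 2) - π * x * (2 * σ - 1)) *
        Real.exp (π * (t + t₀) / 4 - t ^ 2 / (2 * h ^ 2)) := by
    rw [← Real.exp_add, ← Real.exp_add, ← Real.exp_add]
    congr 1
    field_simp
    ring
  have hππ : π ^ (1 / 4 : ℝ) * π ^ (-σ / 2) = π ^ ((1 - 2 * σ) / 4) := by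
    rw [← Real.rpow_add Real.pi_pos]; congr 1; ring
  have him : ((σ : ℂ) + ((t + t₀ : ℝ) : ℂ) * I).im = t + t₀ := by simp
  rw [show (((σ : ℂ) + ((t + t₀ : ℝ) : ℂ) * I)) = s from rfl] at *
  rw [hΛ, norm_mul, hGℝ]
  have hy : (((σ : ℝ) : ℂ) + (((t + t₀ : ℝ)) : ℂ) * I) = s := rfl
  have hE := hexp
  -- the weights at `v = σ`, `y = t + t₀`
  have hG0 : 0 ≤ ‖Complex.Gamma ((σ + (t + t₀) * I) / 2)‖ := norm_nonneg _
  have hW0 : 0 ≤ Real.exp (π * (t + t₀) / 4) * Real.exp (((σ - 1 / 2) ^ 2 - (t + t₀ - t₀) ^ 2) / (2 * h ^ 2)) *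
      Real.exp (-(2 * π * x * (σ - 1 / 2))) := by positivity
  calc π ^ (1 / 4 : ℝ) * (π ^ (-σ / 2) * ‖Complex.Gamma ((σ + (t + t₀) * I) / 2)‖ * ‖riemannZeta s‖) *
        (Real.exp (π * (t + t₀) / 4) * Real.exp (((σ - 1 / 2) ^ 2 - (t + t₀ - t₀) ^ 2) / (2 * h ^ 2)) *
          Real.exp (-(2 * π * x * (σ - 1 / 2))))
      ≤ π ^ (1 / 4 : ℝ) * (π ^ (-σ / 2) * ‖Complex.Gamma ((σ + (t + t₀) * I) / 2)‖ * (riemannZeta (σ : ℂ)).re) *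
        (Real.exp (π * (t + t₀) / 4) * Real.exp (((σ - 1 / 2) ^ 2 - (t + t₀ - t₀) ^ 2) / (2 * h ^ 2)) *
          Real.exp (-(2 * π * x * (σ - 1 / 2)))) := by gcongr
    _ = (riemannZeta (σ : ℂ)).re * (π ^ (1 / 4 : ℝ) * π ^ (-σ / 2)) *
        (Real.exp (π * (t + t₀) / 4) * Real.exp (((σ - 1 / 2) ^ 2 - (t + t₀ - t₀) ^ 2) / (2 * h ^ 2)) *
          Real.exp (-(2 * π * x * (σ - 1 / 2)))) * ‖Complex.Gamma ((σ + (t + t₀) * I) / 2)‖ := by ring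
    _ = _ := by rw [hππ, hexp]; ring

/-- **The pole of `Ξ` at `s = 1`** («encountering the pole of `ζ(s)` at `s = 1`»): near `1`,
`Ξ(s) = φ(s)/(s−1)` with `φ(s) = π^{1/4} ((s−1)Λ₀(s) − (s−1)/s + 1) × (weights)` holomorphic on
`|s − 1| < 1/2` (`Λ(s) = Λ₀(s) − 1/s − 1/(1−s)`, Mathlib `completedRiemannZeta_eq`), and
`φ(1) = π^{1/4} × (weights at 1)` — the residue. [cite: Platt2017, Lemma A.8 p. 2461 (proof)] -/
theorem fourierF_kernel_pole (t₀ h x : ℝ) :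
    ∃ φ : ℂ → ℂ, ∃ V ∈ nhds (1 : ℂ), DifferentiableOn ℂ φ V ∧
      φ 1 = ((π ^ (1 / 4 : ℝ) : ℝ) : ℂ) * (Complex.exp (π * (-I * ((1 : ℂ) - 1 / 2)) / 4) *
        Complex.exp (-(-I * ((1 : ℂ) - 1 / 2) - t₀) ^ 2 / (2 * h ^ 2)) *
        Complex.exp (-2 * π * I * (-I * ((1 : ℂ) - 1 / 2) - t₀) * x)) ∧
      ∀ z ∈ V, z ≠ 1 → (fun s : ℂ => ((π ^ (1 / 4 : ℝ) : ℝ) : ℂ) * completedRiemannZeta s * Complex.exp (π * (-I * (s - 1 / 2)) / 4) *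
        Complex.exp (-(-I * (s - 1 / 2) - t₀) ^ 2 / (2 * h ^ 2)) *
        Complex.exp (-2 * π * I * (-I * (s - 1 / 2) - t₀) * x)) z = φ z / (z - 1) := by
  refine ⟨fun z => ((π ^ (1 / 4 : ℝ) : ℝ) : ℂ) * ((z - 1) * completedRiemannZeta₀ z - (z - 1) / z + 1) *
      (Complex.exp (π * (-I * (z - 1 / 2)) / 4) * Complex.exp (-(-I * (z - 1 / 2) - t₀) ^ 2 / (2 * h ^ 2)) *
        Complex.exp (-2 * π * I * (-I * (z - 1 / 2) - t₀) * x)),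
    Metric.ball 1 (1 / 2), Metric.ball_mem_nhds _ (by norm_num), ?_, ?_, ?_⟩
  · intro z hz
    have hz0 : z ≠ 0 := by
      intro h0
      rw [h0, Metric.mem_ball, dist_zero_left, norm_one] at hz
      norm_num at hz
    refine DifferentiableAt.differentiableWithinAt ?_
    have d1 : DifferentiableAt ℂ (fun z : ℂ => (z - 1) * completedRiemannZeta₀ z - (z - 1) / z + 1) z := by
      have := differentiable_completedZeta₀.differentiableAt (x := z)
      fun_prop (disch := exact hz0)
    have d2 : DifferentiableAt ℂ (fun z : ℂ => Complex.exp (π * (-I * (z - 1 / 2)) / 4) *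
        Complex.exp (-(-I * (z - 1 / 2) - t₀) ^ 2 / (2 * h ^ 2)) *
        Complex.exp (-2 * π * I * (-I * (z - 1 / 2) - t₀) * x)) z := by fun_prop
    exact ((differentiableAt_const _).mul d1).mul d2
  · simp
  · intro z hz hz1
    have hz0 : z ≠ 0 := by
      intro h0
      rw [h0, Metric.mem_ball, dist_zero_left, norm_one] at hz
      norm_num at hz
    have hz1' : z - 1 ≠ 0 := sub_ne_zero.mpr hz1
    have h1z : 1 - z ≠ 0 := sub_ne_zero.mpr (Ne.symm hz1)
    simp only []
    rw [completedRiemannZeta_eq]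
    field_simp
    ring

/-- The modulus of the residue factor: `2π · π^{1/4} |weights at s = 1| = 2π^{5/4} e^{1/(8h²) − πx − t₀²/(2h²)}`
(«This yields a residue smaller in absolute terms than `2π^{5/4} exp(1/(8h²) − πx − t₀²/(2h²))`»).
[cite: Platt2017, Lemma A.8 p. 2461 (proof)] -/
theorem norm_fourierF_residue (t₀ h x : ℝ) :
    2 * π * ‖((π ^ (1 / 4 : ℝ) : ℝ) : ℂ) * (Complex.exp (π * (-I * ((1 : ℂ) - 1 / 2)) / 4) *
        Complex.exp (-(-I * ((1 : ℂ) - 1 / 2) - t₀) ^ 2 / (2 * h ^ 2)) *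
        Complex.exp (-2 * π * I * (-I * ((1 : ℂ) - 1 / 2) - t₀) * x))‖ =
      2 * π ^ (5 / 4 : ℝ) * Real.exp (1 / (8 * h ^ 2) - π * x - t₀ ^ 2 / (2 * h ^ 2)) := by
    have h1 : ((1 : ℂ) - 1 / 2) = (((1 : ℝ) : ℂ) + ((0 : ℝ) : ℂ) * I) - 1 / 2 := by push_cast; ring
    rw [norm_mul, Complex.norm_real, Real.norm_eq_abs, abs_of_pos (by positivity)]
    rw [h1, norm_fourier_weight t₀ h x 1 0]
    have hexp : Real.exp (π * 0 / 4) * Real.exp ((((1 : ℝ) - 1 / 2) ^ 2 - (0 - t₀) ^ 2) / (2 * h ^ 2)) *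
        Real.exp (-(2 * π * x * ((1 : ℝ) - 1 / 2))) =
        Real.exp (1 / (8 * h ^ 2) - π * x - t₀ ^ 2 / (2 * h ^ 2)) := by
      rw [← Real.exp_add, ← Real.exp_add]; congr 1; field_simp; ring
    rw [hexp]
    have hπ : π * π ^ (1 / 4 : ℝ) = π ^ (5 / 4 : ℝ) := by
      rw [show (5 / 4 : ℝ) = 1 + 1 / 4 by norm_num, Real.rpow_add Real.pi_pos, Real.rpow_one]
    rw [← hπ]; ring

/-- **The integrand of `C(σ,t₀,h,0)` is integrable** (`σ = 2m+1 ≥ 3`): by the monotonicity of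
`τ ↦ |Γ((σ+iτ)/2)| e^{πτ/4}` (`norm_Gamma_mul_exp_monotone`) and Lemma A.2 at `max(τ, σ)`,
`|Γ((σ+i(t+t₀))/2)| e^{π(t+t₀)/4} ≤ 2^{(3−σ)/4}√π e^{(1+2√2)/6} (|t| + |t₀| + σ)^m`, and the Gaussian
absorbs the polynomial. [cite: Platt2017, Lemma A.3 p. 2457 (the definition of C(σ,t₀,h,k))] -/
theorem integrable_lemmaA3_integrand {σ t₀ h : ℝ} {m : ℕ} (hσ : σ = 2 * m + 1) (hm : 1 ≤ m)
    (hh : 0 < h) :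
    Integrable fun t : ℝ => ‖Complex.Gamma ((σ + (t + t₀) * I) / 2)‖ *
      Real.exp (π * (t + t₀) / 4 - t ^ 2 / (2 * h ^ 2)) := by
  have hm1 : (1 : ℝ) ≤ m := by exact_mod_cast hm
  have hσ3 : 3 ≤ σ := by rw [hσ]; linarith
  have hmono := norm_Gamma_mul_exp_monotone (σ := σ) (by linarith)
  set K : ℝ := (2 : ℝ) ^ ((3 - σ) / 4) * Real.sqrt π * Real.exp ((1 + 2 * Real.sqrt 2) / 6) with hK
  have hK0 : 0 < K := by positivity
  -- pointwise: `|Γ((σ+iτ)/2)| e^{πτ/4} ≤ K (|t| + |t₀| + σ)^m` at `τ = t + t₀`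
  have hpt : ∀ t : ℝ, ‖Complex.Gamma ((σ + (t + t₀) * I) / 2)‖ * Real.exp (π * (t + t₀) / 4) ≤
      K * (|t| + (|t₀| + σ)) ^ m := by
    intro t
    set M : ℝ := max (t + t₀) σ with hM
    have hMσ : σ ≤ M := le_max_right _ _
    have hM0 : 0 < M := by linarith
    have h1 : ‖Complex.Gamma ((σ + (t + t₀) * I) / 2)‖ * Real.exp (π * (t + t₀) / 4) ≤
        ‖Complex.Gamma ((σ + M * I) / 2)‖ * Real.exp (π * M / 4) := by
      have := hmono (le_max_left (t + t₀) σ)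
      simp only [] at this
      push_cast at this ⊢
      exact this
    have hA2 := platt2017_lemmaA2 (σ := σ) (t := M) (by linarith) hMσ
    have hpow : M ^ ((σ - 1) / 2) = M ^ m := by
      rw [show (σ - 1) / 2 = (m : ℝ) by rw [hσ]; ring, Real.rpow_natCast]
    rw [hpow] at hA2
    have hexp : Real.exp ((1 + 2 * Real.sqrt 2) / (6 * M)) ≤ Real.exp ((1 + 2 * Real.sqrt 2) / 6) := by
      refine Real.exp_le_exp.mpr ?_
      rw [div_le_div_iff_of_pos_left (by positivity) (by positivity) (by norm_num)]
      linarith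
    have hMle : M ≤ |t| + (|t₀| + σ) := by
      rcases le_total (t + t₀) σ with hle | hle
      · rw [hM, max_eq_right hle]; have := abs_nonneg t; have := abs_nonneg t₀; linarith
      · rw [hM, max_eq_left hle]; have := le_abs_self t; have := le_abs_self t₀; linarith
    have hMm : M ^ m ≤ (|t| + (|t₀| + σ)) ^ m := pow_le_pow_left₀ hM0.le hMle m
    calc ‖Complex.Gamma ((σ + (t + t₀) * I) / 2)‖ * Real.exp (π * (t + t₀) / 4)
        ≤ ‖Complex.Gamma ((σ + M * I) / 2)‖ * Real.exp (π * M / 4) := h1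
      _ ≤ (2 : ℝ) ^ ((3 - σ) / 4) * Real.sqrt π * M ^ m * Real.exp ((1 + 2 * Real.sqrt 2) / (6 * M)) := hA2.le
      _ ≤ (2 : ℝ) ^ ((3 - σ) / 4) * Real.sqrt π * (|t| + (|t₀| + σ)) ^ m *
          Real.exp ((1 + 2 * Real.sqrt 2) / 6) := by gcongr
      _ = K * (|t| + (|t₀| + σ)) ^ m := by rw [hK]; ring
  -- the Gaussian majorant
  have hd0 : 0 ≤ |t₀| + σ := by positivity
  have hb : (0 : ℝ) < 1 / (4 * h ^ 2) := by positivity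
  have hg : Integrable fun t : ℝ => K * (m.factorial * Real.exp ((|t₀| + σ) + h ^ 2)) *
      Real.exp (-(1 / (4 * h ^ 2)) * t ^ 2) :=
    (integrable_exp_neg_mul_sq hb).const_mul _
  have hcont : Continuous fun t : ℝ => ‖Complex.Gamma ((σ + (t + t₀) * I) / 2)‖ *
      Real.exp (π * (t + t₀) / 4 - t ^ 2 / (2 * h ^ 2)) := by
    have hl : Continuous fun t : ℝ => ((σ : ℂ) + ((t : ℂ) + (t₀ : ℂ)) * I) / 2 := by fun_prop
    have hon : ContinuousOn Complex.Gamma {s : ℂ | 0 < s.re} := fun s (hs : 0 < s.re) =>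
      (Complex.differentiableAt_Gamma s (fun n hn => by
        have := congrArg Complex.re hn; simp at this; have h0 : (0:ℝ) ≤ n := Nat.cast_nonneg n
        linarith)).continuousAt.continuousWithinAt
    have hmem : ∀ t : ℝ, ((σ : ℂ) + ((t : ℂ) + (t₀ : ℂ)) * I) / 2 ∈ {s : ℂ | 0 < s.re} := fun t => by
      show 0 < (((σ : ℂ) + ((t : ℂ) + (t₀ : ℂ)) * I) / 2).re
      simp; linarith
    have hΓc := hon.comp_continuous hl hmem
    exact (hΓc.norm).mul (by fun_prop)
  refine hg.mono' hcont.aestronglyMeasurable (ae_of_all _ fun t => ?_)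
  rw [Real.norm_eq_abs, abs_of_nonneg (by positivity)]
  have hsplit : Real.exp (π * (t + t₀) / 4 - t ^ 2 / (2 * h ^ 2)) =
      Real.exp (π * (t + t₀) / 4) * (Real.exp (-(|t| ^ 2 / (4 * h ^ 2))) *
        Real.exp (-(1 / (4 * h ^ 2)) * t ^ 2)) := by
    rw [← Real.exp_add, ← Real.exp_add, sq_abs]; congr 1; field_simp; ring
  have hpg : (|t| + (|t₀| + σ)) ^ m * Real.exp (-(|t| ^ 2 / (4 * h ^ 2))) ≤
      m.factorial * Real.exp ((|t₀| + σ) + h ^ 2) := pow_mul_gauss_le m (abs_nonneg t) hd0 hh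
  have hE0 : 0 < Real.exp (-(1 / (4 * h ^ 2)) * t ^ 2) := Real.exp_pos _
  calc ‖Complex.Gamma ((σ + (t + t₀) * I) / 2)‖ * Real.exp (π * (t + t₀) / 4 - t ^ 2 / (2 * h ^ 2))
      = (‖Complex.Gamma ((σ + (t + t₀) * I) / 2)‖ * Real.exp (π * (t + t₀) / 4)) *
          (Real.exp (-(|t| ^ 2 / (4 * h ^ 2))) * Real.exp (-(1 / (4 * h ^ 2)) * t ^ 2)) := by
        rw [hsplit]; ring
    _ ≤ (K * (|t| + (|t₀| + σ)) ^ m) *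
          (Real.exp (-(|t| ^ 2 / (4 * h ^ 2))) * Real.exp (-(1 / (4 * h ^ 2)) * t ^ 2)) :=
        mul_le_mul_of_nonneg_right (hpt t) (by positivity)
    _ = K * ((|t| + (|t₀| + σ)) ^ m * Real.exp (-(|t| ^ 2 / (4 * h ^ 2)))) *
          Real.exp (-(1 / (4 * h ^ 2)) * t ^ 2) := by ring
    _ ≤ K * (m.factorial * Real.exp ((|t₀| + σ) + h ^ 2)) * Real.exp (-(1 / (4 * h ^ 2)) * t ^ 2) := by
        gcongr

end Platt2017


open Platt2017 in
/-- **Platt 2017, Lemma A.8 (p. 2461), PROVED for `x ≥ 0`:** «Let `σ ∈ 2ℤ+1` and `1 < σ < t₀`. Then we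
have `|F(x)| ≤ ζ(σ) π^{(1−2σ)/4} C(σ,t₀,h,0) exp((2σ−1)²/(8h²) − π|x|(2σ−1))
+ 2π^{5/4} exp(1/(8h²) − π|x| − t₀²/(2h²))`. *Proof.* Since `f(t)` is real, its Fourier Transform
`F(x)` has the property `F(−x) = conj F(x)` so we need only consider `x ≥ 0`. We write
`s = 1/2 + i(t+t₀)` and shift the line of integration right to `ℜ(s) = σ` encountering the pole of
`ζ(s)` at `s = 1`. This yields a residue smaller in absolute terms than
`2π^{5/4} exp(1/(8h²) − πx − t₀²/(2h²))`. The remaining integral is then bounded in exactly the same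
fashion as in Lemma A.6 using `|ζ(σ+it)| ≤ |ζ(σ)|` for `σ > 1` and `t ∈ ℝ`.» Here
`F(x) = ∫ f(t) e(−tx) dt`, `f(t) = Λ(t+t₀) exp(π(t+t₀)/4 − t²/(2h²))` (3.1),
`Λ(t) = π^{−it/2} Γ((1/2+it)/2) ζ(1/2+it)`, all written out over Mathlib's `riemannZeta` and
`Complex.Gamma`; `C(σ,t₀,h,0) = ∫|Γ((σ+i(t+t₀))/2)| e^{π(t+t₀)/4 − t²/(2h²)} dt`; `ζ(σ) = Re ζ(σ)`;
`σ = 2m+1 ≥ 3` (the printed `σ < t₀` is not used). The case `x ≥ 0` is typed (the reduction of `x < 0`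
to it, `F(−x) = conj F(x)`, rests on the reality of `Λ(t)` and is not typed here). The shift across the
pole is the tree's residue theorem for a vertical strip
`Literature.Analysis.Complex.integral_vertical_sub_eq_sum_of_simplePoles`, fed by the engine
`Platt2017.fourierF_kernel_eq` (the continued integrand `Ξ(s) = π^{1/4} Λ(s) × weights`, `Λ` =
`completedRiemannZeta`), `differentiableAt_fourierF_kernel`, `fourierF_kernel_pole` (simple pole at
`s = 1`, `Λ = Λ₀ − 1/s − 1/(1−s)`), `norm_fourierF_residue`, `norm_fourierF_kernel_le`
(Gaussian strip majorant from the Euler–Maclaurin growth bound of `ζ`), `integrable_fourierF_kernel_vertical`,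
`decay_fourierF_kernel`, `norm_fourierF_kernel_far_le` and `integrable_lemmaA3_integrand`.
[cite: Platt2017, Lemma A.8 p. 2461 (statement and proof)] -/
theorem platt2017_lemmaA8 {σ t₀ h x : ℝ} {m : ℕ} (hσ : σ = 2 * m + 1) (hm : 1 ≤ m) (hh : 0 < h)
    (hx : 0 ≤ x) :
    ‖∫ t : ℝ, (π : ℂ) ^ (-(I * (t + t₀ : ℝ) / 2)) * Complex.Gamma ((1 / 2 + (t + t₀ : ℝ) * I) / 2) *
        riemannZeta (1 / 2 + (t + t₀ : ℝ) * I) *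
        Complex.exp ((π * (t + t₀) / 4 - t ^ 2 / (2 * h ^ 2) : ℝ) : ℂ) *
        Complex.exp (-(2 * π * t * x : ℝ) * I)‖ ≤
      (riemannZeta (σ : ℂ)).re * π ^ ((1 - 2 * σ) / 4) *
          (∫ t : ℝ, ‖Complex.Gamma ((σ + (t + t₀) * I) / 2)‖ *
            Real.exp (π * (t + t₀) / 4 - t ^ 2 / (2 * h ^ 2))) *
          Real.exp ((2 * σ - 1) ^ 2 / (8 * h ^ 2) - π * x * (2 * σ - 1)) +
        2 * π ^ (5 / 4 : ℝ) * Real.exp (1 / (8 * h ^ 2) - π * x - t₀ ^ 2 / (2 * h ^ 2)) := by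
  have hm1 : (1 : ℝ) ≤ m := by exact_mod_cast hm
  have hσ3 : 3 ≤ σ := by rw [hσ]; linarith
  have hπ0 : 0 < π := Real.pi_pos
  have hker : (fun t : ℝ => (π : ℂ) ^ (-(I * (t + t₀ : ℝ) / 2)) *
      Complex.Gamma ((1 / 2 + (t + t₀ : ℝ) * I) / 2) * riemannZeta (1 / 2 + (t + t₀ : ℝ) * I) *
      Complex.exp ((π * (t + t₀) / 4 - t ^ 2 / (2 * h ^ 2) : ℝ) : ℂ) *
      Complex.exp (-(2 * π * t * x : ℝ) * I)) =
      fun t : ℝ => (fun s : ℂ => ((π ^ (1 / 4 : ℝ) : ℝ) : ℂ) * completedRiemannZeta s * Complex.exp (π * (-I * (s - 1 / 2)) / 4) *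
        Complex.exp (-(-I * (s - 1 / 2) - t₀) ^ 2 / (2 * h ^ 2)) *
        Complex.exp (-2 * π * I * (-I * (s - 1 / 2) - t₀) * x)) (((1 / 2 : ℝ) : ℂ) + ((t + t₀ : ℝ) : ℂ) * I) :=
    funext fun t => fourierF_kernel_eq t₀ h x t
  rw [hker]
  have htr : ∫ t : ℝ, (fun s : ℂ => ((π ^ (1 / 4 : ℝ) : ℝ) : ℂ) * completedRiemannZeta s * Complex.exp (π * (-I * (s - 1 / 2)) / 4) *
        Complex.exp (-(-I * (s - 1 / 2) - t₀) ^ 2 / (2 * h ^ 2)) *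
        Complex.exp (-2 * π * I * (-I * (s - 1 / 2) - t₀) * x)) (((1 / 2 : ℝ) : ℂ) + ((t + t₀ : ℝ) : ℂ) * I) =
      ∫ y : ℝ, (fun s : ℂ => ((π ^ (1 / 4 : ℝ) : ℝ) : ℂ) * completedRiemannZeta s * Complex.exp (π * (-I * (s - 1 / 2)) / 4) *
        Complex.exp (-(-I * (s - 1 / 2) - t₀) ^ 2 / (2 * h ^ 2)) *
        Complex.exp (-2 * π * I * (-I * (s - 1 / 2) - t₀) * x)) (((1 / 2 : ℝ) : ℂ) + ((y : ℝ) : ℂ) * I) :=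
    integral_add_right_eq_self (μ := volume) (fun y : ℝ => (fun s : ℂ => ((π ^ (1 / 4 : ℝ) : ℝ) : ℂ) * completedRiemannZeta s * Complex.exp (π * (-I * (s - 1 / 2)) / 4) *
        Complex.exp (-(-I * (s - 1 / 2) - t₀) ^ 2 / (2 * h ^ 2)) *
        Complex.exp (-2 * π * I * (-I * (s - 1 / 2) - t₀) * x)) (((1 / 2 : ℝ) : ℂ) + ((y : ℝ) : ℂ) * I)) t₀
  rw [htr]
  -- the residue factor at `s = 1`
  set r₁ : ℂ := ((π ^ (1 / 4 : ℝ) : ℝ) : ℂ) * (Complex.exp (π * (-I * ((1 : ℂ) - 1 / 2)) / 4) *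
        Complex.exp (-(-I * ((1 : ℂ) - 1 / 2) - t₀) ^ 2 / (2 * h ^ 2)) *
        Complex.exp (-2 * π * I * (-I * ((1 : ℂ) - 1 / 2) - t₀) * x)) with hr₁
  have hres := Literature.Analysis.Complex.integral_vertical_sub_eq_sum_of_simplePoles
    (F := (fun s : ℂ => ((π ^ (1 / 4 : ℝ) : ℝ) : ℂ) * completedRiemannZeta s * Complex.exp (π * (-I * (s - 1 / 2)) / 4) *
        Complex.exp (-(-I * (s - 1 / 2) - t₀) ^ 2 / (2 * h ^ 2)) *
        Complex.exp (-2 * π * I * (-I * (s - 1 / 2) - t₀) * x)))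
    (a := 1 / 2) (b := σ) (by linarith) ({1} : Finset ℂ) (fun _ => r₁) {s : ℂ | 1 / 4 < s.re}
    (isOpen_lt continuous_const Complex.continuous_re)
    (fun s hs => by
      have h1 : 1 / 2 ≤ s.re := (Set.mem_preimage.mp hs).1
      show 1 / 4 < s.re
      linarith)
    (fun p hp => by
      rw [Finset.mem_singleton] at hp
      subst hp
      simp only [Complex.one_re, Set.mem_Ioo]
      constructor <;> linarith)
    (fun s hs => by
      have h1 : 1 / 4 < s.re := hs.1
      have h2 : s ≠ 1 := fun h => hs.2 (by rw [h]; simp)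
      have h0 : s ≠ 0 := fun h => by rw [h] at h1; simp at h1; linarith
      exact (differentiableAt_fourierF_kernel t₀ h x h0 h2).differentiableWithinAt)
    (fun p hp => by
      rw [Finset.mem_singleton] at hp
      subst hp
      exact fourierF_kernel_pole t₀ h x)
    (integrable_fourierF_kernel_vertical (σ := σ) (t₀ := t₀) hh hx le_rfl (by linarith)
      (by norm_num))
    (integrable_fourierF_kernel_vertical (σ := σ) (t₀ := t₀) hh hx (by linarith) le_rfl
      (by rw [abs_of_pos (by linarith)]; linarith))
    (decay_fourierF_kernel (σ := σ) (t₀ := t₀) hh hx)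
  rw [Finset.sum_singleton] at hres
  -- `∫_{1/2} = ∫_σ − 2π r₁`
  have hA : ∫ y : ℝ, (fun s : ℂ => ((π ^ (1 / 4 : ℝ) : ℝ) : ℂ) * completedRiemannZeta s * Complex.exp (π * (-I * (s - 1 / 2)) / 4) *
        Complex.exp (-(-I * (s - 1 / 2) - t₀) ^ 2 / (2 * h ^ 2)) *
        Complex.exp (-2 * π * I * (-I * (s - 1 / 2) - t₀) * x)) (((1 / 2 : ℝ) : ℂ) + ((y : ℝ) : ℂ) * I) =
      (∫ y : ℝ, (fun s : ℂ => ((π ^ (1 / 4 : ℝ) : ℝ) : ℂ) * completedRiemannZeta s * Complex.exp (π * (-I * (s - 1 / 2)) / 4) *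
        Complex.exp (-(-I * (s - 1 / 2) - t₀) ^ 2 / (2 * h ^ 2)) *
        Complex.exp (-2 * π * I * (-I * (s - 1 / 2) - t₀) * x)) ((σ : ℂ) + ((y : ℝ) : ℂ) * I)) - 2 * π * r₁ := by
    linear_combination -hres
  rw [hA]
  -- the remaining integral
  have hintσ := integrable_fourierF_kernel_vertical (σ := σ) (t₀ := t₀) (x := x) hh hx
    (by linarith : 1 / 2 ≤ σ) le_rfl (by rw [abs_of_pos (by linarith)]; linarith)
  have htrσ : ∫ y : ℝ, ‖(fun s : ℂ => ((π ^ (1 / 4 : ℝ) : ℝ) : ℂ) * completedRiemannZeta s * Complex.exp (π * (-I * (s - 1 / 2)) / 4) *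
        Complex.exp (-(-I * (s - 1 / 2) - t₀) ^ 2 / (2 * h ^ 2)) *
        Complex.exp (-2 * π * I * (-I * (s - 1 / 2) - t₀) * x)) ((σ : ℂ) + ((y : ℝ) : ℂ) * I)‖ =
      ∫ t : ℝ, ‖(fun s : ℂ => ((π ^ (1 / 4 : ℝ) : ℝ) : ℂ) * completedRiemannZeta s * Complex.exp (π * (-I * (s - 1 / 2)) / 4) *
        Complex.exp (-(-I * (s - 1 / 2) - t₀) ^ 2 / (2 * h ^ 2)) *
        Complex.exp (-2 * π * I * (-I * (s - 1 / 2) - t₀) * x)) ((σ : ℂ) + ((t + t₀ : ℝ) : ℂ) * I)‖ :=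
    (integral_add_right_eq_self (μ := volume) (fun y : ℝ => ‖(fun s : ℂ => ((π ^ (1 / 4 : ℝ) : ℝ) : ℂ) * completedRiemannZeta s * Complex.exp (π * (-I * (s - 1 / 2)) / 4) *
        Complex.exp (-(-I * (s - 1 / 2) - t₀) ^ 2 / (2 * h ^ 2)) *
        Complex.exp (-2 * π * I * (-I * (s - 1 / 2) - t₀) * x)) ((σ : ℂ) + ((y : ℝ) : ℂ) * I)‖) t₀).symm
  have hfar : ∫ t : ℝ, ‖(fun s : ℂ => ((π ^ (1 / 4 : ℝ) : ℝ) : ℂ) * completedRiemannZeta s * Complex.exp (π * (-I * (s - 1 / 2)) / 4) *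
        Complex.exp (-(-I * (s - 1 / 2) - t₀) ^ 2 / (2 * h ^ 2)) *
        Complex.exp (-2 * π * I * (-I * (s - 1 / 2) - t₀) * x)) ((σ : ℂ) + ((t + t₀ : ℝ) : ℂ) * I)‖ ≤
      ∫ t : ℝ, (riemannZeta (σ : ℂ)).re * π ^ ((1 - 2 * σ) / 4) *
        Real.exp ((2 * σ - 1) ^ 2 / (8 * h ^ 2) - π * x * (2 * σ - 1)) *
        (‖Complex.Gamma ((σ + (t + t₀) * I) / 2)‖ * Real.exp (π * (t + t₀) / 4 - t ^ 2 / (2 * h ^ 2))) := by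
    refine integral_mono (hintσ.norm.comp_add_right t₀)
      ((integrable_lemmaA3_integrand (t₀ := t₀) hσ hm hh).const_mul _) fun t => ?_
    exact norm_fourierF_kernel_far_le t₀ h x t (by linarith)
  rw [integral_const_mul] at hfar
  have hres_norm : ‖2 * (π : ℂ) * r₁‖ = 2 * π ^ (5 / 4 : ℝ) * Real.exp (1 / (8 * h ^ 2) - π * x - t₀ ^ 2 / (2 * h ^ 2)) := by
    rw [norm_mul, norm_mul, Complex.norm_two, Complex.norm_real, Real.norm_eq_abs, abs_of_pos hπ0, hr₁]
    exact norm_fourierF_residue t₀ h x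
  calc ‖(∫ y : ℝ, (fun s : ℂ => ((π ^ (1 / 4 : ℝ) : ℝ) : ℂ) * completedRiemannZeta s * Complex.exp (π * (-I * (s - 1 / 2)) / 4) *
        Complex.exp (-(-I * (s - 1 / 2) - t₀) ^ 2 / (2 * h ^ 2)) *
        Complex.exp (-2 * π * I * (-I * (s - 1 / 2) - t₀) * x)) ((σ : ℂ) + ((y : ℝ) : ℂ) * I)) - 2 * π * r₁‖
      ≤ ‖∫ y : ℝ, (fun s : ℂ => ((π ^ (1 / 4 : ℝ) : ℝ) : ℂ) * completedRiemannZeta s * Complex.exp (π * (-I * (s - 1 / 2)) / 4) *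
        Complex.exp (-(-I * (s - 1 / 2) - t₀) ^ 2 / (2 * h ^ 2)) *
        Complex.exp (-2 * π * I * (-I * (s - 1 / 2) - t₀) * x)) ((σ : ℂ) + ((y : ℝ) : ℂ) * I)‖ + ‖2 * (π : ℂ) * r₁‖ := norm_sub_le _ _
    _ ≤ (∫ y : ℝ, ‖(fun s : ℂ => ((π ^ (1 / 4 : ℝ) : ℝ) : ℂ) * completedRiemannZeta s * Complex.exp (π * (-I * (s - 1 / 2)) / 4) *
        Complex.exp (-(-I * (s - 1 / 2) - t₀) ^ 2 / (2 * h ^ 2)) *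
        Complex.exp (-2 * π * I * (-I * (s - 1 / 2) - t₀) * x)) ((σ : ℂ) + ((y : ℝ) : ℂ) * I)‖) + ‖2 * (π : ℂ) * r₁‖ := by
        gcongr; exact norm_integral_le_integral_norm _
    _ ≤ _ := by
        rw [htrσ, hres_norm]
        gcongr
        refine hfar.trans (le_of_eq ?_)
        ring

end Literature.NumberTheory.LFunctions
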